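import Literature.AlgebraicGeometry.HodgeTheory.FermatHodgeCharactersPrimePow
import Literature.AlgebraicGeometry.Shioda1982.KoblitzOgusRelationsTwentyFourPrime
import HarnessLib

/-!
# Koblitz–Ogus relations for the Hodge multisets of level `20p` (Shioda 1982 §3 / Aoki 1983 Prop. 2.2, via Deligne LNM 900 Rem. 7.16 (a))

Topic `Literature/AlgebraicGeometry/Shioda1982`. THEOREMS (no named fact, no `sorry`): the first step towards the levels `m = 20p`
(the levels `4·5·p` of the series `PicardNumber*.lean` / `HodgeQuadruples*Prime.lean`, above `KoblitzOgusRelationsTenPrime` /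
`HodgeQuadruplesTenPrime` (`10p`): T. Shioda, *On the Picard number of a Fermat surface*, J. Fac. Sci. Univ. Tokyo IA **28** (1982)
725–734, Prop. 4 (Q′) p. 729 with `m′ = 10p`, no `γ`, and the level `20` carrying four exceptional orbits): eight explicit,
`p`-independent families of LINEAR RELATIONS satisfied by the multiplicity function of every Hodge multiset
(`FermatCharacter.IsHodgeMultiset`) of level `20p`, `p ≥ 7` prime, in the Chinese-remainder coordinates `ℤ/20p ≅ ℤ/20 × ℤ/p`,
`w ↔ (u, c)` (**`crtPt20`**). Writing `ô(u, c) = #_{(u,c)}(s) − #_{(−u,−c)}(s)` (the tree's `oddCt`), `U = {1,3,7,9,11,13,17,19}`,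
`E₂ = {2,6,14,18}`, `E₄ = {4,8,12,16}`, `F = {5,15}`, for every `c ≢ 0 (mod p)` — one family per odd Dirichlet character
`χ₂₀·ψ` of `(ℤ/20p)ˣ` up to complex conjugation; `χ₂₀` EVEN with `ψ` odd gives a relation `= 0` fibre by fibre, `χ₂₀` ODD with
`ψ` even gives "constant in `c`":

* **`relOne_twentyPrime`** (`χ₂₀ = 1`; fibres `c, 2c, 4c, 5c, 10c, 20c`): `Σ_{u∈U} (ô(u,c) − ô(u,2c) − ô(u,5c) + ô(u,10c))
  + 2Σ_{e∈E₂} (ô(e,2c) − ô(e,4c) − ô(e,10c) + ô(e,20c)) + 2Σ_{f∈E₄} (ô(f,4c) − ô(f,20c)) + 4Σ_{v∈F} (ô(v,5c) − ô(v,10c))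
  + 8(ô(10,10c) − ô(10,20c)) + 8ô(0,20c) = 0`;
* **`relChi5_twentyPrime`** (`χ₂₀ = χ₅ = (·/5)`; fibres `c, 2c, 4c`): `Σ_{u∈U} χ₅(u)(ô(u,c) + ô(u,2c)) + 2Σ_{e∈E₂} χ₅(e/2)(ô(e,2c)
  + ô(e,4c)) + 2Σ_{f∈E₄} χ₅(f/4) ô(f,4c) = 0`;
* **`relOneNine_twentyPrime`**, **`relThreeSeven_twentyPrime`** (`χ₂₀ = χ₋₄χ₄^{±1}`; a SINGLE fibre):
  `ô(1,c) − ô(9,c) − ô(11,c) + ô(19,c) = 0` and `ô(3,c) − ô(7,c) − ô(13,c) + ô(17,c) = 0` (the functions `c ↦ ô(1,c) − ô(9,c)` and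
  `c ↦ ô(3,c) − ô(7,c)` are even in `c`);
* **`gammaM4_twentyPrime`** (`χ₂₀ = χ₋₄`; **`gammaM4Sum20`** `= Σ_{u∈U} χ₋₄(u)(ô(u,c) − ô(u,5c)) + 4(ô(5,5c) − ô(15,5c))` is constant
  in `c ≠ 0`), **`gammaM4Chi5_twentyPrime`** (`χ₂₀ = χ₋₄χ₅`, a SINGLE fibre: **`gammaM4Chi5Sum20`** `= Σ_{u∈{1,3,7,9}} ô(u,c)
  − Σ_{u∈{11,13,17,19}} ô(u,c)` is constant), **`gammaA_twentyPrime`**, **`gammaB_twentyPrime`** (`χ₂₀ = χ₄^{±1}`; fibres `c, 2c, 4c`,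
  coefficients `±1, ±2`: **`gammaASum20`**, **`gammaBSum20`** are constant in `c ≠ 0`).

PROOF (this formalisation's; the printed route is Shioda's inductive structure / Aoki's Prop. 2.2): by the tree's PROVED
`KoblitzOgus.hodge_eq_combination` [Deligne1982HodgeCycles, Rem. 7.16 (a)] the multiplicity function of a Hodge multiset of level `N`
is a `ℚ`-combination of reflection vectors `e_a + e_{−a}` and distribution vectors `D_{M,z} = 𝟙[· ≡ z (M)] − 𝟙[· = (N/M) z]`, `M ∣ N`;
the functionals are odd and annihilate every `D_{M,z}`, `M ∣ 20p` — checked divisor class by divisor class (`M = k`, `k·p` for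
`k ∣ 20`) in coordinates, where each check is a finite computation in `ℤ/20`. WHY THESE (cell `pub-hfermat`,
`code/lit/picard/scope20p*.py`, `pub-hfermat-lit/SCOPING-20p-relations.md`): the space of odd functionals on `ℚ^{ℤ/20p}` annihilating
all `D_{M,z}` has dimension `4(p − 1)`, one per odd character of `(ℤ/20p)ˣ`; solving for all functionals of the shape
`Σ a_{u,λ} ô(u, λc)` (`λ ∣ 20`) in exact arithmetic at `p = 13, 17` and decomposing by the characters of `(ℤ/20)ˣ` gives exactly these
eight (four `= 0`, four constant); `check20p.py`: they hold on all `2659 / 6347 / 8797` Hodge `4`-multisets of the levels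
`140, 220, 260`, the constant ones being `≡ 0` at `220, 260`. They are the input for the classification of the indecomposable Hodge
quadruples of level `20p` (not carried out in this file).

HONEST FRAMING (cell `pub-hfermat`): explicit algebraic cycles for specific Hodge classes on Fermat/Delsarte varieties; residual open
instances listed; no claim on general Hodge. (Surface classes are algebraic by Lefschetz (1,1); this file proves linear identities
that follow from a printed theorem.)

## References
* [Deligne1982HodgeCycles] P. Deligne, *Hodge cycles on abelian varieties*, LNM 900 (1982), Rem. 7.16 (a) (Koblitz–Ogus), through the
  tree's `Literature.NumberTheory.Transcendental.KoblitzOgus.hodge_eq_combination`.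
* [Aoki1983] N. Aoki, *On some arithmetic problems related to the Hodge cycles on the Fermat varieties*, Math. Ann. 266 (1983) 23–54,
  Prop. 2.2 (relations among Hodge cycles under level change).
* [Shioda1982PicardFermat] T. Shioda, J. Fac. Sci. Univ. Tokyo IA 28 (1982) 725–734, §3 p. 727 (the method), Prop. 4 (Q′) p. 729.
* [Shioda1979PJA] T. Shioda, Proc. Japan Acad. 55A (1979), §1 (2) (the Hodge condition).
-/

namespace Literature.AlgebraicGeometry.Shioda1982

open Finset Multiset Literature.AlgebraicGeometry.HodgeTheory Literature.AlgebraicGeometry.HodgeTheory.FermatCharacter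

section TwentyPrime

variable {p : ℕ}

set_option linter.unusedSimpArgs false -- one uniform list of atom rewrites across the generated divisor-class checks (as in `KoblitzOgusRelationsTenPrime`)

/-! ### `ℤ/20p ≅ ℤ/20 × ℤ/p`: Chinese-remainder coordinates -/

/-- The Chinese-remainder isomorphism `ℤ/20p ≃+* ℤ/20 × ℤ/p`. [folklore] -/
private def crt (h : Nat.Coprime 20 p) : ZMod (20 * p) ≃+* ZMod 20 × ZMod p := ZMod.chineseRemainder h

/-- The residue with coordinates `(e, b)`. [folklore] -/
private def pt (h : Nat.Coprime 20 p) (e : ZMod 20) (b : ZMod p) : ZMod (20 * p) := (crt h).symm (e, b)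

/-- First coordinate = residue mod `20`. [folklore] -/
private theorem crt_fst (h : Nat.Coprime 20 p) [NeZero (20 * p)] (w : ZMod (20 * p)) :
    (crt h w).1 = (w.val : ZMod 20) := by
  conv_lhs => rw [← ZMod.natCast_zmod_val w]
  rw [map_natCast, Prod.fst_natCast]

/-- Second coordinate = residue mod `p`. [folklore] -/
private theorem crt_snd (h : Nat.Coprime 20 p) [NeZero (20 * p)] (w : ZMod (20 * p)) :
    (crt h w).2 = (w.val : ZMod p) := by
  conv_lhs => rw [← ZMod.natCast_zmod_val w]
  rw [map_natCast, Prod.snd_natCast]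

/-- `crt (pt e b) = (e, b)`. [folklore] -/
private theorem crt_pt (h : Nat.Coprime 20 p) (e : ZMod 20) (b : ZMod p) : crt h (pt h e b) = (e, b) :=
  (crt h).apply_symm_apply (e, b)

/-- `pt (crt w) = w`. [folklore] -/
private theorem pt_crt (h : Nat.Coprime 20 p) (w : ZMod (20 * p)) : pt h (crt h w).1 (crt h w).2 = w :=
  (crt h).symm_apply_apply w

/-- `pt` is injective. [folklore] -/
private theorem pt_inj (h : Nat.Coprime 20 p) {e e' : ZMod 20} {b b' : ZMod p} :
    pt h e b = pt h e' b' ↔ e = e' ∧ b = b' := by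
  rw [pt, pt, (crt h).symm.injective.eq_iff, Prod.mk.injEq]

/-- `pt` and negation. [folklore] -/
private theorem neg_pt (h : Nat.Coprime 20 p) (e : ZMod 20) (b : ZMod p) : -pt h e b = pt h (-e) (-b) := by
  rw [pt, pt, ← (crt h).symm.map_neg, Prod.neg_mk]

/-- `pt` and natural multiples. [folklore] -/
private theorem natCast_mul_pt (h : Nat.Coprime 20 p) (k : ℕ) (e : ZMod 20) (b : ZMod p) :
    (k : ZMod (20 * p)) * pt h e b = pt h (k * e) (k * b) := by
  rw [pt, pt, ← nsmul_eq_mul, ← _root_.map_nsmul, Prod.smul_mk, nsmul_eq_mul, nsmul_eq_mul]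

/-! ### The Koblitz–Ogus distribution vectors in Chinese-remainder coordinates -/

/-- The Koblitz–Ogus distribution vector of level `M ∣ 20p` through `z` (as in `KoblitzOgus.hodge_eq_combination`):
`w ↦ [w ≡ z (mod M)] − [(20p/M)·z = w]`. [cite: Deligne1982HodgeCycles, Rem. 7.16 (a)] -/
private def koD (N : ℕ) (M : ℕ) (z w : ZMod N) : ℚ :=
  (if w.val % M = z.val % M then (1 : ℚ) else 0) - (if ((N / M : ℕ) : ZMod N) * z = w then 1 else 0)

/-- The divisors of `20p`. [folklore] -/
private theorem eq_of_dvd_twenty_mul_prime (hp : p.Prime) (h7 : 7 ≤ p) {M : ℕ} (hM : M ∣ 20 * p) :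
    M = 1 ∨ M = 2 ∨ M = 4 ∨ M = 5 ∨ M = 10 ∨ M = 20 ∨ M = p ∨ M = 2 * p ∨ M = 4 * p ∨ M = 5 * p ∨ M = 10 * p ∨
      M = 20 * p := by
  obtain ⟨a, b, ha, hb, rfl⟩ := (Nat.dvd_mul.1 hM)
  have ha' : a = 1 ∨ a = 2 ∨ a = 4 ∨ a = 5 ∨ a = 10 ∨ a = 20 := by
    have := Nat.le_of_dvd (by norm_num) ha
    interval_cases a <;> simp_all
  rcases (Nat.dvd_prime hp).1 hb with rfl | rfl <;> rcases ha' with rfl | rfl | rfl | rfl | rfl | rfl <;> simp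

/-- Congruence mod `p` in coordinates. [folklore] -/
private theorem mod_p_iff (h : Nat.Coprime 20 p) [NeZero (20 * p)] (w z : ZMod (20 * p)) :
    w.val % p = z.val % p ↔ (crt h w).2 = (crt h z).2 := by
  rw [crt_snd, crt_snd, ZMod.natCast_eq_natCast_iff']

/-- Congruence mod a divisor `k` of `20` in coordinates. [folklore] -/
private theorem mod_dvd_twenty_iff (h : Nat.Coprime 20 p) [NeZero (20 * p)] {k : ℕ} (hk : k ∣ 20)
    (w z : ZMod (20 * p)) : w.val % k = z.val % k ↔ (crt h w).1.val % k = (crt h z).1.val % k := by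
  rw [crt_fst, crt_fst, ZMod.val_natCast, ZMod.val_natCast, Nat.mod_mod_of_dvd _ hk, Nat.mod_mod_of_dvd _ hk]

/-- Congruence mod `k·p`, `k ∣ 20`, in coordinates. [folklore] -/
private theorem mod_dvd_twenty_mul_iff (h : Nat.Coprime 20 p) [NeZero (20 * p)] {k : ℕ} (hk : k ∣ 20)
    (w z : ZMod (20 * p)) :
    w.val % (k * p) = z.val % (k * p) ↔ (crt h w).1.val % k = (crt h z).1.val % k ∧ (crt h w).2 = (crt h z).2 := by
  have hkp : Nat.Coprime k p := Nat.Coprime.coprime_dvd_left hk h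
  rw [← mod_dvd_twenty_iff h hk, ← mod_p_iff]
  exact (Nat.modEq_and_modEq_iff_modEq_mul hkp).symm

/-- A multiple of `z = pt e b` in coordinates. [folklore] -/
private theorem natCast_mul_eq_pt_iff (h : Nat.Coprime 20 p) (k : ℕ) (ez e : ZMod 20) (bz c : ZMod p) :
    (k : ZMod (20 * p)) * pt h ez bz = pt h e c ↔ (k : ZMod 20) * ez = e ∧ (k : ZMod p) * bz = c := by
  rw [natCast_mul_pt, pt_inj]

/-- A divisor of `20` is non-zero in `ℤ/p` for a prime `p ≥ 7`. [folklore] -/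
private theorem cast_ne_zero (hp : p.Prime) (h7 : 7 ≤ p) {k : ℕ} (hk : k ∣ 20) : (k : ZMod p) ≠ 0 := by
  intro h0
  rw [ZMod.natCast_eq_zero_iff] at h0
  have h20 : p ∣ 4 * 5 := (dvd_trans h0 hk)
  rcases (Nat.Prime.dvd_mul hp).1 h20 with h4 | h5
  · rcases (Nat.Prime.dvd_mul hp).1 (show p ∣ 2 * 2 from h4) with h2 | h2 <;>
      exact absurd (Nat.le_of_dvd (by norm_num) h2) (by omega)
  · exact absurd (Nat.le_of_dvd (by norm_num) h5) (by omega)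

/-- Cancellation of a non-zero numeral factor `g` in an equation `g·A′ = g·B′` of `ℤ/p`, in the orientation used below
(`A = B ↔ B′ = A′`). [folklore] -/
private theorem atom_iff (hp : p.Prime) {g : ℕ} (hg : (g : ZMod p) ≠ 0) {A B A' B' : ZMod p}
    (hA : A = (g : ZMod p) * A') (hB : B = (g : ZMod p) * B') : (A = B ↔ B' = A') := by
  haveI := Fact.mk hp
  constructor
  · intro e; rw [hA, hB] at e; exact (mul_left_cancel₀ hg e).symm
  · intro e; rw [hA, hB, e]

/-! ### The point atoms of the distribution vectors at the fibres `λc`, `λ ∣ 20` -/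

/-- Point atom `20·x = 1·c` reduced by `1`. [folklore] -/
private theorem atm_20_1p (hp : p.Prime) (h7 : 7 ≤ p) (c x : ZMod p) :
    ((20 : ZMod p) * x = c ↔ c = 20 * x) :=
  atom_iff hp (cast_ne_zero hp h7 (k := 1) (by norm_num)) (A' := 20 * x) (B' := c) (by push_cast; ring) (by push_cast; ring)

/-- Point atom `20·x = −1·c` reduced by `1`. [folklore] -/
private theorem atm_20_1n (hp : p.Prime) (h7 : 7 ≤ p) (c x : ZMod p) :
    ((20 : ZMod p) * x = -c ↔ -c = 20 * x) :=
  atom_iff hp (cast_ne_zero hp h7 (k := 1) (by norm_num)) (A' := 20 * x) (B' := -c) (by push_cast; ring) (by push_cast; ring)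

/-- Point atom `20·x = 2·c` reduced by `2`. [folklore] -/
private theorem atm_20_2p (hp : p.Prime) (h7 : 7 ≤ p) (c x : ZMod p) :
    ((20 : ZMod p) * x = 2 * c ↔ c = 10 * x) :=
  atom_iff hp (cast_ne_zero hp h7 (k := 2) (by norm_num)) (A' := 10 * x) (B' := c) (by push_cast; ring) (by push_cast; ring)

/-- Point atom `20·x = −2·c` reduced by `2`. [folklore] -/
private theorem atm_20_2n (hp : p.Prime) (h7 : 7 ≤ p) (c x : ZMod p) :
    ((20 : ZMod p) * x = -(2 * c) ↔ -c = 10 * x) :=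
  atom_iff hp (cast_ne_zero hp h7 (k := 2) (by norm_num)) (A' := 10 * x) (B' := -c) (by push_cast; ring) (by push_cast; ring)

/-- Point atom `20·x = 4·c` reduced by `4`. [folklore] -/
private theorem atm_20_4p (hp : p.Prime) (h7 : 7 ≤ p) (c x : ZMod p) :
    ((20 : ZMod p) * x = 4 * c ↔ c = 5 * x) :=
  atom_iff hp (cast_ne_zero hp h7 (k := 4) (by norm_num)) (A' := 5 * x) (B' := c) (by push_cast; ring) (by push_cast; ring)

/-- Point atom `20·x = −4·c` reduced by `4`. [folklore] -/
private theorem atm_20_4n (hp : p.Prime) (h7 : 7 ≤ p) (c x : ZMod p) :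
    ((20 : ZMod p) * x = -(4 * c) ↔ -c = 5 * x) :=
  atom_iff hp (cast_ne_zero hp h7 (k := 4) (by norm_num)) (A' := 5 * x) (B' := -c) (by push_cast; ring) (by push_cast; ring)

/-- Point atom `20·x = 5·c` reduced by `5`. [folklore] -/
private theorem atm_20_5p (hp : p.Prime) (h7 : 7 ≤ p) (c x : ZMod p) :
    ((20 : ZMod p) * x = 5 * c ↔ c = 4 * x) :=
  atom_iff hp (cast_ne_zero hp h7 (k := 5) (by norm_num)) (A' := 4 * x) (B' := c) (by push_cast; ring) (by push_cast; ring)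

/-- Point atom `20·x = −5·c` reduced by `5`. [folklore] -/
private theorem atm_20_5n (hp : p.Prime) (h7 : 7 ≤ p) (c x : ZMod p) :
    ((20 : ZMod p) * x = -(5 * c) ↔ -c = 4 * x) :=
  atom_iff hp (cast_ne_zero hp h7 (k := 5) (by norm_num)) (A' := 4 * x) (B' := -c) (by push_cast; ring) (by push_cast; ring)

/-- Point atom `20·x = 10·c` reduced by `10`. [folklore] -/
private theorem atm_20_10p (hp : p.Prime) (h7 : 7 ≤ p) (c x : ZMod p) :
    ((20 : ZMod p) * x = 10 * c ↔ c = 2 * x) :=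
  atom_iff hp (cast_ne_zero hp h7 (k := 10) (by norm_num)) (A' := 2 * x) (B' := c) (by push_cast; ring) (by push_cast; ring)

/-- Point atom `20·x = −10·c` reduced by `10`. [folklore] -/
private theorem atm_20_10n (hp : p.Prime) (h7 : 7 ≤ p) (c x : ZMod p) :
    ((20 : ZMod p) * x = -(10 * c) ↔ -c = 2 * x) :=
  atom_iff hp (cast_ne_zero hp h7 (k := 10) (by norm_num)) (A' := 2 * x) (B' := -c) (by push_cast; ring) (by push_cast; ring)

/-- Point atom `20·x = 20·c` reduced by `20`. [folklore] -/
private theorem atm_20_20p (hp : p.Prime) (h7 : 7 ≤ p) (c x : ZMod p) :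
    ((20 : ZMod p) * x = 20 * c ↔ c = x) :=
  atom_iff hp (cast_ne_zero hp h7 (k := 20) (by norm_num)) (A' := x) (B' := c) (by push_cast; ring) (by push_cast; ring)

/-- Point atom `20·x = −20·c` reduced by `20`. [folklore] -/
private theorem atm_20_20n (hp : p.Prime) (h7 : 7 ≤ p) (c x : ZMod p) :
    ((20 : ZMod p) * x = -(20 * c) ↔ -c = x) :=
  atom_iff hp (cast_ne_zero hp h7 (k := 20) (by norm_num)) (A' := x) (B' := -c) (by push_cast; ring) (by push_cast; ring)

/-- Point atom `10·x = 1·c` reduced by `1`. [folklore] -/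
private theorem atm_10_1p (hp : p.Prime) (h7 : 7 ≤ p) (c x : ZMod p) :
    ((10 : ZMod p) * x = c ↔ c = 10 * x) :=
  atom_iff hp (cast_ne_zero hp h7 (k := 1) (by norm_num)) (A' := 10 * x) (B' := c) (by push_cast; ring) (by push_cast; ring)

/-- Point atom `10·x = −1·c` reduced by `1`. [folklore] -/
private theorem atm_10_1n (hp : p.Prime) (h7 : 7 ≤ p) (c x : ZMod p) :
    ((10 : ZMod p) * x = -c ↔ -c = 10 * x) :=
  atom_iff hp (cast_ne_zero hp h7 (k := 1) (by norm_num)) (A' := 10 * x) (B' := -c) (by push_cast; ring) (by push_cast; ring)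

/-- Point atom `10·x = 2·c` reduced by `2`. [folklore] -/
private theorem atm_10_2p (hp : p.Prime) (h7 : 7 ≤ p) (c x : ZMod p) :
    ((10 : ZMod p) * x = 2 * c ↔ c = 5 * x) :=
  atom_iff hp (cast_ne_zero hp h7 (k := 2) (by norm_num)) (A' := 5 * x) (B' := c) (by push_cast; ring) (by push_cast; ring)

/-- Point atom `10·x = −2·c` reduced by `2`. [folklore] -/
private theorem atm_10_2n (hp : p.Prime) (h7 : 7 ≤ p) (c x : ZMod p) :
    ((10 : ZMod p) * x = -(2 * c) ↔ -c = 5 * x) :=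
  atom_iff hp (cast_ne_zero hp h7 (k := 2) (by norm_num)) (A' := 5 * x) (B' := -c) (by push_cast; ring) (by push_cast; ring)

/-- Point atom `10·x = 4·c` reduced by `2`. [folklore] -/
private theorem atm_10_4p (hp : p.Prime) (h7 : 7 ≤ p) (c x : ZMod p) :
    ((10 : ZMod p) * x = 4 * c ↔ 2 * c = 5 * x) :=
  atom_iff hp (cast_ne_zero hp h7 (k := 2) (by norm_num)) (A' := 5 * x) (B' := 2 * c) (by push_cast; ring) (by push_cast; ring)

/-- Point atom `10·x = −4·c` reduced by `2`. [folklore] -/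
private theorem atm_10_4n (hp : p.Prime) (h7 : 7 ≤ p) (c x : ZMod p) :
    ((10 : ZMod p) * x = -(4 * c) ↔ -(2 * c) = 5 * x) :=
  atom_iff hp (cast_ne_zero hp h7 (k := 2) (by norm_num)) (A' := 5 * x) (B' := -(2 * c)) (by push_cast; ring) (by push_cast; ring)

/-- Point atom `10·x = 5·c` reduced by `5`. [folklore] -/
private theorem atm_10_5p (hp : p.Prime) (h7 : 7 ≤ p) (c x : ZMod p) :
    ((10 : ZMod p) * x = 5 * c ↔ c = 2 * x) :=
  atom_iff hp (cast_ne_zero hp h7 (k := 5) (by norm_num)) (A' := 2 * x) (B' := c) (by push_cast; ring) (by push_cast; ring)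

/-- Point atom `10·x = −5·c` reduced by `5`. [folklore] -/
private theorem atm_10_5n (hp : p.Prime) (h7 : 7 ≤ p) (c x : ZMod p) :
    ((10 : ZMod p) * x = -(5 * c) ↔ -c = 2 * x) :=
  atom_iff hp (cast_ne_zero hp h7 (k := 5) (by norm_num)) (A' := 2 * x) (B' := -c) (by push_cast; ring) (by push_cast; ring)

/-- Point atom `10·x = 10·c` reduced by `10`. [folklore] -/
private theorem atm_10_10p (hp : p.Prime) (h7 : 7 ≤ p) (c x : ZMod p) :
    ((10 : ZMod p) * x = 10 * c ↔ c = x) :=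
  atom_iff hp (cast_ne_zero hp h7 (k := 10) (by norm_num)) (A' := x) (B' := c) (by push_cast; ring) (by push_cast; ring)

/-- Point atom `10·x = −10·c` reduced by `10`. [folklore] -/
private theorem atm_10_10n (hp : p.Prime) (h7 : 7 ≤ p) (c x : ZMod p) :
    ((10 : ZMod p) * x = -(10 * c) ↔ -c = x) :=
  atom_iff hp (cast_ne_zero hp h7 (k := 10) (by norm_num)) (A' := x) (B' := -c) (by push_cast; ring) (by push_cast; ring)

/-- Point atom `10·x = 20·c` reduced by `10`. [folklore] -/
private theorem atm_10_20p (hp : p.Prime) (h7 : 7 ≤ p) (c x : ZMod p) :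
    ((10 : ZMod p) * x = 20 * c ↔ 2 * c = x) :=
  atom_iff hp (cast_ne_zero hp h7 (k := 10) (by norm_num)) (A' := x) (B' := 2 * c) (by push_cast; ring) (by push_cast; ring)

/-- Point atom `10·x = −20·c` reduced by `10`. [folklore] -/
private theorem atm_10_20n (hp : p.Prime) (h7 : 7 ≤ p) (c x : ZMod p) :
    ((10 : ZMod p) * x = -(20 * c) ↔ -(2 * c) = x) :=
  atom_iff hp (cast_ne_zero hp h7 (k := 10) (by norm_num)) (A' := x) (B' := -(2 * c)) (by push_cast; ring) (by push_cast; ring)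

/-- Point atom `5·x = 1·c` reduced by `1`. [folklore] -/
private theorem atm_5_1p (hp : p.Prime) (h7 : 7 ≤ p) (c x : ZMod p) :
    ((5 : ZMod p) * x = c ↔ c = 5 * x) :=
  atom_iff hp (cast_ne_zero hp h7 (k := 1) (by norm_num)) (A' := 5 * x) (B' := c) (by push_cast; ring) (by push_cast; ring)

/-- Point atom `5·x = −1·c` reduced by `1`. [folklore] -/
private theorem atm_5_1n (hp : p.Prime) (h7 : 7 ≤ p) (c x : ZMod p) :
    ((5 : ZMod p) * x = -c ↔ -c = 5 * x) :=
  atom_iff hp (cast_ne_zero hp h7 (k := 1) (by norm_num)) (A' := 5 * x) (B' := -c) (by push_cast; ring) (by push_cast; ring)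

/-- Point atom `5·x = 2·c` reduced by `1`. [folklore] -/
private theorem atm_5_2p (hp : p.Prime) (h7 : 7 ≤ p) (c x : ZMod p) :
    ((5 : ZMod p) * x = 2 * c ↔ 2 * c = 5 * x) :=
  atom_iff hp (cast_ne_zero hp h7 (k := 1) (by norm_num)) (A' := 5 * x) (B' := 2 * c) (by push_cast; ring) (by push_cast; ring)

/-- Point atom `5·x = −2·c` reduced by `1`. [folklore] -/
private theorem atm_5_2n (hp : p.Prime) (h7 : 7 ≤ p) (c x : ZMod p) :
    ((5 : ZMod p) * x = -(2 * c) ↔ -(2 * c) = 5 * x) :=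
  atom_iff hp (cast_ne_zero hp h7 (k := 1) (by norm_num)) (A' := 5 * x) (B' := -(2 * c)) (by push_cast; ring) (by push_cast; ring)

/-- Point atom `5·x = 4·c` reduced by `1`. [folklore] -/
private theorem atm_5_4p (hp : p.Prime) (h7 : 7 ≤ p) (c x : ZMod p) :
    ((5 : ZMod p) * x = 4 * c ↔ 4 * c = 5 * x) :=
  atom_iff hp (cast_ne_zero hp h7 (k := 1) (by norm_num)) (A' := 5 * x) (B' := 4 * c) (by push_cast; ring) (by push_cast; ring)

/-- Point atom `5·x = −4·c` reduced by `1`. [folklore] -/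
private theorem atm_5_4n (hp : p.Prime) (h7 : 7 ≤ p) (c x : ZMod p) :
    ((5 : ZMod p) * x = -(4 * c) ↔ -(4 * c) = 5 * x) :=
  atom_iff hp (cast_ne_zero hp h7 (k := 1) (by norm_num)) (A' := 5 * x) (B' := -(4 * c)) (by push_cast; ring) (by push_cast; ring)

/-- Point atom `5·x = 5·c` reduced by `5`. [folklore] -/
private theorem atm_5_5p (hp : p.Prime) (h7 : 7 ≤ p) (c x : ZMod p) :
    ((5 : ZMod p) * x = 5 * c ↔ c = x) :=
  atom_iff hp (cast_ne_zero hp h7 (k := 5) (by norm_num)) (A' := x) (B' := c) (by push_cast; ring) (by push_cast; ring)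

/-- Point atom `5·x = −5·c` reduced by `5`. [folklore] -/
private theorem atm_5_5n (hp : p.Prime) (h7 : 7 ≤ p) (c x : ZMod p) :
    ((5 : ZMod p) * x = -(5 * c) ↔ -c = x) :=
  atom_iff hp (cast_ne_zero hp h7 (k := 5) (by norm_num)) (A' := x) (B' := -c) (by push_cast; ring) (by push_cast; ring)

/-- Point atom `5·x = 10·c` reduced by `5`. [folklore] -/
private theorem atm_5_10p (hp : p.Prime) (h7 : 7 ≤ p) (c x : ZMod p) :
    ((5 : ZMod p) * x = 10 * c ↔ 2 * c = x) :=
  atom_iff hp (cast_ne_zero hp h7 (k := 5) (by norm_num)) (A' := x) (B' := 2 * c) (by push_cast; ring) (by push_cast; ring)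

/-- Point atom `5·x = −10·c` reduced by `5`. [folklore] -/
private theorem atm_5_10n (hp : p.Prime) (h7 : 7 ≤ p) (c x : ZMod p) :
    ((5 : ZMod p) * x = -(10 * c) ↔ -(2 * c) = x) :=
  atom_iff hp (cast_ne_zero hp h7 (k := 5) (by norm_num)) (A' := x) (B' := -(2 * c)) (by push_cast; ring) (by push_cast; ring)

/-- Point atom `5·x = 20·c` reduced by `5`. [folklore] -/
private theorem atm_5_20p (hp : p.Prime) (h7 : 7 ≤ p) (c x : ZMod p) :
    ((5 : ZMod p) * x = 20 * c ↔ 4 * c = x) :=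
  atom_iff hp (cast_ne_zero hp h7 (k := 5) (by norm_num)) (A' := x) (B' := 4 * c) (by push_cast; ring) (by push_cast; ring)

/-- Point atom `5·x = −20·c` reduced by `5`. [folklore] -/
private theorem atm_5_20n (hp : p.Prime) (h7 : 7 ≤ p) (c x : ZMod p) :
    ((5 : ZMod p) * x = -(20 * c) ↔ -(4 * c) = x) :=
  atom_iff hp (cast_ne_zero hp h7 (k := 5) (by norm_num)) (A' := x) (B' := -(4 * c)) (by push_cast; ring) (by push_cast; ring)

/-- Point atom `4·x = 1·c` reduced by `1`. [folklore] -/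
private theorem atm_4_1p (hp : p.Prime) (h7 : 7 ≤ p) (c x : ZMod p) :
    ((4 : ZMod p) * x = c ↔ c = 4 * x) :=
  atom_iff hp (cast_ne_zero hp h7 (k := 1) (by norm_num)) (A' := 4 * x) (B' := c) (by push_cast; ring) (by push_cast; ring)

/-- Point atom `4·x = −1·c` reduced by `1`. [folklore] -/
private theorem atm_4_1n (hp : p.Prime) (h7 : 7 ≤ p) (c x : ZMod p) :
    ((4 : ZMod p) * x = -c ↔ -c = 4 * x) :=
  atom_iff hp (cast_ne_zero hp h7 (k := 1) (by norm_num)) (A' := 4 * x) (B' := -c) (by push_cast; ring) (by push_cast; ring)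

/-- Point atom `4·x = 2·c` reduced by `2`. [folklore] -/
private theorem atm_4_2p (hp : p.Prime) (h7 : 7 ≤ p) (c x : ZMod p) :
    ((4 : ZMod p) * x = 2 * c ↔ c = 2 * x) :=
  atom_iff hp (cast_ne_zero hp h7 (k := 2) (by norm_num)) (A' := 2 * x) (B' := c) (by push_cast; ring) (by push_cast; ring)

/-- Point atom `4·x = −2·c` reduced by `2`. [folklore] -/
private theorem atm_4_2n (hp : p.Prime) (h7 : 7 ≤ p) (c x : ZMod p) :
    ((4 : ZMod p) * x = -(2 * c) ↔ -c = 2 * x) :=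
  atom_iff hp (cast_ne_zero hp h7 (k := 2) (by norm_num)) (A' := 2 * x) (B' := -c) (by push_cast; ring) (by push_cast; ring)

/-- Point atom `4·x = 4·c` reduced by `4`. [folklore] -/
private theorem atm_4_4p (hp : p.Prime) (h7 : 7 ≤ p) (c x : ZMod p) :
    ((4 : ZMod p) * x = 4 * c ↔ c = x) :=
  atom_iff hp (cast_ne_zero hp h7 (k := 4) (by norm_num)) (A' := x) (B' := c) (by push_cast; ring) (by push_cast; ring)

/-- Point atom `4·x = −4·c` reduced by `4`. [folklore] -/
private theorem atm_4_4n (hp : p.Prime) (h7 : 7 ≤ p) (c x : ZMod p) :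
    ((4 : ZMod p) * x = -(4 * c) ↔ -c = x) :=
  atom_iff hp (cast_ne_zero hp h7 (k := 4) (by norm_num)) (A' := x) (B' := -c) (by push_cast; ring) (by push_cast; ring)

/-- Point atom `4·x = 5·c` reduced by `1`. [folklore] -/
private theorem atm_4_5p (hp : p.Prime) (h7 : 7 ≤ p) (c x : ZMod p) :
    ((4 : ZMod p) * x = 5 * c ↔ 5 * c = 4 * x) :=
  atom_iff hp (cast_ne_zero hp h7 (k := 1) (by norm_num)) (A' := 4 * x) (B' := 5 * c) (by push_cast; ring) (by push_cast; ring)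

/-- Point atom `4·x = −5·c` reduced by `1`. [folklore] -/
private theorem atm_4_5n (hp : p.Prime) (h7 : 7 ≤ p) (c x : ZMod p) :
    ((4 : ZMod p) * x = -(5 * c) ↔ -(5 * c) = 4 * x) :=
  atom_iff hp (cast_ne_zero hp h7 (k := 1) (by norm_num)) (A' := 4 * x) (B' := -(5 * c)) (by push_cast; ring) (by push_cast; ring)

/-- Point atom `4·x = 10·c` reduced by `2`. [folklore] -/
private theorem atm_4_10p (hp : p.Prime) (h7 : 7 ≤ p) (c x : ZMod p) :
    ((4 : ZMod p) * x = 10 * c ↔ 5 * c = 2 * x) :=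
  atom_iff hp (cast_ne_zero hp h7 (k := 2) (by norm_num)) (A' := 2 * x) (B' := 5 * c) (by push_cast; ring) (by push_cast; ring)

/-- Point atom `4·x = −10·c` reduced by `2`. [folklore] -/
private theorem atm_4_10n (hp : p.Prime) (h7 : 7 ≤ p) (c x : ZMod p) :
    ((4 : ZMod p) * x = -(10 * c) ↔ -(5 * c) = 2 * x) :=
  atom_iff hp (cast_ne_zero hp h7 (k := 2) (by norm_num)) (A' := 2 * x) (B' := -(5 * c)) (by push_cast; ring) (by push_cast; ring)

/-- Point atom `4·x = 20·c` reduced by `4`. [folklore] -/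
private theorem atm_4_20p (hp : p.Prime) (h7 : 7 ≤ p) (c x : ZMod p) :
    ((4 : ZMod p) * x = 20 * c ↔ 5 * c = x) :=
  atom_iff hp (cast_ne_zero hp h7 (k := 4) (by norm_num)) (A' := x) (B' := 5 * c) (by push_cast; ring) (by push_cast; ring)

/-- Point atom `4·x = −20·c` reduced by `4`. [folklore] -/
private theorem atm_4_20n (hp : p.Prime) (h7 : 7 ≤ p) (c x : ZMod p) :
    ((4 : ZMod p) * x = -(20 * c) ↔ -(5 * c) = x) :=
  atom_iff hp (cast_ne_zero hp h7 (k := 4) (by norm_num)) (A' := x) (B' := -(5 * c)) (by push_cast; ring) (by push_cast; ring)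

/-- Point atom `2·x = 1·c` reduced by `1`. [folklore] -/
private theorem atm_2_1p (hp : p.Prime) (h7 : 7 ≤ p) (c x : ZMod p) :
    ((2 : ZMod p) * x = c ↔ c = 2 * x) :=
  atom_iff hp (cast_ne_zero hp h7 (k := 1) (by norm_num)) (A' := 2 * x) (B' := c) (by push_cast; ring) (by push_cast; ring)

/-- Point atom `2·x = −1·c` reduced by `1`. [folklore] -/
private theorem atm_2_1n (hp : p.Prime) (h7 : 7 ≤ p) (c x : ZMod p) :
    ((2 : ZMod p) * x = -c ↔ -c = 2 * x) :=
  atom_iff hp (cast_ne_zero hp h7 (k := 1) (by norm_num)) (A' := 2 * x) (B' := -c) (by push_cast; ring) (by push_cast; ring)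

/-- Point atom `2·x = 2·c` reduced by `2`. [folklore] -/
private theorem atm_2_2p (hp : p.Prime) (h7 : 7 ≤ p) (c x : ZMod p) :
    ((2 : ZMod p) * x = 2 * c ↔ c = x) :=
  atom_iff hp (cast_ne_zero hp h7 (k := 2) (by norm_num)) (A' := x) (B' := c) (by push_cast; ring) (by push_cast; ring)

/-- Point atom `2·x = −2·c` reduced by `2`. [folklore] -/
private theorem atm_2_2n (hp : p.Prime) (h7 : 7 ≤ p) (c x : ZMod p) :
    ((2 : ZMod p) * x = -(2 * c) ↔ -c = x) :=
  atom_iff hp (cast_ne_zero hp h7 (k := 2) (by norm_num)) (A' := x) (B' := -c) (by push_cast; ring) (by push_cast; ring)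

/-- Point atom `2·x = 4·c` reduced by `2`. [folklore] -/
private theorem atm_2_4p (hp : p.Prime) (h7 : 7 ≤ p) (c x : ZMod p) :
    ((2 : ZMod p) * x = 4 * c ↔ 2 * c = x) :=
  atom_iff hp (cast_ne_zero hp h7 (k := 2) (by norm_num)) (A' := x) (B' := 2 * c) (by push_cast; ring) (by push_cast; ring)

/-- Point atom `2·x = −4·c` reduced by `2`. [folklore] -/
private theorem atm_2_4n (hp : p.Prime) (h7 : 7 ≤ p) (c x : ZMod p) :
    ((2 : ZMod p) * x = -(4 * c) ↔ -(2 * c) = x) :=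
  atom_iff hp (cast_ne_zero hp h7 (k := 2) (by norm_num)) (A' := x) (B' := -(2 * c)) (by push_cast; ring) (by push_cast; ring)

/-- Point atom `2·x = 5·c` reduced by `1`. [folklore] -/
private theorem atm_2_5p (hp : p.Prime) (h7 : 7 ≤ p) (c x : ZMod p) :
    ((2 : ZMod p) * x = 5 * c ↔ 5 * c = 2 * x) :=
  atom_iff hp (cast_ne_zero hp h7 (k := 1) (by norm_num)) (A' := 2 * x) (B' := 5 * c) (by push_cast; ring) (by push_cast; ring)

/-- Point atom `2·x = −5·c` reduced by `1`. [folklore] -/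
private theorem atm_2_5n (hp : p.Prime) (h7 : 7 ≤ p) (c x : ZMod p) :
    ((2 : ZMod p) * x = -(5 * c) ↔ -(5 * c) = 2 * x) :=
  atom_iff hp (cast_ne_zero hp h7 (k := 1) (by norm_num)) (A' := 2 * x) (B' := -(5 * c)) (by push_cast; ring) (by push_cast; ring)

/-- Point atom `2·x = 10·c` reduced by `2`. [folklore] -/
private theorem atm_2_10p (hp : p.Prime) (h7 : 7 ≤ p) (c x : ZMod p) :
    ((2 : ZMod p) * x = 10 * c ↔ 5 * c = x) :=
  atom_iff hp (cast_ne_zero hp h7 (k := 2) (by norm_num)) (A' := x) (B' := 5 * c) (by push_cast; ring) (by push_cast; ring)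

/-- Point atom `2·x = −10·c` reduced by `2`. [folklore] -/
private theorem atm_2_10n (hp : p.Prime) (h7 : 7 ≤ p) (c x : ZMod p) :
    ((2 : ZMod p) * x = -(10 * c) ↔ -(5 * c) = x) :=
  atom_iff hp (cast_ne_zero hp h7 (k := 2) (by norm_num)) (A' := x) (B' := -(5 * c)) (by push_cast; ring) (by push_cast; ring)

/-- Point atom `2·x = 20·c` reduced by `2`. [folklore] -/
private theorem atm_2_20p (hp : p.Prime) (h7 : 7 ≤ p) (c x : ZMod p) :
    ((2 : ZMod p) * x = 20 * c ↔ 10 * c = x) :=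
  atom_iff hp (cast_ne_zero hp h7 (k := 2) (by norm_num)) (A' := x) (B' := 10 * c) (by push_cast; ring) (by push_cast; ring)

/-- Point atom `2·x = −20·c` reduced by `2`. [folklore] -/
private theorem atm_2_20n (hp : p.Prime) (h7 : 7 ≤ p) (c x : ZMod p) :
    ((2 : ZMod p) * x = -(20 * c) ↔ -(10 * c) = x) :=
  atom_iff hp (cast_ne_zero hp h7 (k := 2) (by norm_num)) (A' := x) (B' := -(10 * c)) (by push_cast; ring) (by push_cast; ring)

/-- All sixty point atoms, bundled for the `simp` sets below. [folklore] -/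
private theorem atoms (hp : p.Prime) (h7 : 7 ≤ p) (c x : ZMod p) :
    ((20 : ZMod p) * x = c ↔ c = 20 * x) ∧
    ((20 : ZMod p) * x = -c ↔ -c = 20 * x) ∧
    ((20 : ZMod p) * x = 2 * c ↔ c = 10 * x) ∧
    ((20 : ZMod p) * x = -(2 * c) ↔ -c = 10 * x) ∧
    ((20 : ZMod p) * x = 4 * c ↔ c = 5 * x) ∧
    ((20 : ZMod p) * x = -(4 * c) ↔ -c = 5 * x) ∧
    ((20 : ZMod p) * x = 5 * c ↔ c = 4 * x) ∧
    ((20 : ZMod p) * x = -(5 * c) ↔ -c = 4 * x) ∧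
    ((20 : ZMod p) * x = 10 * c ↔ c = 2 * x) ∧
    ((20 : ZMod p) * x = -(10 * c) ↔ -c = 2 * x) ∧
    ((20 : ZMod p) * x = 20 * c ↔ c = x) ∧
    ((20 : ZMod p) * x = -(20 * c) ↔ -c = x) ∧
    ((10 : ZMod p) * x = c ↔ c = 10 * x) ∧
    ((10 : ZMod p) * x = -c ↔ -c = 10 * x) ∧
    ((10 : ZMod p) * x = 2 * c ↔ c = 5 * x) ∧
    ((10 : ZMod p) * x = -(2 * c) ↔ -c = 5 * x) ∧
    ((10 : ZMod p) * x = 4 * c ↔ 2 * c = 5 * x) ∧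
    ((10 : ZMod p) * x = -(4 * c) ↔ -(2 * c) = 5 * x) ∧
    ((10 : ZMod p) * x = 5 * c ↔ c = 2 * x) ∧
    ((10 : ZMod p) * x = -(5 * c) ↔ -c = 2 * x) ∧
    ((10 : ZMod p) * x = 10 * c ↔ c = x) ∧
    ((10 : ZMod p) * x = -(10 * c) ↔ -c = x) ∧
    ((10 : ZMod p) * x = 20 * c ↔ 2 * c = x) ∧
    ((10 : ZMod p) * x = -(20 * c) ↔ -(2 * c) = x) ∧
    ((5 : ZMod p) * x = c ↔ c = 5 * x) ∧
    ((5 : ZMod p) * x = -c ↔ -c = 5 * x) ∧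
    ((5 : ZMod p) * x = 2 * c ↔ 2 * c = 5 * x) ∧
    ((5 : ZMod p) * x = -(2 * c) ↔ -(2 * c) = 5 * x) ∧
    ((5 : ZMod p) * x = 4 * c ↔ 4 * c = 5 * x) ∧
    ((5 : ZMod p) * x = -(4 * c) ↔ -(4 * c) = 5 * x) ∧
    ((5 : ZMod p) * x = 5 * c ↔ c = x) ∧
    ((5 : ZMod p) * x = -(5 * c) ↔ -c = x) ∧
    ((5 : ZMod p) * x = 10 * c ↔ 2 * c = x) ∧
    ((5 : ZMod p) * x = -(10 * c) ↔ -(2 * c) = x) ∧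
    ((5 : ZMod p) * x = 20 * c ↔ 4 * c = x) ∧
    ((5 : ZMod p) * x = -(20 * c) ↔ -(4 * c) = x) ∧
    ((4 : ZMod p) * x = c ↔ c = 4 * x) ∧
    ((4 : ZMod p) * x = -c ↔ -c = 4 * x) ∧
    ((4 : ZMod p) * x = 2 * c ↔ c = 2 * x) ∧
    ((4 : ZMod p) * x = -(2 * c) ↔ -c = 2 * x) ∧
    ((4 : ZMod p) * x = 4 * c ↔ c = x) ∧
    ((4 : ZMod p) * x = -(4 * c) ↔ -c = x) ∧
    ((4 : ZMod p) * x = 5 * c ↔ 5 * c = 4 * x) ∧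
    ((4 : ZMod p) * x = -(5 * c) ↔ -(5 * c) = 4 * x) ∧
    ((4 : ZMod p) * x = 10 * c ↔ 5 * c = 2 * x) ∧
    ((4 : ZMod p) * x = -(10 * c) ↔ -(5 * c) = 2 * x) ∧
    ((4 : ZMod p) * x = 20 * c ↔ 5 * c = x) ∧
    ((4 : ZMod p) * x = -(20 * c) ↔ -(5 * c) = x) ∧
    ((2 : ZMod p) * x = c ↔ c = 2 * x) ∧
    ((2 : ZMod p) * x = -c ↔ -c = 2 * x) ∧
    ((2 : ZMod p) * x = 2 * c ↔ c = x) ∧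
    ((2 : ZMod p) * x = -(2 * c) ↔ -c = x) ∧
    ((2 : ZMod p) * x = 4 * c ↔ 2 * c = x) ∧
    ((2 : ZMod p) * x = -(4 * c) ↔ -(2 * c) = x) ∧
    ((2 : ZMod p) * x = 5 * c ↔ 5 * c = 2 * x) ∧
    ((2 : ZMod p) * x = -(5 * c) ↔ -(5 * c) = 2 * x) ∧
    ((2 : ZMod p) * x = 10 * c ↔ 5 * c = x) ∧
    ((2 : ZMod p) * x = -(10 * c) ↔ -(5 * c) = x) ∧
    ((2 : ZMod p) * x = 20 * c ↔ 10 * c = x) ∧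
    ((2 : ZMod p) * x = -(20 * c) ↔ -(10 * c) = x) :=
  ⟨atm_20_1p hp h7 c x, atm_20_1n hp h7 c x, atm_20_2p hp h7 c x, atm_20_2n hp h7 c x, atm_20_4p hp h7 c x, atm_20_4n hp h7 c x, atm_20_5p hp h7 c x, atm_20_5n hp h7 c x, atm_20_10p hp h7 c x, atm_20_10n hp h7 c x, atm_20_20p hp h7 c x, atm_20_20n hp h7 c x, atm_10_1p hp h7 c x, atm_10_1n hp h7 c x, atm_10_2p hp h7 c x, atm_10_2n hp h7 c x, atm_10_4p hp h7 c x, atm_10_4n hp h7 c x, atm_10_5p hp h7 c x, atm_10_5n hp h7 c x, atm_10_10p hp h7 c x, atm_10_10n hp h7 c x, atm_10_20p hp h7 c x, atm_10_20n hp h7 c x, atm_5_1p hp h7 c x, atm_5_1n hp h7 c x, atm_5_2p hp h7 c x, atm_5_2n hp h7 c x, atm_5_4p hp h7 c x, atm_5_4n hp h7 c x, atm_5_5p hp h7 c x, atm_5_5n hp h7 c x, atm_5_10p hp h7 c x, atm_5_10n hp h7 c x, atm_5_20p hp h7 c x, atm_5_20n hp h7 c x, atm_4_1p hp h7 c x,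 atm_4_1n hp h7 c x, atm_4_2p hp h7 c x, atm_4_2n hp h7 c x, atm_4_4p hp h7 c x, atm_4_4n hp h7 c x, atm_4_5p hp h7 c x, atm_4_5n hp h7 c x, atm_4_10p hp h7 c x, atm_4_10n hp h7 c x, atm_4_20p hp h7 c x, atm_4_20n hp h7 c x, atm_2_1p hp h7 c x, atm_2_1n hp h7 c x, atm_2_2p hp h7 c x, atm_2_2n hp h7 c x, atm_2_4p hp h7 c x, atm_2_4n hp h7 c x, atm_2_5p hp h7 c x, atm_2_5n hp h7 c x, atm_2_10p hp h7 c x, atm_2_10n hp h7 c x, atm_2_20p hp h7 c x, atm_2_20n hp h7 c x⟩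

/-- `2c, 4c, 5c, 10c, 20c ≠ 0` for `c ≠ 0` in `ℤ/p`, `p ≥ 7` prime. [folklore] -/
private theorem mul_ne_zero_facts (hp : p.Prime) (h7 : 7 ≤ p) {c : ZMod p} (hc : c ≠ 0) :
    (2 * c ≠ 0) ∧ (4 * c ≠ 0) ∧ (5 * c ≠ 0) ∧ (10 * c ≠ 0) ∧ (20 * c ≠ 0) := by
  haveI := Fact.mk hp
  refine ⟨?_, ?_, ?_, ?_, ?_⟩
  · exact_mod_cast mul_ne_zero (cast_ne_zero hp h7 (k := 2) (by norm_num)) hc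
  · exact_mod_cast mul_ne_zero (cast_ne_zero hp h7 (k := 4) (by norm_num)) hc
  · exact_mod_cast mul_ne_zero (cast_ne_zero hp h7 (k := 5) (by norm_num)) hc
  · exact_mod_cast mul_ne_zero (cast_ne_zero hp h7 (k := 10) (by norm_num)) hc
  · exact_mod_cast mul_ne_zero (cast_ne_zero hp h7 (k := 20) (by norm_num)) hc

/-! ### The eight functionals of level `20p` -/

/-- `ĝ(w) = g(w) − g(−w)`: twice the odd part. [folklore] -/
private def hat (g : ZMod (20 * p) → ℚ) (w : ZMod (20 * p)) : ℚ := g w - g (-w)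

/-- **`R¹(c)`** (trivial character mod `20`, odd `ψ` mod `p`; fibres `c, 2c, 4c, 5c, 10c, 20c`). [folklore] -/
private def R1 (h : Nat.Coprime 20 p) (g : ZMod (20 * p) → ℚ) (c : ZMod p) : ℚ :=
  hat g (pt h 1 c) - hat g (pt h 1 (2 * c)) - hat g (pt h 1 (5 * c)) + hat g (pt h 1 (10 * c)) + hat g (pt h 3 c) -
    hat g (pt h 3 (2 * c)) - hat g (pt h 3 (5 * c)) + hat g (pt h 3 (10 * c)) + hat g (pt h 7 c) - hat g (pt h 7 (2
    * c)) - hat g (pt h 7 (5 * c)) + hat g (pt h 7 (10 * c)) + hat g (pt h 9 c) - hat g (pt h 9 (2 * c)) - hat g (pt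
    h 9 (5 * c)) + hat g (pt h 9 (10 * c)) + hat g (pt h 11 c) - hat g (pt h 11 (2 * c)) - hat g (pt h 11 (5 * c)) +
    hat g (pt h 11 (10 * c)) + hat g (pt h 13 c) - hat g (pt h 13 (2 * c)) - hat g (pt h 13 (5 * c)) + hat g (pt h
    13 (10 * c)) + hat g (pt h 17 c) - hat g (pt h 17 (2 * c)) - hat g (pt h 17 (5 * c)) + hat g (pt h 17 (10 * c))
    + hat g (pt h 19 c) - hat g (pt h 19 (2 * c)) - hat g (pt h 19 (5 * c)) + hat g (pt h 19 (10 * c)) + hat g (pt h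
    2 (2 * c)) + hat g (pt h 2 (2 * c)) - hat g (pt h 2 (4 * c)) - hat g (pt h 2 (4 * c)) - hat g (pt h 2 (10 * c))
    - hat g (pt h 2 (10 * c)) + hat g (pt h 2 (20 * c)) + hat g (pt h 2 (20 * c)) + hat g (pt h 6 (2 * c)) + hat g
    (pt h 6 (2 * c)) - hat g (pt h 6 (4 * c)) - hat g (pt h 6 (4 * c)) - hat g (pt h 6 (10 * c)) - hat g (pt h 6 (10
    * c)) + hat g (pt h 6 (20 * c)) + hat g (pt h 6 (20 * c)) + hat g (pt h 14 (2 * c)) + hat g (pt h 14 (2 * c)) -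
    hat g (pt h 14 (4 * c)) - hat g (pt h 14 (4 * c)) - hat g (pt h 14 (10 * c)) - hat g (pt h 14 (10 * c)) + hat g
    (pt h 14 (20 * c)) + hat g (pt h 14 (20 * c)) + hat g (pt h 18 (2 * c)) + hat g (pt h 18 (2 * c)) - hat g (pt h
    18 (4 * c)) - hat g (pt h 18 (4 * c)) - hat g (pt h 18 (10 * c)) - hat g (pt h 18 (10 * c)) + hat g (pt h 18 (20
    * c)) + hat g (pt h 18 (20 * c)) + hat g (pt h 4 (4 * c)) + hat g (pt h 4 (4 * c)) - hat g (pt h 4 (20 * c)) -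
    hat g (pt h 4 (20 * c)) + hat g (pt h 8 (4 * c)) + hat g (pt h 8 (4 * c)) - hat g (pt h 8 (20 * c)) - hat g (pt
    h 8 (20 * c)) + hat g (pt h 12 (4 * c)) + hat g (pt h 12 (4 * c)) - hat g (pt h 12 (20 * c)) - hat g (pt h 12
    (20 * c)) + hat g (pt h 16 (4 * c)) + hat g (pt h 16 (4 * c)) - hat g (pt h 16 (20 * c)) - hat g (pt h 16 (20 *
    c)) + hat g (pt h 5 (5 * c)) + hat g (pt h 5 (5 * c)) + hat g (pt h 5 (5 * c)) + hat g (pt h 5 (5 * c)) - hat g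
    (pt h 5 (10 * c)) - hat g (pt h 5 (10 * c)) - hat g (pt h 5 (10 * c)) - hat g (pt h 5 (10 * c)) + hat g (pt h 15
    (5 * c)) + hat g (pt h 15 (5 * c)) + hat g (pt h 15 (5 * c)) + hat g (pt h 15 (5 * c)) - hat g (pt h 15 (10 *
    c)) - hat g (pt h 15 (10 * c)) - hat g (pt h 15 (10 * c)) - hat g (pt h 15 (10 * c)) + hat g (pt h 10 (10 * c))
    + hat g (pt h 10 (10 * c)) + hat g (pt h 10 (10 * c)) + hat g (pt h 10 (10 * c)) + hat g (pt h 10 (10 * c)) +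
    hat g (pt h 10 (10 * c)) + hat g (pt h 10 (10 * c)) + hat g (pt h 10 (10 * c)) - hat g (pt h 10 (20 * c)) - hat
    g (pt h 10 (20 * c)) - hat g (pt h 10 (20 * c)) - hat g (pt h 10 (20 * c)) - hat g (pt h 10 (20 * c)) - hat g
    (pt h 10 (20 * c)) - hat g (pt h 10 (20 * c)) - hat g (pt h 10 (20 * c)) + hat g (pt h 0 (20 * c)) + hat g (pt h
    0 (20 * c)) + hat g (pt h 0 (20 * c)) + hat g (pt h 0 (20 * c)) + hat g (pt h 0 (20 * c)) + hat g (pt h 0 (20 *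
    c)) + hat g (pt h 0 (20 * c)) + hat g (pt h 0 (20 * c))

/-- **`R^χ(c)`** (`χ₅` mod `20`, odd `ψ`; fibres `c, 2c, 4c`). [folklore] -/
private def Rchi (h : Nat.Coprime 20 p) (g : ZMod (20 * p) → ℚ) (c : ZMod p) : ℚ :=
  hat g (pt h 1 c) - hat g (pt h 3 c) - hat g (pt h 7 c) + hat g (pt h 9 c) + hat g (pt h 11 c) - hat g (pt h 13 c)
    - hat g (pt h 17 c) + hat g (pt h 19 c) + hat g (pt h 1 (2 * c)) - hat g (pt h 3 (2 * c)) - hat g (pt h 7 (2 *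
    c)) + hat g (pt h 9 (2 * c)) + hat g (pt h 11 (2 * c)) - hat g (pt h 13 (2 * c)) - hat g (pt h 17 (2 * c)) + hat
    g (pt h 19 (2 * c)) + hat g (pt h 2 (2 * c)) + hat g (pt h 2 (2 * c)) - hat g (pt h 6 (2 * c)) - hat g (pt h 6
    (2 * c)) - hat g (pt h 14 (2 * c)) - hat g (pt h 14 (2 * c)) + hat g (pt h 18 (2 * c)) + hat g (pt h 18 (2 * c))
    + hat g (pt h 2 (4 * c)) + hat g (pt h 2 (4 * c)) - hat g (pt h 6 (4 * c)) - hat g (pt h 6 (4 * c)) - hat g (pt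
    h 14 (4 * c)) - hat g (pt h 14 (4 * c)) + hat g (pt h 18 (4 * c)) + hat g (pt h 18 (4 * c)) + hat g (pt h 4 (4 *
    c)) + hat g (pt h 4 (4 * c)) - hat g (pt h 8 (4 * c)) - hat g (pt h 8 (4 * c)) - hat g (pt h 12 (4 * c)) - hat g
    (pt h 12 (4 * c)) + hat g (pt h 16 (4 * c)) + hat g (pt h 16 (4 * c))

/-- **`Z¹(c) = ĝ(1,c) − ĝ(9,c) − ĝ(11,c) + ĝ(19,c)`** (`χ₋₄χ₄^{±1}`, first real form; one fibre). [folklore] -/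
private def Z1 (h : Nat.Coprime 20 p) (g : ZMod (20 * p) → ℚ) (c : ZMod p) : ℚ :=
  hat g (pt h 1 c) - hat g (pt h 9 c) - hat g (pt h 11 c) + hat g (pt h 19 c)

/-- **`Z³(c) = ĝ(3,c) − ĝ(7,c) − ĝ(13,c) + ĝ(17,c)`** (second real form; one fibre). [folklore] -/
private def Z3 (h : Nat.Coprime 20 p) (g : ZMod (20 * p) → ℚ) (c : ZMod p) : ℚ :=
  hat g (pt h 3 c) - hat g (pt h 7 c) - hat g (pt h 13 c) + hat g (pt h 17 c)

/-- **`Γ₋₄(c)`** (`χ₋₄` mod `20`, even `ψ`; fibres `c, 5c`; constant in `c`). [folklore] -/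
private def G4 (h : Nat.Coprime 20 p) (g : ZMod (20 * p) → ℚ) (c : ZMod p) : ℚ :=
  hat g (pt h 1 c) - hat g (pt h 3 c) - hat g (pt h 7 c) + hat g (pt h 9 c) - hat g (pt h 11 c) + hat g (pt h 13 c)
    + hat g (pt h 17 c) - hat g (pt h 19 c) - hat g (pt h 1 (5 * c)) + hat g (pt h 3 (5 * c)) + hat g (pt h 7 (5 *
    c)) - hat g (pt h 9 (5 * c)) + hat g (pt h 11 (5 * c)) - hat g (pt h 13 (5 * c)) - hat g (pt h 17 (5 * c)) + hat
    g (pt h 19 (5 * c)) + hat g (pt h 5 (5 * c)) + hat g (pt h 5 (5 * c)) + hat g (pt h 5 (5 * c)) + hat g (pt h 5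
    (5 * c)) - hat g (pt h 15 (5 * c)) - hat g (pt h 15 (5 * c)) - hat g (pt h 15 (5 * c)) - hat g (pt h 15 (5 * c))

/-- **`Γ₋₄χ₅(c) = Σ_{u∈{1,3,7,9}} ĝ(u,c) − Σ_{u∈{11,13,17,19}} ĝ(u,c)`** (one fibre; constant in `c`). [folklore] -/
private def G45 (h : Nat.Coprime 20 p) (g : ZMod (20 * p) → ℚ) (c : ZMod p) : ℚ :=
  hat g (pt h 1 c) + hat g (pt h 3 c) + hat g (pt h 7 c) + hat g (pt h 9 c) - hat g (pt h 11 c) - hat g (pt h 13 c)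
    - hat g (pt h 17 c) - hat g (pt h 19 c)

/-- **`Γ_A(c)`** (`χ₄^{±1}` mod `20`, even `ψ`, first real form; fibres `c, 2c, 4c`; constant in `c`). [folklore] -/
private def GA (h : Nat.Coprime 20 p) (g : ZMod (20 * p) → ℚ) (c : ZMod p) : ℚ :=
  -hat g (pt h 1 c) + hat g (pt h 9 c) - hat g (pt h 11 c) + hat g (pt h 19 c) - hat g (pt h 3 (2 * c)) + hat g (pt
    h 7 (2 * c)) - hat g (pt h 13 (2 * c)) + hat g (pt h 17 (2 * c)) - hat g (pt h 2 (2 * c)) - hat g (pt h 2 (2 *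
    c)) + hat g (pt h 18 (2 * c)) + hat g (pt h 18 (2 * c)) - hat g (pt h 4 (4 * c)) - hat g (pt h 4 (4 * c)) - hat
    g (pt h 6 (4 * c)) - hat g (pt h 6 (4 * c)) + hat g (pt h 14 (4 * c)) + hat g (pt h 14 (4 * c)) + hat g (pt h 16
    (4 * c)) + hat g (pt h 16 (4 * c))

/-- **`Γ_B(c)`** (second real form; constant in `c`). [folklore] -/
private def GB (h : Nat.Coprime 20 p) (g : ZMod (20 * p) → ℚ) (c : ZMod p) : ℚ :=
  hat g (pt h 3 c) - hat g (pt h 7 c) + hat g (pt h 13 c) - hat g (pt h 17 c) - hat g (pt h 1 (2 * c)) + hat g (pt h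
    9 (2 * c)) - hat g (pt h 11 (2 * c)) + hat g (pt h 19 (2 * c)) + hat g (pt h 6 (2 * c)) + hat g (pt h 6 (2 * c))
    - hat g (pt h 14 (2 * c)) - hat g (pt h 14 (2 * c)) - hat g (pt h 2 (4 * c)) - hat g (pt h 2 (4 * c)) - hat g
    (pt h 8 (4 * c)) - hat g (pt h 8 (4 * c)) + hat g (pt h 12 (4 * c)) + hat g (pt h 12 (4 * c)) + hat g (pt h 18
    (4 * c)) + hat g (pt h 18 (4 * c))

/-- The difference `G4(c) − G4(c′)` (the relation is `= 0` for `c, c′ ≠ 0`). [folklore] -/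
private def L4 (h : Nat.Coprime 20 p) (g : ZMod (20 * p) → ℚ) (c c' : ZMod p) : ℚ := G4 h g c - G4 h g c'

/-- The difference `G45(c) − G45(c′)` (the relation is `= 0` for `c, c′ ≠ 0`). [folklore] -/
private def L45 (h : Nat.Coprime 20 p) (g : ZMod (20 * p) → ℚ) (c c' : ZMod p) : ℚ := G45 h g c - G45 h g c'

/-- The difference `GA(c) − GA(c′)` (the relation is `= 0` for `c, c′ ≠ 0`). [folklore] -/
private def LA (h : Nat.Coprime 20 p) (g : ZMod (20 * p) → ℚ) (c c' : ZMod p) : ℚ := GA h g c - GA h g c'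

/-- The difference `GB(c) − GB(c′)` (the relation is `= 0` for `c, c′ ≠ 0`). [folklore] -/
private def LB (h : Nat.Coprime 20 p) (g : ZMod (20 * p) → ℚ) (c c' : ZMod p) : ℚ := GB h g c - GB h g c'

/-- `ĝ` is additive. [folklore] -/
private theorem hat_add (g g' : ZMod (20 * p) → ℚ) (w : ZMod (20 * p)) :
    hat (fun z ↦ g z + g' z) w = hat g w + hat g' w := by
  simp only [hat]; ring

/-- `ĝ` is homogeneous. [folklore] -/
private theorem hat_smul (a : ℚ) (g : ZMod (20 * p) → ℚ) (w : ZMod (20 * p)) :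
    hat (fun z ↦ a * g z) w = a * hat g w := by
  simp only [hat]; ring

/-- `ĝ` commutes with sums. [folklore] -/
private theorem hat_sum {ι : Type} (t : Finset ι) (g : ι → ZMod (20 * p) → ℚ) (w : ZMod (20 * p)) :
    hat (fun z ↦ ∑ i ∈ t, g i z) w = ∑ i ∈ t, hat (g i) w := by
  simp only [hat, Finset.sum_sub_distrib]

/-- `ĝ = 0` for negation-invariant `g`. [folklore] -/
private theorem hat_even {g : ZMod (20 * p) → ℚ} (hg : ∀ z, g (-z) = g z) (w : ZMod (20 * p)) : hat g w = 0 := by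
  simp only [hat, hg, sub_self]

/-- `R1` is linear and kills negation-invariant functions. [folklore] -/
private theorem R1_linear (h : Nat.Coprime 20 p) (c : ZMod p) :
    (∀ g g' : ZMod (20 * p) → ℚ, R1 h (fun z ↦ g z + g' z) c = R1 h g c + R1 h g' c) ∧
    (∀ (a : ℚ) (g : ZMod (20 * p) → ℚ), R1 h (fun z ↦ a * g z) c = a * R1 h g c) ∧
    (∀ {ι : Type} (t : Finset ι) (g : ι → ZMod (20 * p) → ℚ),
      R1 h (fun z ↦ ∑ i ∈ t, g i z) c = ∑ i ∈ t, R1 h (g i) c) ∧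
    (∀ g : ZMod (20 * p) → ℚ, (∀ z, g (-z) = g z) → R1 h g c = 0) := by
  refine ⟨fun g g' ↦ ?_, fun a g ↦ ?_, fun t g ↦ ?_, fun g hg ↦ ?_⟩
  · simp only [R1, hat_add]; ring
  · simp only [R1, hat_smul]; ring
  · simp only [R1, hat_sum, ← Finset.sum_add_distrib, ← Finset.sum_sub_distrib, ← Finset.sum_neg_distrib]
  · simp only [R1, hat_even hg]; ring

/-- `Rchi` is linear and kills negation-invariant functions. [folklore] -/
private theorem Rchi_linear (h : Nat.Coprime 20 p) (c : ZMod p) :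
    (∀ g g' : ZMod (20 * p) → ℚ, Rchi h (fun z ↦ g z + g' z) c = Rchi h g c + Rchi h g' c) ∧
    (∀ (a : ℚ) (g : ZMod (20 * p) → ℚ), Rchi h (fun z ↦ a * g z) c = a * Rchi h g c) ∧
    (∀ {ι : Type} (t : Finset ι) (g : ι → ZMod (20 * p) → ℚ),
      Rchi h (fun z ↦ ∑ i ∈ t, g i z) c = ∑ i ∈ t, Rchi h (g i) c) ∧
    (∀ g : ZMod (20 * p) → ℚ, (∀ z, g (-z) = g z) → Rchi h g c = 0) := by
  refine ⟨fun g g' ↦ ?_, fun a g ↦ ?_, fun t g ↦ ?_, fun g hg ↦ ?_⟩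
  · simp only [Rchi, hat_add]; ring
  · simp only [Rchi, hat_smul]; ring
  · simp only [Rchi, hat_sum, ← Finset.sum_add_distrib, ← Finset.sum_sub_distrib, ← Finset.sum_neg_distrib]
  · simp only [Rchi, hat_even hg]; ring

/-- `Z1` is linear and kills negation-invariant functions. [folklore] -/
private theorem Z1_linear (h : Nat.Coprime 20 p) (c : ZMod p) :
    (∀ g g' : ZMod (20 * p) → ℚ, Z1 h (fun z ↦ g z + g' z) c = Z1 h g c + Z1 h g' c) ∧
    (∀ (a : ℚ) (g : ZMod (20 * p) → ℚ), Z1 h (fun z ↦ a * g z) c = a * Z1 h g c) ∧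
    (∀ {ι : Type} (t : Finset ι) (g : ι → ZMod (20 * p) → ℚ),
      Z1 h (fun z ↦ ∑ i ∈ t, g i z) c = ∑ i ∈ t, Z1 h (g i) c) ∧
    (∀ g : ZMod (20 * p) → ℚ, (∀ z, g (-z) = g z) → Z1 h g c = 0) := by
  refine ⟨fun g g' ↦ ?_, fun a g ↦ ?_, fun t g ↦ ?_, fun g hg ↦ ?_⟩
  · simp only [Z1, hat_add]; ring
  · simp only [Z1, hat_smul]; ring
  · simp only [Z1, hat_sum, ← Finset.sum_add_distrib, ← Finset.sum_sub_distrib, ← Finset.sum_neg_distrib]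
  · simp only [Z1, hat_even hg]; ring

/-- `Z3` is linear and kills negation-invariant functions. [folklore] -/
private theorem Z3_linear (h : Nat.Coprime 20 p) (c : ZMod p) :
    (∀ g g' : ZMod (20 * p) → ℚ, Z3 h (fun z ↦ g z + g' z) c = Z3 h g c + Z3 h g' c) ∧
    (∀ (a : ℚ) (g : ZMod (20 * p) → ℚ), Z3 h (fun z ↦ a * g z) c = a * Z3 h g c) ∧
    (∀ {ι : Type} (t : Finset ι) (g : ι → ZMod (20 * p) → ℚ),
      Z3 h (fun z ↦ ∑ i ∈ t, g i z) c = ∑ i ∈ t, Z3 h (g i) c) ∧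
    (∀ g : ZMod (20 * p) → ℚ, (∀ z, g (-z) = g z) → Z3 h g c = 0) := by
  refine ⟨fun g g' ↦ ?_, fun a g ↦ ?_, fun t g ↦ ?_, fun g hg ↦ ?_⟩
  · simp only [Z3, hat_add]; ring
  · simp only [Z3, hat_smul]; ring
  · simp only [Z3, hat_sum, ← Finset.sum_add_distrib, ← Finset.sum_sub_distrib, ← Finset.sum_neg_distrib]
  · simp only [Z3, hat_even hg]; ring

/-- `L4` is linear and kills negation-invariant functions. [folklore] -/
private theorem L4_linear (h : Nat.Coprime 20 p) (c c' : ZMod p) :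
    (∀ g g' : ZMod (20 * p) → ℚ, L4 h (fun z ↦ g z + g' z) c c' = L4 h g c c' + L4 h g' c c') ∧
    (∀ (a : ℚ) (g : ZMod (20 * p) → ℚ), L4 h (fun z ↦ a * g z) c c' = a * L4 h g c c') ∧
    (∀ {ι : Type} (t : Finset ι) (g : ι → ZMod (20 * p) → ℚ),
      L4 h (fun z ↦ ∑ i ∈ t, g i z) c c' = ∑ i ∈ t, L4 h (g i) c c') ∧
    (∀ g : ZMod (20 * p) → ℚ, (∀ z, g (-z) = g z) → L4 h g c c' = 0) := by
  refine ⟨fun g g' ↦ ?_, fun a g ↦ ?_, fun t g ↦ ?_, fun g hg ↦ ?_⟩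
  · simp only [L4, G4, hat_add]; ring
  · simp only [L4, G4, hat_smul]; ring
  · simp only [L4, G4, hat_sum, ← Finset.sum_add_distrib, ← Finset.sum_sub_distrib, ← Finset.sum_neg_distrib]
  · simp only [L4, G4, hat_even hg]; ring

/-- `L45` is linear and kills negation-invariant functions. [folklore] -/
private theorem L45_linear (h : Nat.Coprime 20 p) (c c' : ZMod p) :
    (∀ g g' : ZMod (20 * p) → ℚ, L45 h (fun z ↦ g z + g' z) c c' = L45 h g c c' + L45 h g' c c') ∧
    (∀ (a : ℚ) (g : ZMod (20 * p) → ℚ), L45 h (fun z ↦ a * g z) c c' = a * L45 h g c c') ∧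
    (∀ {ι : Type} (t : Finset ι) (g : ι → ZMod (20 * p) → ℚ),
      L45 h (fun z ↦ ∑ i ∈ t, g i z) c c' = ∑ i ∈ t, L45 h (g i) c c') ∧
    (∀ g : ZMod (20 * p) → ℚ, (∀ z, g (-z) = g z) → L45 h g c c' = 0) := by
  refine ⟨fun g g' ↦ ?_, fun a g ↦ ?_, fun t g ↦ ?_, fun g hg ↦ ?_⟩
  · simp only [L45, G45, hat_add]; ring
  · simp only [L45, G45, hat_smul]; ring
  · simp only [L45, G45, hat_sum, ← Finset.sum_add_distrib, ← Finset.sum_sub_distrib, ← Finset.sum_neg_distrib]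
  · simp only [L45, G45, hat_even hg]; ring

/-- `LA` is linear and kills negation-invariant functions. [folklore] -/
private theorem LA_linear (h : Nat.Coprime 20 p) (c c' : ZMod p) :
    (∀ g g' : ZMod (20 * p) → ℚ, LA h (fun z ↦ g z + g' z) c c' = LA h g c c' + LA h g' c c') ∧
    (∀ (a : ℚ) (g : ZMod (20 * p) → ℚ), LA h (fun z ↦ a * g z) c c' = a * LA h g c c') ∧
    (∀ {ι : Type} (t : Finset ι) (g : ι → ZMod (20 * p) → ℚ),
      LA h (fun z ↦ ∑ i ∈ t, g i z) c c' = ∑ i ∈ t, LA h (g i) c c') ∧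
    (∀ g : ZMod (20 * p) → ℚ, (∀ z, g (-z) = g z) → LA h g c c' = 0) := by
  refine ⟨fun g g' ↦ ?_, fun a g ↦ ?_, fun t g ↦ ?_, fun g hg ↦ ?_⟩
  · simp only [LA, GA, hat_add]; ring
  · simp only [LA, GA, hat_smul]; ring
  · simp only [LA, GA, hat_sum, ← Finset.sum_add_distrib, ← Finset.sum_sub_distrib, ← Finset.sum_neg_distrib]
  · simp only [LA, GA, hat_even hg]; ring

/-- `LB` is linear and kills negation-invariant functions. [folklore] -/
private theorem LB_linear (h : Nat.Coprime 20 p) (c c' : ZMod p) :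
    (∀ g g' : ZMod (20 * p) → ℚ, LB h (fun z ↦ g z + g' z) c c' = LB h g c c' + LB h g' c c') ∧
    (∀ (a : ℚ) (g : ZMod (20 * p) → ℚ), LB h (fun z ↦ a * g z) c c' = a * LB h g c c') ∧
    (∀ {ι : Type} (t : Finset ι) (g : ι → ZMod (20 * p) → ℚ),
      LB h (fun z ↦ ∑ i ∈ t, g i z) c c' = ∑ i ∈ t, LB h (g i) c c') ∧
    (∀ g : ZMod (20 * p) → ℚ, (∀ z, g (-z) = g z) → LB h g c c' = 0) := by
  refine ⟨fun g g' ↦ ?_, fun a g ↦ ?_, fun t g ↦ ?_, fun g hg ↦ ?_⟩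
  · simp only [LB, GB, hat_add]; ring
  · simp only [LB, GB, hat_smul]; ring
  · simp only [LB, GB, hat_sum, ← Finset.sum_add_distrib, ← Finset.sum_sub_distrib, ← Finset.sum_neg_distrib]
  · simp only [LB, GB, hat_even hg]; ring

/-! ### The functionals kill every distribution vector -/

/-- A point with non-zero second coordinate is not of the form `pt e 0`. [folklore] -/
private theorem pt_ne_pt_zero (h : Nat.Coprime 20 p) {c : ZMod p} (hc : c ≠ 0) (e e' : ZMod 20) :
    pt h e' 0 ≠ pt h e c := fun eq ↦ hc ((pt_inj h).1 eq).2.symm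

/-- `ĝ` of a distribution vector at a coordinate point, unfolded. [folklore] -/
private theorem hat_koD (h : Nat.Coprime 20 p) (M : ℕ) (z : ZMod (20 * p)) (e : ZMod 20) (c : ZMod p) :
    hat (koD (20 * p) M z) (pt h e c) =
      ((if (pt h e c).val % M = z.val % M then (1 : ℚ) else 0) -
        (if (pt h (-e) (-c)).val % M = z.val % M then (1 : ℚ) else 0)) -
      ((if ((20 * p / M : ℕ) : ZMod (20 * p)) * z = pt h e c then (1 : ℚ) else 0) -
        (if ((20 * p / M : ℕ) : ZMod (20 * p)) * z = pt h (-e) (-c) then (1 : ℚ) else 0)) := by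
  simp only [hat, koD, neg_pt]
  ring

/-- The distribution vector of level `20p` is zero. [folklore] -/
private theorem koD_top [NeZero (20 * p)] (z w : ZMod (20 * p)) : koD (20 * p) (20 * p) z w = 0 := by
  have h0 : (20 * p) ≠ 0 := NeZero.ne _
  simp only [koD, Nat.mod_eq_of_lt (ZMod.val_lt _), Nat.div_self (Nat.pos_of_ne_zero h0), Nat.cast_one, one_mul]
  by_cases hw : w = z
  · rw [if_pos (by rw [hw]), if_pos hw.symm, sub_self]
  · rw [if_neg (fun e ↦ hw (ZMod.val_injective _ e)), if_neg (fun e ↦ hw e.symm), sub_self]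

/-- Level `k ∣ 20`: `ĝ(e, c) = [e ≡ e_z (k)] − [−e ≡ e_z (k)]` off the fibre `0`. [folklore] -/
private theorem hat_koD_dvd_twenty (h : Nat.Coprime 20 p) [NeZero (20 * p)] {k : ℕ} (hk : k ∣ 20) (hk0 : 0 < k)
    (ez e : ZMod 20) {bz c : ZMod p} (hc : c ≠ 0) : hat (koD (20 * p) k (pt h ez bz)) (pt h e c) =
      (if e.val % k = ez.val % k then (1 : ℚ) else 0) - (if (-e).val % k = ez.val % k then (1 : ℚ) else 0) := by
  rw [hat_koD]
  obtain ⟨j, hj⟩ := hk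
  have hjk : (20 * p / k : ℕ) = j * p := by
    rw [hj, mul_assoc]; exact Nat.mul_div_cancel_left _ hk0
  have hP : ((j * p : ℕ) : ZMod p) = 0 := by rw [Nat.cast_mul, ZMod.natCast_self, mul_zero]
  have n1 : ((j * p : ℕ) : ZMod (20 * p)) * pt h ez bz ≠ pt h e c := by
    rw [natCast_mul_pt, hP, zero_mul]; exact pt_ne_pt_zero h hc _ _
  have n2 : ((j * p : ℕ) : ZMod (20 * p)) * pt h ez bz ≠ pt h (-e) (-c) := by
    rw [natCast_mul_pt, hP, zero_mul]; exact pt_ne_pt_zero h (neg_ne_zero.2 hc) _ _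
  rw [hjk, if_neg n1, if_neg n2]
  simp only [mod_dvd_twenty_iff h ⟨j, hj⟩, crt_pt, sub_zero]

/-- Level `p`: `ĝ(e, c) = [c = b_z] − [−c = b_z] − [0 = e, 20b_z = c] + [0 = −e, 20b_z = −c]`. [folklore] -/
private theorem hat_koD_P (h : Nat.Coprime 20 p) [NeZero (20 * p)] (hp : p.Prime) (ez e : ZMod 20) (bz c : ZMod p) :
    hat (koD (20 * p) p (pt h ez bz)) (pt h e c) =
      ((if c = bz then (1 : ℚ) else 0) - (if -c = bz then (1 : ℚ) else 0)) -
      ((if 0 = e ∧ 20 * bz = c then (1 : ℚ) else 0) - (if 0 = -e ∧ 20 * bz = -c then (1 : ℚ) else 0)) := by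
  rw [hat_koD]
  have h12 : (20 * p / p : ℕ) = 20 := Nat.mul_div_cancel 20 hp.pos
  have h120 : (20 : ZMod 20) * ez = 0 := by rw [show (20 : ZMod 20) = 0 by decide, zero_mul]
  rw [h12]
  simp only [natCast_mul_eq_pt_iff]
  simp only [mod_p_iff h, crt_pt, Nat.cast_ofNat, h120]

/-- Level `k·p`, `k ∣ 20`, `20 = j·k`: `ĝ(e, c) = [e ≡ e_z (k), c = b_z] − [−e ≡ e_z (k), −c = b_z] − [j e_z = e, j b_z = c]
 + [j e_z = −e, j b_z = −c]`. [folklore] -/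
private theorem hat_koD_mulP (h : Nat.Coprime 20 p) [NeZero (20 * p)] (hp : p.Prime) {k j : ℕ} (hjk : 20 = j * k)
    (ez e : ZMod 20) (bz c : ZMod p) :
    hat (koD (20 * p) (k * p) (pt h ez bz)) (pt h e c) =
      ((if e.val % k = ez.val % k ∧ c = bz then (1 : ℚ) else 0) -
        (if (-e).val % k = ez.val % k ∧ -c = bz then (1 : ℚ) else 0)) -
      ((if (j : ZMod 20) * ez = e ∧ (j : ZMod p) * bz = c then (1 : ℚ) else 0) -
        (if (j : ZMod 20) * ez = -e ∧ (j : ZMod p) * bz = -c then (1 : ℚ) else 0)) := by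
  rw [hat_koD]
  have hk0 : 0 < k := Nat.pos_of_ne_zero fun h0 ↦ by rw [h0, mul_zero] at hjk; exact absurd hjk (by norm_num)
  have hj : (20 * p / (k * p) : ℕ) = j := by
    rw [hjk, show j * k * p = j * (k * p) by ring]; exact Nat.mul_div_cancel j (Nat.mul_pos hk0 hp.pos)
  rw [hj]
  simp only [natCast_mul_eq_pt_iff]
  simp only [mod_dvd_twenty_mul_iff h ⟨j, by rw [hjk, mul_comm]⟩, crt_pt]

/-- `R1` kills `D_{1,z}`. [folklore] -/
private theorem R1_koD_1 (h : Nat.Coprime 20 p) [NeZero (20 * p)] (hp : p.Prime) (h7 : 7 ≤ p)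
    (ez : ZMod 20) (bz : ZMod p) {c : ZMod p} (hc : c ≠ 0) : R1 h (koD (20 * p) 1 (pt h ez bz)) c = 0 := by
  obtain ⟨hc2, hc4, hc5, hc10, hc20⟩ := mul_ne_zero_facts hp h7 hc
  simp only [R1,
    hat_koD_dvd_twenty h (by norm_num : 1 ∣ 20) (by norm_num) _ _ hc,
    hat_koD_dvd_twenty h (by norm_num : 1 ∣ 20) (by norm_num) _ _ hc2,
    hat_koD_dvd_twenty h (by norm_num : 1 ∣ 20) (by norm_num) _ _ hc4,
    hat_koD_dvd_twenty h (by norm_num : 1 ∣ 20) (by norm_num) _ _ hc5,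
    hat_koD_dvd_twenty h (by norm_num : 1 ∣ 20) (by norm_num) _ _ hc10,
    hat_koD_dvd_twenty h (by norm_num : 1 ∣ 20) (by norm_num) _ _ hc20]
  fin_cases ez <;> simp +decide

/-- `R1` kills `D_{2,z}`. [folklore] -/
private theorem R1_koD_2 (h : Nat.Coprime 20 p) [NeZero (20 * p)] (hp : p.Prime) (h7 : 7 ≤ p)
    (ez : ZMod 20) (bz : ZMod p) {c : ZMod p} (hc : c ≠ 0) : R1 h (koD (20 * p) 2 (pt h ez bz)) c = 0 := by
  obtain ⟨hc2, hc4, hc5, hc10, hc20⟩ := mul_ne_zero_facts hp h7 hc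
  simp only [R1,
    hat_koD_dvd_twenty h (by norm_num : 2 ∣ 20) (by norm_num) _ _ hc,
    hat_koD_dvd_twenty h (by norm_num : 2 ∣ 20) (by norm_num) _ _ hc2,
    hat_koD_dvd_twenty h (by norm_num : 2 ∣ 20) (by norm_num) _ _ hc4,
    hat_koD_dvd_twenty h (by norm_num : 2 ∣ 20) (by norm_num) _ _ hc5,
    hat_koD_dvd_twenty h (by norm_num : 2 ∣ 20) (by norm_num) _ _ hc10,
    hat_koD_dvd_twenty h (by norm_num : 2 ∣ 20) (by norm_num) _ _ hc20]
  fin_cases ez <;> simp +decide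

/-- `R1` kills `D_{4,z}`. [folklore] -/
private theorem R1_koD_4 (h : Nat.Coprime 20 p) [NeZero (20 * p)] (hp : p.Prime) (h7 : 7 ≤ p)
    (ez : ZMod 20) (bz : ZMod p) {c : ZMod p} (hc : c ≠ 0) : R1 h (koD (20 * p) 4 (pt h ez bz)) c = 0 := by
  obtain ⟨hc2, hc4, hc5, hc10, hc20⟩ := mul_ne_zero_facts hp h7 hc
  simp only [R1,
    hat_koD_dvd_twenty h (by norm_num : 4 ∣ 20) (by norm_num) _ _ hc,
    hat_koD_dvd_twenty h (by norm_num : 4 ∣ 20) (by norm_num) _ _ hc2,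
    hat_koD_dvd_twenty h (by norm_num : 4 ∣ 20) (by norm_num) _ _ hc4,
    hat_koD_dvd_twenty h (by norm_num : 4 ∣ 20) (by norm_num) _ _ hc5,
    hat_koD_dvd_twenty h (by norm_num : 4 ∣ 20) (by norm_num) _ _ hc10,
    hat_koD_dvd_twenty h (by norm_num : 4 ∣ 20) (by norm_num) _ _ hc20]
  fin_cases ez <;> simp +decide

/-- `R1` kills `D_{5,z}`. [folklore] -/
private theorem R1_koD_5 (h : Nat.Coprime 20 p) [NeZero (20 * p)] (hp : p.Prime) (h7 : 7 ≤ p)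
    (ez : ZMod 20) (bz : ZMod p) {c : ZMod p} (hc : c ≠ 0) : R1 h (koD (20 * p) 5 (pt h ez bz)) c = 0 := by
  obtain ⟨hc2, hc4, hc5, hc10, hc20⟩ := mul_ne_zero_facts hp h7 hc
  simp only [R1,
    hat_koD_dvd_twenty h (by norm_num : 5 ∣ 20) (by norm_num) _ _ hc,
    hat_koD_dvd_twenty h (by norm_num : 5 ∣ 20) (by norm_num) _ _ hc2,
    hat_koD_dvd_twenty h (by norm_num : 5 ∣ 20) (by norm_num) _ _ hc4,
    hat_koD_dvd_twenty h (by norm_num : 5 ∣ 20) (by norm_num) _ _ hc5,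
    hat_koD_dvd_twenty h (by norm_num : 5 ∣ 20) (by norm_num) _ _ hc10,
    hat_koD_dvd_twenty h (by norm_num : 5 ∣ 20) (by norm_num) _ _ hc20]
  fin_cases ez <;> simp +decide

/-- `R1` kills `D_{10,z}`. [folklore] -/
private theorem R1_koD_10 (h : Nat.Coprime 20 p) [NeZero (20 * p)] (hp : p.Prime) (h7 : 7 ≤ p)
    (ez : ZMod 20) (bz : ZMod p) {c : ZMod p} (hc : c ≠ 0) : R1 h (koD (20 * p) 10 (pt h ez bz)) c = 0 := by
  obtain ⟨hc2, hc4, hc5, hc10, hc20⟩ := mul_ne_zero_facts hp h7 hc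
  simp only [R1,
    hat_koD_dvd_twenty h (by norm_num : 10 ∣ 20) (by norm_num) _ _ hc,
    hat_koD_dvd_twenty h (by norm_num : 10 ∣ 20) (by norm_num) _ _ hc2,
    hat_koD_dvd_twenty h (by norm_num : 10 ∣ 20) (by norm_num) _ _ hc4,
    hat_koD_dvd_twenty h (by norm_num : 10 ∣ 20) (by norm_num) _ _ hc5,
    hat_koD_dvd_twenty h (by norm_num : 10 ∣ 20) (by norm_num) _ _ hc10,
    hat_koD_dvd_twenty h (by norm_num : 10 ∣ 20) (by norm_num) _ _ hc20]
  fin_cases ez <;> simp +decide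

/-- `R1` kills `D_{20,z}`. [folklore] -/
private theorem R1_koD_20 (h : Nat.Coprime 20 p) [NeZero (20 * p)] (hp : p.Prime) (h7 : 7 ≤ p)
    (ez : ZMod 20) (bz : ZMod p) {c : ZMod p} (hc : c ≠ 0) : R1 h (koD (20 * p) 20 (pt h ez bz)) c = 0 := by
  obtain ⟨hc2, hc4, hc5, hc10, hc20⟩ := mul_ne_zero_facts hp h7 hc
  simp only [R1,
    hat_koD_dvd_twenty h (by norm_num : 20 ∣ 20) (by norm_num) _ _ hc,
    hat_koD_dvd_twenty h (by norm_num : 20 ∣ 20) (by norm_num) _ _ hc2,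
    hat_koD_dvd_twenty h (by norm_num : 20 ∣ 20) (by norm_num) _ _ hc4,
    hat_koD_dvd_twenty h (by norm_num : 20 ∣ 20) (by norm_num) _ _ hc5,
    hat_koD_dvd_twenty h (by norm_num : 20 ∣ 20) (by norm_num) _ _ hc10,
    hat_koD_dvd_twenty h (by norm_num : 20 ∣ 20) (by norm_num) _ _ hc20]
  fin_cases ez <;> simp +decide

set_option maxHeartbeats 1000000 in
/-- `R1` kills `D_{p,z}`. [folklore] -/
private theorem R1_koD_P (h : Nat.Coprime 20 p) [NeZero (20 * p)] (hp : p.Prime) (h7 : 7 ≤ p)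
    (ez : ZMod 20) (bz : ZMod p) (c : ZMod p) : R1 h (koD (20 * p) p (pt h ez bz)) c = 0 := by
  simp only [R1, hat_koD_P h hp]
  fin_cases ez <;> simp +decide [atoms hp h7 c bz] <;> ring

set_option maxHeartbeats 1000000 in
/-- `R1` kills `D_{2p,z}`. [folklore] -/
private theorem R1_koD_2P (h : Nat.Coprime 20 p) [NeZero (20 * p)] (hp : p.Prime) (h7 : 7 ≤ p)
    (ez : ZMod 20) (bz : ZMod p) (c : ZMod p) : R1 h (koD (20 * p) (2 * p) (pt h ez bz)) c = 0 := by
  simp only [R1, hat_koD_mulP h hp (k := 2) (j := 10) (by norm_num), Nat.cast_ofNat]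
  fin_cases ez <;> simp +decide [atoms hp h7 c bz] <;> ring

/-- `R1` kills `D_{4p,z}`. [folklore] -/
private theorem R1_koD_4P (h : Nat.Coprime 20 p) [NeZero (20 * p)] (hp : p.Prime) (h7 : 7 ≤ p)
    (ez : ZMod 20) (bz : ZMod p) (c : ZMod p) : R1 h (koD (20 * p) (4 * p) (pt h ez bz)) c = 0 := by
  simp only [R1, hat_koD_mulP h hp (k := 4) (j := 5) (by norm_num), Nat.cast_ofNat]
  fin_cases ez <;> simp +decide [atoms hp h7 c bz] <;> ring

/-- `R1` kills `D_{5p,z}`. [folklore] -/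
private theorem R1_koD_5P (h : Nat.Coprime 20 p) [NeZero (20 * p)] (hp : p.Prime) (h7 : 7 ≤ p)
    (ez : ZMod 20) (bz : ZMod p) (c : ZMod p) : R1 h (koD (20 * p) (5 * p) (pt h ez bz)) c = 0 := by
  simp only [R1, hat_koD_mulP h hp (k := 5) (j := 4) (by norm_num), Nat.cast_ofNat]
  fin_cases ez <;> simp +decide [atoms hp h7 c bz] <;> ring

/-- `R1` kills `D_{10p,z}`. [folklore] -/
private theorem R1_koD_10P (h : Nat.Coprime 20 p) [NeZero (20 * p)] (hp : p.Prime) (h7 : 7 ≤ p)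
    (ez : ZMod 20) (bz : ZMod p) (c : ZMod p) : R1 h (koD (20 * p) (10 * p) (pt h ez bz)) c = 0 := by
  simp only [R1, hat_koD_mulP h hp (k := 10) (j := 2) (by norm_num), Nat.cast_ofNat]
  fin_cases ez <;> simp +decide [atoms hp h7 c bz] <;> ring

/-- **`R1` kills every distribution vector.** [folklore] -/
private theorem R1_koD (h : Nat.Coprime 20 p) [NeZero (20 * p)] (hp : p.Prime) (h7 : 7 ≤ p) {M : ℕ}
    (hM : M ∈ (20 * p).divisors) (z : ZMod (20 * p)) {c : ZMod p} (hc : c ≠ 0) : R1 h (koD (20 * p) M z) c = 0 := by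
  obtain ⟨ez, bz, rfl⟩ : ∃ ez bz, z = pt h ez bz := ⟨_, _, (pt_crt h z).symm⟩
  rcases eq_of_dvd_twenty_mul_prime hp h7 (Nat.dvd_of_mem_divisors hM) with
    rfl | rfl | rfl | rfl | rfl | rfl | rfl | rfl | rfl | rfl | rfl | hM20
  · exact R1_koD_1 h hp h7 ez bz hc
  · exact R1_koD_2 h hp h7 ez bz hc
  · exact R1_koD_4 h hp h7 ez bz hc
  · exact R1_koD_5 h hp h7 ez bz hc
  · exact R1_koD_10 h hp h7 ez bz hc
  · exact R1_koD_20 h hp h7 ez bz hc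
  · exact R1_koD_P h hp h7 ez bz c
  · exact R1_koD_2P h hp h7 ez bz c
  · exact R1_koD_4P h hp h7 ez bz c
  · exact R1_koD_5P h hp h7 ez bz c
  · exact R1_koD_10P h hp h7 ez bz c
  · rw [hM20]
    simp [R1, hat, koD_top]

/-- `Rchi` kills `D_{1,z}`. [folklore] -/
private theorem Rchi_koD_1 (h : Nat.Coprime 20 p) [NeZero (20 * p)] (hp : p.Prime) (h7 : 7 ≤ p)
    (ez : ZMod 20) (bz : ZMod p) {c : ZMod p} (hc : c ≠ 0) : Rchi h (koD (20 * p) 1 (pt h ez bz)) c = 0 := by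
  obtain ⟨hc2, hc4, hc5, hc10, hc20⟩ := mul_ne_zero_facts hp h7 hc
  simp only [Rchi,
    hat_koD_dvd_twenty h (by norm_num : 1 ∣ 20) (by norm_num) _ _ hc,
    hat_koD_dvd_twenty h (by norm_num : 1 ∣ 20) (by norm_num) _ _ hc2,
    hat_koD_dvd_twenty h (by norm_num : 1 ∣ 20) (by norm_num) _ _ hc4]
  fin_cases ez <;> simp +decide

/-- `Rchi` kills `D_{2,z}`. [folklore] -/
private theorem Rchi_koD_2 (h : Nat.Coprime 20 p) [NeZero (20 * p)] (hp : p.Prime) (h7 : 7 ≤ p)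
    (ez : ZMod 20) (bz : ZMod p) {c : ZMod p} (hc : c ≠ 0) : Rchi h (koD (20 * p) 2 (pt h ez bz)) c = 0 := by
  obtain ⟨hc2, hc4, hc5, hc10, hc20⟩ := mul_ne_zero_facts hp h7 hc
  simp only [Rchi,
    hat_koD_dvd_twenty h (by norm_num : 2 ∣ 20) (by norm_num) _ _ hc,
    hat_koD_dvd_twenty h (by norm_num : 2 ∣ 20) (by norm_num) _ _ hc2,
    hat_koD_dvd_twenty h (by norm_num : 2 ∣ 20) (by norm_num) _ _ hc4]
  fin_cases ez <;> simp +decide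

/-- `Rchi` kills `D_{4,z}`. [folklore] -/
private theorem Rchi_koD_4 (h : Nat.Coprime 20 p) [NeZero (20 * p)] (hp : p.Prime) (h7 : 7 ≤ p)
    (ez : ZMod 20) (bz : ZMod p) {c : ZMod p} (hc : c ≠ 0) : Rchi h (koD (20 * p) 4 (pt h ez bz)) c = 0 := by
  obtain ⟨hc2, hc4, hc5, hc10, hc20⟩ := mul_ne_zero_facts hp h7 hc
  simp only [Rchi,
    hat_koD_dvd_twenty h (by norm_num : 4 ∣ 20) (by norm_num) _ _ hc,
    hat_koD_dvd_twenty h (by norm_num : 4 ∣ 20) (by norm_num) _ _ hc2,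
    hat_koD_dvd_twenty h (by norm_num : 4 ∣ 20) (by norm_num) _ _ hc4]
  fin_cases ez <;> simp +decide

/-- `Rchi` kills `D_{5,z}`. [folklore] -/
private theorem Rchi_koD_5 (h : Nat.Coprime 20 p) [NeZero (20 * p)] (hp : p.Prime) (h7 : 7 ≤ p)
    (ez : ZMod 20) (bz : ZMod p) {c : ZMod p} (hc : c ≠ 0) : Rchi h (koD (20 * p) 5 (pt h ez bz)) c = 0 := by
  obtain ⟨hc2, hc4, hc5, hc10, hc20⟩ := mul_ne_zero_facts hp h7 hc
  simp only [Rchi,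
    hat_koD_dvd_twenty h (by norm_num : 5 ∣ 20) (by norm_num) _ _ hc,
    hat_koD_dvd_twenty h (by norm_num : 5 ∣ 20) (by norm_num) _ _ hc2,
    hat_koD_dvd_twenty h (by norm_num : 5 ∣ 20) (by norm_num) _ _ hc4]
  fin_cases ez <;> simp +decide

/-- `Rchi` kills `D_{10,z}`. [folklore] -/
private theorem Rchi_koD_10 (h : Nat.Coprime 20 p) [NeZero (20 * p)] (hp : p.Prime) (h7 : 7 ≤ p)
    (ez : ZMod 20) (bz : ZMod p) {c : ZMod p} (hc : c ≠ 0) : Rchi h (koD (20 * p) 10 (pt h ez bz)) c = 0 := by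
  obtain ⟨hc2, hc4, hc5, hc10, hc20⟩ := mul_ne_zero_facts hp h7 hc
  simp only [Rchi,
    hat_koD_dvd_twenty h (by norm_num : 10 ∣ 20) (by norm_num) _ _ hc,
    hat_koD_dvd_twenty h (by norm_num : 10 ∣ 20) (by norm_num) _ _ hc2,
    hat_koD_dvd_twenty h (by norm_num : 10 ∣ 20) (by norm_num) _ _ hc4]
  fin_cases ez <;> simp +decide

/-- `Rchi` kills `D_{20,z}`. [folklore] -/
private theorem Rchi_koD_20 (h : Nat.Coprime 20 p) [NeZero (20 * p)] (hp : p.Prime) (h7 : 7 ≤ p)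
    (ez : ZMod 20) (bz : ZMod p) {c : ZMod p} (hc : c ≠ 0) : Rchi h (koD (20 * p) 20 (pt h ez bz)) c = 0 := by
  obtain ⟨hc2, hc4, hc5, hc10, hc20⟩ := mul_ne_zero_facts hp h7 hc
  simp only [Rchi,
    hat_koD_dvd_twenty h (by norm_num : 20 ∣ 20) (by norm_num) _ _ hc,
    hat_koD_dvd_twenty h (by norm_num : 20 ∣ 20) (by norm_num) _ _ hc2,
    hat_koD_dvd_twenty h (by norm_num : 20 ∣ 20) (by norm_num) _ _ hc4]
  fin_cases ez <;> simp +decide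

/-- `Rchi` kills `D_{p,z}`. [folklore] -/
private theorem Rchi_koD_P (h : Nat.Coprime 20 p) [NeZero (20 * p)] (hp : p.Prime) (h7 : 7 ≤ p)
    (ez : ZMod 20) (bz : ZMod p) (c : ZMod p) : Rchi h (koD (20 * p) p (pt h ez bz)) c = 0 := by
  simp only [Rchi, hat_koD_P h hp]
  fin_cases ez <;> simp +decide [atoms hp h7 c bz]

/-- `Rchi` kills `D_{2p,z}`. [folklore] -/
private theorem Rchi_koD_2P (h : Nat.Coprime 20 p) [NeZero (20 * p)] (hp : p.Prime) (h7 : 7 ≤ p)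
    (ez : ZMod 20) (bz : ZMod p) (c : ZMod p) : Rchi h (koD (20 * p) (2 * p) (pt h ez bz)) c = 0 := by
  simp only [Rchi, hat_koD_mulP h hp (k := 2) (j := 10) (by norm_num), Nat.cast_ofNat]
  fin_cases ez <;> simp +decide [atoms hp h7 c bz]

/-- `Rchi` kills `D_{4p,z}`. [folklore] -/
private theorem Rchi_koD_4P (h : Nat.Coprime 20 p) [NeZero (20 * p)] (hp : p.Prime) (h7 : 7 ≤ p)
    (ez : ZMod 20) (bz : ZMod p) (c : ZMod p) : Rchi h (koD (20 * p) (4 * p) (pt h ez bz)) c = 0 := by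
  simp only [Rchi, hat_koD_mulP h hp (k := 4) (j := 5) (by norm_num), Nat.cast_ofNat]
  fin_cases ez <;> simp +decide [atoms hp h7 c bz] <;> ring

/-- `Rchi` kills `D_{5p,z}`. [folklore] -/
private theorem Rchi_koD_5P (h : Nat.Coprime 20 p) [NeZero (20 * p)] (hp : p.Prime) (h7 : 7 ≤ p)
    (ez : ZMod 20) (bz : ZMod p) (c : ZMod p) : Rchi h (koD (20 * p) (5 * p) (pt h ez bz)) c = 0 := by
  simp only [Rchi, hat_koD_mulP h hp (k := 5) (j := 4) (by norm_num), Nat.cast_ofNat]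
  fin_cases ez <;> simp +decide [atoms hp h7 c bz] <;> ring

/-- `Rchi` kills `D_{10p,z}`. [folklore] -/
private theorem Rchi_koD_10P (h : Nat.Coprime 20 p) [NeZero (20 * p)] (hp : p.Prime) (h7 : 7 ≤ p)
    (ez : ZMod 20) (bz : ZMod p) (c : ZMod p) : Rchi h (koD (20 * p) (10 * p) (pt h ez bz)) c = 0 := by
  simp only [Rchi, hat_koD_mulP h hp (k := 10) (j := 2) (by norm_num), Nat.cast_ofNat]
  fin_cases ez <;> simp +decide [atoms hp h7 c bz] <;> ring

/-- **`Rchi` kills every distribution vector.** [folklore] -/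
private theorem Rchi_koD (h : Nat.Coprime 20 p) [NeZero (20 * p)] (hp : p.Prime) (h7 : 7 ≤ p) {M : ℕ}
    (hM : M ∈ (20 * p).divisors) (z : ZMod (20 * p)) {c : ZMod p} (hc : c ≠ 0) : Rchi h (koD (20 * p) M z) c = 0 := by
  obtain ⟨ez, bz, rfl⟩ : ∃ ez bz, z = pt h ez bz := ⟨_, _, (pt_crt h z).symm⟩
  rcases eq_of_dvd_twenty_mul_prime hp h7 (Nat.dvd_of_mem_divisors hM) with
    rfl | rfl | rfl | rfl | rfl | rfl | rfl | rfl | rfl | rfl | rfl | hM20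
  · exact Rchi_koD_1 h hp h7 ez bz hc
  · exact Rchi_koD_2 h hp h7 ez bz hc
  · exact Rchi_koD_4 h hp h7 ez bz hc
  · exact Rchi_koD_5 h hp h7 ez bz hc
  · exact Rchi_koD_10 h hp h7 ez bz hc
  · exact Rchi_koD_20 h hp h7 ez bz hc
  · exact Rchi_koD_P h hp h7 ez bz c
  · exact Rchi_koD_2P h hp h7 ez bz c
  · exact Rchi_koD_4P h hp h7 ez bz c
  · exact Rchi_koD_5P h hp h7 ez bz c
  · exact Rchi_koD_10P h hp h7 ez bz c
  · rw [hM20]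
    simp [Rchi, hat, koD_top]

/-- `Z1` kills `D_{1,z}`. [folklore] -/
private theorem Z1_koD_1 (h : Nat.Coprime 20 p) [NeZero (20 * p)] (_hp : p.Prime) (_h7 : 7 ≤ p)
    (ez : ZMod 20) (bz : ZMod p) {c : ZMod p} (hc : c ≠ 0) : Z1 h (koD (20 * p) 1 (pt h ez bz)) c = 0 := by
  simp only [Z1,
    hat_koD_dvd_twenty h (by norm_num : 1 ∣ 20) (by norm_num) _ _ hc]
  fin_cases ez <;> simp +decide

/-- `Z1` kills `D_{2,z}`. [folklore] -/
private theorem Z1_koD_2 (h : Nat.Coprime 20 p) [NeZero (20 * p)] (_hp : p.Prime) (_h7 : 7 ≤ p)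
    (ez : ZMod 20) (bz : ZMod p) {c : ZMod p} (hc : c ≠ 0) : Z1 h (koD (20 * p) 2 (pt h ez bz)) c = 0 := by
  simp only [Z1,
    hat_koD_dvd_twenty h (by norm_num : 2 ∣ 20) (by norm_num) _ _ hc]
  fin_cases ez <;> simp +decide

/-- `Z1` kills `D_{4,z}`. [folklore] -/
private theorem Z1_koD_4 (h : Nat.Coprime 20 p) [NeZero (20 * p)] (_hp : p.Prime) (_h7 : 7 ≤ p)
    (ez : ZMod 20) (bz : ZMod p) {c : ZMod p} (hc : c ≠ 0) : Z1 h (koD (20 * p) 4 (pt h ez bz)) c = 0 := by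
  simp only [Z1,
    hat_koD_dvd_twenty h (by norm_num : 4 ∣ 20) (by norm_num) _ _ hc]
  fin_cases ez <;> simp +decide

/-- `Z1` kills `D_{5,z}`. [folklore] -/
private theorem Z1_koD_5 (h : Nat.Coprime 20 p) [NeZero (20 * p)] (_hp : p.Prime) (_h7 : 7 ≤ p)
    (ez : ZMod 20) (bz : ZMod p) {c : ZMod p} (hc : c ≠ 0) : Z1 h (koD (20 * p) 5 (pt h ez bz)) c = 0 := by
  simp only [Z1,
    hat_koD_dvd_twenty h (by norm_num : 5 ∣ 20) (by norm_num) _ _ hc]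
  fin_cases ez <;> simp +decide

/-- `Z1` kills `D_{10,z}`. [folklore] -/
private theorem Z1_koD_10 (h : Nat.Coprime 20 p) [NeZero (20 * p)] (_hp : p.Prime) (_h7 : 7 ≤ p)
    (ez : ZMod 20) (bz : ZMod p) {c : ZMod p} (hc : c ≠ 0) : Z1 h (koD (20 * p) 10 (pt h ez bz)) c = 0 := by
  simp only [Z1,
    hat_koD_dvd_twenty h (by norm_num : 10 ∣ 20) (by norm_num) _ _ hc]
  fin_cases ez <;> simp +decide

/-- `Z1` kills `D_{20,z}`. [folklore] -/
private theorem Z1_koD_20 (h : Nat.Coprime 20 p) [NeZero (20 * p)] (_hp : p.Prime) (_h7 : 7 ≤ p)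
    (ez : ZMod 20) (bz : ZMod p) {c : ZMod p} (hc : c ≠ 0) : Z1 h (koD (20 * p) 20 (pt h ez bz)) c = 0 := by
  simp only [Z1,
    hat_koD_dvd_twenty h (by norm_num : 20 ∣ 20) (by norm_num) _ _ hc]
  fin_cases ez <;> simp +decide

/-- `Z1` kills `D_{p,z}`. [folklore] -/
private theorem Z1_koD_P (h : Nat.Coprime 20 p) [NeZero (20 * p)] (hp : p.Prime) (h7 : 7 ≤ p)
    (ez : ZMod 20) (bz : ZMod p) (c : ZMod p) : Z1 h (koD (20 * p) p (pt h ez bz)) c = 0 := by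
  simp only [Z1, hat_koD_P h hp]
  fin_cases ez <;> simp +decide [atoms hp h7 c bz]

/-- `Z1` kills `D_{2p,z}`. [folklore] -/
private theorem Z1_koD_2P (h : Nat.Coprime 20 p) [NeZero (20 * p)] (hp : p.Prime) (h7 : 7 ≤ p)
    (ez : ZMod 20) (bz : ZMod p) (c : ZMod p) : Z1 h (koD (20 * p) (2 * p) (pt h ez bz)) c = 0 := by
  simp only [Z1, hat_koD_mulP h hp (k := 2) (j := 10) (by norm_num), Nat.cast_ofNat]
  fin_cases ez <;> simp +decide [atoms hp h7 c bz]

/-- `Z1` kills `D_{4p,z}`. [folklore] -/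
private theorem Z1_koD_4P (h : Nat.Coprime 20 p) [NeZero (20 * p)] (hp : p.Prime) (h7 : 7 ≤ p)
    (ez : ZMod 20) (bz : ZMod p) (c : ZMod p) : Z1 h (koD (20 * p) (4 * p) (pt h ez bz)) c = 0 := by
  simp only [Z1, hat_koD_mulP h hp (k := 4) (j := 5) (by norm_num), Nat.cast_ofNat]
  fin_cases ez <;> simp +decide [atoms hp h7 c bz]

/-- `Z1` kills `D_{5p,z}`. [folklore] -/
private theorem Z1_koD_5P (h : Nat.Coprime 20 p) [NeZero (20 * p)] (hp : p.Prime) (h7 : 7 ≤ p)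
    (ez : ZMod 20) (bz : ZMod p) (c : ZMod p) : Z1 h (koD (20 * p) (5 * p) (pt h ez bz)) c = 0 := by
  simp only [Z1, hat_koD_mulP h hp (k := 5) (j := 4) (by norm_num), Nat.cast_ofNat]
  fin_cases ez <;> simp +decide [atoms hp h7 c bz] <;> ring

/-- `Z1` kills `D_{10p,z}`. [folklore] -/
private theorem Z1_koD_10P (h : Nat.Coprime 20 p) [NeZero (20 * p)] (hp : p.Prime) (h7 : 7 ≤ p)
    (ez : ZMod 20) (bz : ZMod p) (c : ZMod p) : Z1 h (koD (20 * p) (10 * p) (pt h ez bz)) c = 0 := by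
  simp only [Z1, hat_koD_mulP h hp (k := 10) (j := 2) (by norm_num), Nat.cast_ofNat]
  fin_cases ez <;> simp +decide [atoms hp h7 c bz] <;> ring

/-- **`Z1` kills every distribution vector.** [folklore] -/
private theorem Z1_koD (h : Nat.Coprime 20 p) [NeZero (20 * p)] (hp : p.Prime) (h7 : 7 ≤ p) {M : ℕ}
    (hM : M ∈ (20 * p).divisors) (z : ZMod (20 * p)) {c : ZMod p} (hc : c ≠ 0) : Z1 h (koD (20 * p) M z) c = 0 := by
  obtain ⟨ez, bz, rfl⟩ : ∃ ez bz, z = pt h ez bz := ⟨_, _, (pt_crt h z).symm⟩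
  rcases eq_of_dvd_twenty_mul_prime hp h7 (Nat.dvd_of_mem_divisors hM) with
    rfl | rfl | rfl | rfl | rfl | rfl | rfl | rfl | rfl | rfl | rfl | hM20
  · exact Z1_koD_1 h hp h7 ez bz hc
  · exact Z1_koD_2 h hp h7 ez bz hc
  · exact Z1_koD_4 h hp h7 ez bz hc
  · exact Z1_koD_5 h hp h7 ez bz hc
  · exact Z1_koD_10 h hp h7 ez bz hc
  · exact Z1_koD_20 h hp h7 ez bz hc
  · exact Z1_koD_P h hp h7 ez bz c
  · exact Z1_koD_2P h hp h7 ez bz c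
  · exact Z1_koD_4P h hp h7 ez bz c
  · exact Z1_koD_5P h hp h7 ez bz c
  · exact Z1_koD_10P h hp h7 ez bz c
  · rw [hM20]
    simp [Z1, hat, koD_top]

/-- `Z3` kills `D_{1,z}`. [folklore] -/
private theorem Z3_koD_1 (h : Nat.Coprime 20 p) [NeZero (20 * p)] (_hp : p.Prime) (_h7 : 7 ≤ p)
    (ez : ZMod 20) (bz : ZMod p) {c : ZMod p} (hc : c ≠ 0) : Z3 h (koD (20 * p) 1 (pt h ez bz)) c = 0 := by
  simp only [Z3,
    hat_koD_dvd_twenty h (by norm_num : 1 ∣ 20) (by norm_num) _ _ hc]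
  fin_cases ez <;> simp +decide

/-- `Z3` kills `D_{2,z}`. [folklore] -/
private theorem Z3_koD_2 (h : Nat.Coprime 20 p) [NeZero (20 * p)] (_hp : p.Prime) (_h7 : 7 ≤ p)
    (ez : ZMod 20) (bz : ZMod p) {c : ZMod p} (hc : c ≠ 0) : Z3 h (koD (20 * p) 2 (pt h ez bz)) c = 0 := by
  simp only [Z3,
    hat_koD_dvd_twenty h (by norm_num : 2 ∣ 20) (by norm_num) _ _ hc]
  fin_cases ez <;> simp +decide

/-- `Z3` kills `D_{4,z}`. [folklore] -/
private theorem Z3_koD_4 (h : Nat.Coprime 20 p) [NeZero (20 * p)] (_hp : p.Prime) (_h7 : 7 ≤ p)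
    (ez : ZMod 20) (bz : ZMod p) {c : ZMod p} (hc : c ≠ 0) : Z3 h (koD (20 * p) 4 (pt h ez bz)) c = 0 := by
  simp only [Z3,
    hat_koD_dvd_twenty h (by norm_num : 4 ∣ 20) (by norm_num) _ _ hc]
  fin_cases ez <;> simp +decide

/-- `Z3` kills `D_{5,z}`. [folklore] -/
private theorem Z3_koD_5 (h : Nat.Coprime 20 p) [NeZero (20 * p)] (_hp : p.Prime) (_h7 : 7 ≤ p)
    (ez : ZMod 20) (bz : ZMod p) {c : ZMod p} (hc : c ≠ 0) : Z3 h (koD (20 * p) 5 (pt h ez bz)) c = 0 := by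
  simp only [Z3,
    hat_koD_dvd_twenty h (by norm_num : 5 ∣ 20) (by norm_num) _ _ hc]
  fin_cases ez <;> simp +decide

/-- `Z3` kills `D_{10,z}`. [folklore] -/
private theorem Z3_koD_10 (h : Nat.Coprime 20 p) [NeZero (20 * p)] (_hp : p.Prime) (_h7 : 7 ≤ p)
    (ez : ZMod 20) (bz : ZMod p) {c : ZMod p} (hc : c ≠ 0) : Z3 h (koD (20 * p) 10 (pt h ez bz)) c = 0 := by
  simp only [Z3,
    hat_koD_dvd_twenty h (by norm_num : 10 ∣ 20) (by norm_num) _ _ hc]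
  fin_cases ez <;> simp +decide

/-- `Z3` kills `D_{20,z}`. [folklore] -/
private theorem Z3_koD_20 (h : Nat.Coprime 20 p) [NeZero (20 * p)] (_hp : p.Prime) (_h7 : 7 ≤ p)
    (ez : ZMod 20) (bz : ZMod p) {c : ZMod p} (hc : c ≠ 0) : Z3 h (koD (20 * p) 20 (pt h ez bz)) c = 0 := by
  simp only [Z3,
    hat_koD_dvd_twenty h (by norm_num : 20 ∣ 20) (by norm_num) _ _ hc]
  fin_cases ez <;> simp +decide

/-- `Z3` kills `D_{p,z}`. [folklore] -/
private theorem Z3_koD_P (h : Nat.Coprime 20 p) [NeZero (20 * p)] (hp : p.Prime) (h7 : 7 ≤ p)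
    (ez : ZMod 20) (bz : ZMod p) (c : ZMod p) : Z3 h (koD (20 * p) p (pt h ez bz)) c = 0 := by
  simp only [Z3, hat_koD_P h hp]
  fin_cases ez <;> simp +decide [atoms hp h7 c bz]

/-- `Z3` kills `D_{2p,z}`. [folklore] -/
private theorem Z3_koD_2P (h : Nat.Coprime 20 p) [NeZero (20 * p)] (hp : p.Prime) (h7 : 7 ≤ p)
    (ez : ZMod 20) (bz : ZMod p) (c : ZMod p) : Z3 h (koD (20 * p) (2 * p) (pt h ez bz)) c = 0 := by
  simp only [Z3, hat_koD_mulP h hp (k := 2) (j := 10) (by norm_num), Nat.cast_ofNat]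
  fin_cases ez <;> simp +decide [atoms hp h7 c bz]

/-- `Z3` kills `D_{4p,z}`. [folklore] -/
private theorem Z3_koD_4P (h : Nat.Coprime 20 p) [NeZero (20 * p)] (hp : p.Prime) (h7 : 7 ≤ p)
    (ez : ZMod 20) (bz : ZMod p) (c : ZMod p) : Z3 h (koD (20 * p) (4 * p) (pt h ez bz)) c = 0 := by
  simp only [Z3, hat_koD_mulP h hp (k := 4) (j := 5) (by norm_num), Nat.cast_ofNat]
  fin_cases ez <;> simp +decide [atoms hp h7 c bz]

/-- `Z3` kills `D_{5p,z}`. [folklore] -/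
private theorem Z3_koD_5P (h : Nat.Coprime 20 p) [NeZero (20 * p)] (hp : p.Prime) (h7 : 7 ≤ p)
    (ez : ZMod 20) (bz : ZMod p) (c : ZMod p) : Z3 h (koD (20 * p) (5 * p) (pt h ez bz)) c = 0 := by
  simp only [Z3, hat_koD_mulP h hp (k := 5) (j := 4) (by norm_num), Nat.cast_ofNat]
  fin_cases ez <;> simp +decide [atoms hp h7 c bz] <;> ring

/-- `Z3` kills `D_{10p,z}`. [folklore] -/
private theorem Z3_koD_10P (h : Nat.Coprime 20 p) [NeZero (20 * p)] (hp : p.Prime) (h7 : 7 ≤ p)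
    (ez : ZMod 20) (bz : ZMod p) (c : ZMod p) : Z3 h (koD (20 * p) (10 * p) (pt h ez bz)) c = 0 := by
  simp only [Z3, hat_koD_mulP h hp (k := 10) (j := 2) (by norm_num), Nat.cast_ofNat]
  fin_cases ez <;> simp +decide [atoms hp h7 c bz] <;> ring

/-- **`Z3` kills every distribution vector.** [folklore] -/
private theorem Z3_koD (h : Nat.Coprime 20 p) [NeZero (20 * p)] (hp : p.Prime) (h7 : 7 ≤ p) {M : ℕ}
    (hM : M ∈ (20 * p).divisors) (z : ZMod (20 * p)) {c : ZMod p} (hc : c ≠ 0) : Z3 h (koD (20 * p) M z) c = 0 := by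
  obtain ⟨ez, bz, rfl⟩ : ∃ ez bz, z = pt h ez bz := ⟨_, _, (pt_crt h z).symm⟩
  rcases eq_of_dvd_twenty_mul_prime hp h7 (Nat.dvd_of_mem_divisors hM) with
    rfl | rfl | rfl | rfl | rfl | rfl | rfl | rfl | rfl | rfl | rfl | hM20
  · exact Z3_koD_1 h hp h7 ez bz hc
  · exact Z3_koD_2 h hp h7 ez bz hc
  · exact Z3_koD_4 h hp h7 ez bz hc
  · exact Z3_koD_5 h hp h7 ez bz hc
  · exact Z3_koD_10 h hp h7 ez bz hc
  · exact Z3_koD_20 h hp h7 ez bz hc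
  · exact Z3_koD_P h hp h7 ez bz c
  · exact Z3_koD_2P h hp h7 ez bz c
  · exact Z3_koD_4P h hp h7 ez bz c
  · exact Z3_koD_5P h hp h7 ez bz c
  · exact Z3_koD_10P h hp h7 ez bz c
  · rw [hM20]
    simp [Z3, hat, koD_top]

/-- `L4` kills `D_{1,z}`. [folklore] -/
private theorem L4_koD_1 (h : Nat.Coprime 20 p) [NeZero (20 * p)] (hp : p.Prime) (h7 : 7 ≤ p)
    (ez : ZMod 20) (bz : ZMod p) {c c' : ZMod p} (hc : c ≠ 0) (hc' : c' ≠ 0) :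
    L4 h (koD (20 * p) 1 (pt h ez bz)) c c' = 0 := by
  obtain ⟨hc2, hc4, hc5, hc10, hc20⟩ := mul_ne_zero_facts hp h7 hc
  obtain ⟨hd2, hd4, hd5, hd10, hd20⟩ := mul_ne_zero_facts hp h7 hc'
  simp only [L4, G4,
    hat_koD_dvd_twenty h (by norm_num : 1 ∣ 20) (by norm_num) _ _ hc,
    hat_koD_dvd_twenty h (by norm_num : 1 ∣ 20) (by norm_num) _ _ hc5,
    hat_koD_dvd_twenty h (by norm_num : 1 ∣ 20) (by norm_num) _ _ hc',
    hat_koD_dvd_twenty h (by norm_num : 1 ∣ 20) (by norm_num) _ _ hd5]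
  fin_cases ez <;> simp +decide

/-- `L4` kills `D_{2,z}`. [folklore] -/
private theorem L4_koD_2 (h : Nat.Coprime 20 p) [NeZero (20 * p)] (hp : p.Prime) (h7 : 7 ≤ p)
    (ez : ZMod 20) (bz : ZMod p) {c c' : ZMod p} (hc : c ≠ 0) (hc' : c' ≠ 0) :
    L4 h (koD (20 * p) 2 (pt h ez bz)) c c' = 0 := by
  obtain ⟨hc2, hc4, hc5, hc10, hc20⟩ := mul_ne_zero_facts hp h7 hc
  obtain ⟨hd2, hd4, hd5, hd10, hd20⟩ := mul_ne_zero_facts hp h7 hc'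
  simp only [L4, G4,
    hat_koD_dvd_twenty h (by norm_num : 2 ∣ 20) (by norm_num) _ _ hc,
    hat_koD_dvd_twenty h (by norm_num : 2 ∣ 20) (by norm_num) _ _ hc5,
    hat_koD_dvd_twenty h (by norm_num : 2 ∣ 20) (by norm_num) _ _ hc',
    hat_koD_dvd_twenty h (by norm_num : 2 ∣ 20) (by norm_num) _ _ hd5]
  fin_cases ez <;> simp +decide

/-- `L4` kills `D_{4,z}`. [folklore] -/
private theorem L4_koD_4 (h : Nat.Coprime 20 p) [NeZero (20 * p)] (hp : p.Prime) (h7 : 7 ≤ p)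
    (ez : ZMod 20) (bz : ZMod p) {c c' : ZMod p} (hc : c ≠ 0) (hc' : c' ≠ 0) :
    L4 h (koD (20 * p) 4 (pt h ez bz)) c c' = 0 := by
  obtain ⟨hc2, hc4, hc5, hc10, hc20⟩ := mul_ne_zero_facts hp h7 hc
  obtain ⟨hd2, hd4, hd5, hd10, hd20⟩ := mul_ne_zero_facts hp h7 hc'
  simp only [L4, G4,
    hat_koD_dvd_twenty h (by norm_num : 4 ∣ 20) (by norm_num) _ _ hc,
    hat_koD_dvd_twenty h (by norm_num : 4 ∣ 20) (by norm_num) _ _ hc5,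
    hat_koD_dvd_twenty h (by norm_num : 4 ∣ 20) (by norm_num) _ _ hc',
    hat_koD_dvd_twenty h (by norm_num : 4 ∣ 20) (by norm_num) _ _ hd5]
  fin_cases ez <;> simp +decide

/-- `L4` kills `D_{5,z}`. [folklore] -/
private theorem L4_koD_5 (h : Nat.Coprime 20 p) [NeZero (20 * p)] (hp : p.Prime) (h7 : 7 ≤ p)
    (ez : ZMod 20) (bz : ZMod p) {c c' : ZMod p} (hc : c ≠ 0) (hc' : c' ≠ 0) :
    L4 h (koD (20 * p) 5 (pt h ez bz)) c c' = 0 := by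
  obtain ⟨hc2, hc4, hc5, hc10, hc20⟩ := mul_ne_zero_facts hp h7 hc
  obtain ⟨hd2, hd4, hd5, hd10, hd20⟩ := mul_ne_zero_facts hp h7 hc'
  simp only [L4, G4,
    hat_koD_dvd_twenty h (by norm_num : 5 ∣ 20) (by norm_num) _ _ hc,
    hat_koD_dvd_twenty h (by norm_num : 5 ∣ 20) (by norm_num) _ _ hc5,
    hat_koD_dvd_twenty h (by norm_num : 5 ∣ 20) (by norm_num) _ _ hc',
    hat_koD_dvd_twenty h (by norm_num : 5 ∣ 20) (by norm_num) _ _ hd5]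
  fin_cases ez <;> simp +decide

/-- `L4` kills `D_{10,z}`. [folklore] -/
private theorem L4_koD_10 (h : Nat.Coprime 20 p) [NeZero (20 * p)] (hp : p.Prime) (h7 : 7 ≤ p)
    (ez : ZMod 20) (bz : ZMod p) {c c' : ZMod p} (hc : c ≠ 0) (hc' : c' ≠ 0) :
    L4 h (koD (20 * p) 10 (pt h ez bz)) c c' = 0 := by
  obtain ⟨hc2, hc4, hc5, hc10, hc20⟩ := mul_ne_zero_facts hp h7 hc
  obtain ⟨hd2, hd4, hd5, hd10, hd20⟩ := mul_ne_zero_facts hp h7 hc'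
  simp only [L4, G4,
    hat_koD_dvd_twenty h (by norm_num : 10 ∣ 20) (by norm_num) _ _ hc,
    hat_koD_dvd_twenty h (by norm_num : 10 ∣ 20) (by norm_num) _ _ hc5,
    hat_koD_dvd_twenty h (by norm_num : 10 ∣ 20) (by norm_num) _ _ hc',
    hat_koD_dvd_twenty h (by norm_num : 10 ∣ 20) (by norm_num) _ _ hd5]
  fin_cases ez <;> simp +decide

/-- `L4` kills `D_{20,z}`. [folklore] -/
private theorem L4_koD_20 (h : Nat.Coprime 20 p) [NeZero (20 * p)] (hp : p.Prime) (h7 : 7 ≤ p)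
    (ez : ZMod 20) (bz : ZMod p) {c c' : ZMod p} (hc : c ≠ 0) (hc' : c' ≠ 0) :
    L4 h (koD (20 * p) 20 (pt h ez bz)) c c' = 0 := by
  obtain ⟨hc2, hc4, hc5, hc10, hc20⟩ := mul_ne_zero_facts hp h7 hc
  obtain ⟨hd2, hd4, hd5, hd10, hd20⟩ := mul_ne_zero_facts hp h7 hc'
  simp only [L4, G4,
    hat_koD_dvd_twenty h (by norm_num : 20 ∣ 20) (by norm_num) _ _ hc,
    hat_koD_dvd_twenty h (by norm_num : 20 ∣ 20) (by norm_num) _ _ hc5,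
    hat_koD_dvd_twenty h (by norm_num : 20 ∣ 20) (by norm_num) _ _ hc',
    hat_koD_dvd_twenty h (by norm_num : 20 ∣ 20) (by norm_num) _ _ hd5]
  fin_cases ez <;> simp +decide

/-- `L4` kills `D_{p,z}`. [folklore] -/
private theorem L4_koD_P (h : Nat.Coprime 20 p) [NeZero (20 * p)] (hp : p.Prime) (h7 : 7 ≤ p)
    (ez : ZMod 20) (bz : ZMod p) (c c' : ZMod p) : L4 h (koD (20 * p) p (pt h ez bz)) c c' = 0 := by
  simp only [L4, G4, hat_koD_P h hp]
  fin_cases ez <;> simp +decide [atoms hp h7 c bz, atoms hp h7 c' bz]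

/-- `L4` kills `D_{2p,z}`. [folklore] -/
private theorem L4_koD_2P (h : Nat.Coprime 20 p) [NeZero (20 * p)] (hp : p.Prime) (h7 : 7 ≤ p)
    (ez : ZMod 20) (bz : ZMod p) (c c' : ZMod p) : L4 h (koD (20 * p) (2 * p) (pt h ez bz)) c c' = 0 := by
  simp only [L4, G4, hat_koD_mulP h hp (k := 2) (j := 10) (by norm_num), Nat.cast_ofNat]
  fin_cases ez <;> simp +decide [atoms hp h7 c bz, atoms hp h7 c' bz]

/-- `L4` kills `D_{4p,z}`. [folklore] -/
private theorem L4_koD_4P (h : Nat.Coprime 20 p) [NeZero (20 * p)] (hp : p.Prime) (h7 : 7 ≤ p)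
    (ez : ZMod 20) (bz : ZMod p) (c c' : ZMod p) : L4 h (koD (20 * p) (4 * p) (pt h ez bz)) c c' = 0 := by
  simp only [L4, G4, hat_koD_mulP h hp (k := 4) (j := 5) (by norm_num), Nat.cast_ofNat]
  fin_cases ez <;> simp +decide [atoms hp h7 c bz, atoms hp h7 c' bz] <;> ring

/-- `L4` kills `D_{5p,z}`. [folklore] -/
private theorem L4_koD_5P (h : Nat.Coprime 20 p) [NeZero (20 * p)] (hp : p.Prime) (h7 : 7 ≤ p)
    (ez : ZMod 20) (bz : ZMod p) (c c' : ZMod p) : L4 h (koD (20 * p) (5 * p) (pt h ez bz)) c c' = 0 := by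
  simp only [L4, G4, hat_koD_mulP h hp (k := 5) (j := 4) (by norm_num), Nat.cast_ofNat]
  fin_cases ez <;> simp +decide [atoms hp h7 c bz, atoms hp h7 c' bz] <;> ring

/-- `L4` kills `D_{10p,z}`. [folklore] -/
private theorem L4_koD_10P (h : Nat.Coprime 20 p) [NeZero (20 * p)] (hp : p.Prime) (h7 : 7 ≤ p)
    (ez : ZMod 20) (bz : ZMod p) (c c' : ZMod p) : L4 h (koD (20 * p) (10 * p) (pt h ez bz)) c c' = 0 := by
  simp only [L4, G4, hat_koD_mulP h hp (k := 10) (j := 2) (by norm_num), Nat.cast_ofNat]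
  fin_cases ez <;> simp +decide [atoms hp h7 c bz, atoms hp h7 c' bz] <;> ring

/-- **`L4` kills every distribution vector.** [folklore] -/
private theorem L4_koD (h : Nat.Coprime 20 p) [NeZero (20 * p)] (hp : p.Prime) (h7 : 7 ≤ p) {M : ℕ}
    (hM : M ∈ (20 * p).divisors) (z : ZMod (20 * p)) {c c' : ZMod p} (hc : c ≠ 0) (hc' : c' ≠ 0) :
    L4 h (koD (20 * p) M z) c c' = 0 := by
  obtain ⟨ez, bz, rfl⟩ : ∃ ez bz, z = pt h ez bz := ⟨_, _, (pt_crt h z).symm⟩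
  rcases eq_of_dvd_twenty_mul_prime hp h7 (Nat.dvd_of_mem_divisors hM) with
    rfl | rfl | rfl | rfl | rfl | rfl | rfl | rfl | rfl | rfl | rfl | hM20
  · exact L4_koD_1 h hp h7 ez bz hc hc'
  · exact L4_koD_2 h hp h7 ez bz hc hc'
  · exact L4_koD_4 h hp h7 ez bz hc hc'
  · exact L4_koD_5 h hp h7 ez bz hc hc'
  · exact L4_koD_10 h hp h7 ez bz hc hc'
  · exact L4_koD_20 h hp h7 ez bz hc hc'
  · exact L4_koD_P h hp h7 ez bz c c'
  · exact L4_koD_2P h hp h7 ez bz c c'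
  · exact L4_koD_4P h hp h7 ez bz c c'
  · exact L4_koD_5P h hp h7 ez bz c c'
  · exact L4_koD_10P h hp h7 ez bz c c'
  · rw [hM20]
    simp [L4, G4, hat, koD_top]

/-- `L45` kills `D_{1,z}`. [folklore] -/
private theorem L45_koD_1 (h : Nat.Coprime 20 p) [NeZero (20 * p)] (_hp : p.Prime) (_h7 : 7 ≤ p)
    (ez : ZMod 20) (bz : ZMod p) {c c' : ZMod p} (hc : c ≠ 0) (hc' : c' ≠ 0) :
    L45 h (koD (20 * p) 1 (pt h ez bz)) c c' = 0 := by
  simp only [L45, G45,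
    hat_koD_dvd_twenty h (by norm_num : 1 ∣ 20) (by norm_num) _ _ hc,
    hat_koD_dvd_twenty h (by norm_num : 1 ∣ 20) (by norm_num) _ _ hc']
  fin_cases ez <;> simp +decide

/-- `L45` kills `D_{2,z}`. [folklore] -/
private theorem L45_koD_2 (h : Nat.Coprime 20 p) [NeZero (20 * p)] (_hp : p.Prime) (_h7 : 7 ≤ p)
    (ez : ZMod 20) (bz : ZMod p) {c c' : ZMod p} (hc : c ≠ 0) (hc' : c' ≠ 0) :
    L45 h (koD (20 * p) 2 (pt h ez bz)) c c' = 0 := by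
  simp only [L45, G45,
    hat_koD_dvd_twenty h (by norm_num : 2 ∣ 20) (by norm_num) _ _ hc,
    hat_koD_dvd_twenty h (by norm_num : 2 ∣ 20) (by norm_num) _ _ hc']
  fin_cases ez <;> simp +decide

/-- `L45` kills `D_{4,z}`. [folklore] -/
private theorem L45_koD_4 (h : Nat.Coprime 20 p) [NeZero (20 * p)] (_hp : p.Prime) (_h7 : 7 ≤ p)
    (ez : ZMod 20) (bz : ZMod p) {c c' : ZMod p} (hc : c ≠ 0) (hc' : c' ≠ 0) :
    L45 h (koD (20 * p) 4 (pt h ez bz)) c c' = 0 := by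
  simp only [L45, G45,
    hat_koD_dvd_twenty h (by norm_num : 4 ∣ 20) (by norm_num) _ _ hc,
    hat_koD_dvd_twenty h (by norm_num : 4 ∣ 20) (by norm_num) _ _ hc']
  fin_cases ez <;> simp +decide

/-- `L45` kills `D_{5,z}`. [folklore] -/
private theorem L45_koD_5 (h : Nat.Coprime 20 p) [NeZero (20 * p)] (_hp : p.Prime) (_h7 : 7 ≤ p)
    (ez : ZMod 20) (bz : ZMod p) {c c' : ZMod p} (hc : c ≠ 0) (hc' : c' ≠ 0) :
    L45 h (koD (20 * p) 5 (pt h ez bz)) c c' = 0 := by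
  simp only [L45, G45,
    hat_koD_dvd_twenty h (by norm_num : 5 ∣ 20) (by norm_num) _ _ hc,
    hat_koD_dvd_twenty h (by norm_num : 5 ∣ 20) (by norm_num) _ _ hc']
  fin_cases ez <;> simp +decide

/-- `L45` kills `D_{10,z}`. [folklore] -/
private theorem L45_koD_10 (h : Nat.Coprime 20 p) [NeZero (20 * p)] (_hp : p.Prime) (_h7 : 7 ≤ p)
    (ez : ZMod 20) (bz : ZMod p) {c c' : ZMod p} (hc : c ≠ 0) (hc' : c' ≠ 0) :
    L45 h (koD (20 * p) 10 (pt h ez bz)) c c' = 0 := by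
  simp only [L45, G45,
    hat_koD_dvd_twenty h (by norm_num : 10 ∣ 20) (by norm_num) _ _ hc,
    hat_koD_dvd_twenty h (by norm_num : 10 ∣ 20) (by norm_num) _ _ hc']
  fin_cases ez <;> simp +decide

/-- `L45` kills `D_{20,z}`. [folklore] -/
private theorem L45_koD_20 (h : Nat.Coprime 20 p) [NeZero (20 * p)] (_hp : p.Prime) (_h7 : 7 ≤ p)
    (ez : ZMod 20) (bz : ZMod p) {c c' : ZMod p} (hc : c ≠ 0) (hc' : c' ≠ 0) :
    L45 h (koD (20 * p) 20 (pt h ez bz)) c c' = 0 := by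
  simp only [L45, G45,
    hat_koD_dvd_twenty h (by norm_num : 20 ∣ 20) (by norm_num) _ _ hc,
    hat_koD_dvd_twenty h (by norm_num : 20 ∣ 20) (by norm_num) _ _ hc']
  fin_cases ez <;> simp +decide

/-- `L45` kills `D_{p,z}`. [folklore] -/
private theorem L45_koD_P (h : Nat.Coprime 20 p) [NeZero (20 * p)] (hp : p.Prime) (h7 : 7 ≤ p)
    (ez : ZMod 20) (bz : ZMod p) (c c' : ZMod p) : L45 h (koD (20 * p) p (pt h ez bz)) c c' = 0 := by
  simp only [L45, G45, hat_koD_P h hp]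
  fin_cases ez <;> simp +decide [atoms hp h7 c bz, atoms hp h7 c' bz]

/-- `L45` kills `D_{2p,z}`. [folklore] -/
private theorem L45_koD_2P (h : Nat.Coprime 20 p) [NeZero (20 * p)] (hp : p.Prime) (h7 : 7 ≤ p)
    (ez : ZMod 20) (bz : ZMod p) (c c' : ZMod p) : L45 h (koD (20 * p) (2 * p) (pt h ez bz)) c c' = 0 := by
  simp only [L45, G45, hat_koD_mulP h hp (k := 2) (j := 10) (by norm_num), Nat.cast_ofNat]
  fin_cases ez <;> simp +decide [atoms hp h7 c bz, atoms hp h7 c' bz]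

/-- `L45` kills `D_{4p,z}`. [folklore] -/
private theorem L45_koD_4P (h : Nat.Coprime 20 p) [NeZero (20 * p)] (hp : p.Prime) (h7 : 7 ≤ p)
    (ez : ZMod 20) (bz : ZMod p) (c c' : ZMod p) : L45 h (koD (20 * p) (4 * p) (pt h ez bz)) c c' = 0 := by
  simp only [L45, G45, hat_koD_mulP h hp (k := 4) (j := 5) (by norm_num), Nat.cast_ofNat]
  fin_cases ez <;> simp +decide [atoms hp h7 c bz, atoms hp h7 c' bz] <;> ring

/-- `L45` kills `D_{5p,z}`. [folklore] -/
private theorem L45_koD_5P (h : Nat.Coprime 20 p) [NeZero (20 * p)] (hp : p.Prime) (h7 : 7 ≤ p)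
    (ez : ZMod 20) (bz : ZMod p) (c c' : ZMod p) : L45 h (koD (20 * p) (5 * p) (pt h ez bz)) c c' = 0 := by
  simp only [L45, G45, hat_koD_mulP h hp (k := 5) (j := 4) (by norm_num), Nat.cast_ofNat]
  fin_cases ez <;> simp +decide [atoms hp h7 c bz, atoms hp h7 c' bz]

/-- `L45` kills `D_{10p,z}`. [folklore] -/
private theorem L45_koD_10P (h : Nat.Coprime 20 p) [NeZero (20 * p)] (hp : p.Prime) (h7 : 7 ≤ p)
    (ez : ZMod 20) (bz : ZMod p) (c c' : ZMod p) : L45 h (koD (20 * p) (10 * p) (pt h ez bz)) c c' = 0 := by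
  simp only [L45, G45, hat_koD_mulP h hp (k := 10) (j := 2) (by norm_num), Nat.cast_ofNat]
  fin_cases ez <;> simp +decide [atoms hp h7 c bz, atoms hp h7 c' bz]

/-- **`L45` kills every distribution vector.** [folklore] -/
private theorem L45_koD (h : Nat.Coprime 20 p) [NeZero (20 * p)] (hp : p.Prime) (h7 : 7 ≤ p) {M : ℕ}
    (hM : M ∈ (20 * p).divisors) (z : ZMod (20 * p)) {c c' : ZMod p} (hc : c ≠ 0) (hc' : c' ≠ 0) :
    L45 h (koD (20 * p) M z) c c' = 0 := by
  obtain ⟨ez, bz, rfl⟩ : ∃ ez bz, z = pt h ez bz := ⟨_, _, (pt_crt h z).symm⟩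
  rcases eq_of_dvd_twenty_mul_prime hp h7 (Nat.dvd_of_mem_divisors hM) with
    rfl | rfl | rfl | rfl | rfl | rfl | rfl | rfl | rfl | rfl | rfl | hM20
  · exact L45_koD_1 h hp h7 ez bz hc hc'
  · exact L45_koD_2 h hp h7 ez bz hc hc'
  · exact L45_koD_4 h hp h7 ez bz hc hc'
  · exact L45_koD_5 h hp h7 ez bz hc hc'
  · exact L45_koD_10 h hp h7 ez bz hc hc'
  · exact L45_koD_20 h hp h7 ez bz hc hc'
  · exact L45_koD_P h hp h7 ez bz c c'
  · exact L45_koD_2P h hp h7 ez bz c c'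
  · exact L45_koD_4P h hp h7 ez bz c c'
  · exact L45_koD_5P h hp h7 ez bz c c'
  · exact L45_koD_10P h hp h7 ez bz c c'
  · rw [hM20]
    simp [L45, G45, hat, koD_top]

/-- `LA` kills `D_{1,z}`. [folklore] -/
private theorem LA_koD_1 (h : Nat.Coprime 20 p) [NeZero (20 * p)] (hp : p.Prime) (h7 : 7 ≤ p)
    (ez : ZMod 20) (bz : ZMod p) {c c' : ZMod p} (hc : c ≠ 0) (hc' : c' ≠ 0) :
    LA h (koD (20 * p) 1 (pt h ez bz)) c c' = 0 := by
  obtain ⟨hc2, hc4, hc5, hc10, hc20⟩ := mul_ne_zero_facts hp h7 hc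
  obtain ⟨hd2, hd4, hd5, hd10, hd20⟩ := mul_ne_zero_facts hp h7 hc'
  simp only [LA, GA,
    hat_koD_dvd_twenty h (by norm_num : 1 ∣ 20) (by norm_num) _ _ hc,
    hat_koD_dvd_twenty h (by norm_num : 1 ∣ 20) (by norm_num) _ _ hc2,
    hat_koD_dvd_twenty h (by norm_num : 1 ∣ 20) (by norm_num) _ _ hc4,
    hat_koD_dvd_twenty h (by norm_num : 1 ∣ 20) (by norm_num) _ _ hc',
    hat_koD_dvd_twenty h (by norm_num : 1 ∣ 20) (by norm_num) _ _ hd2,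
    hat_koD_dvd_twenty h (by norm_num : 1 ∣ 20) (by norm_num) _ _ hd4]
  fin_cases ez <;> simp +decide

/-- `LA` kills `D_{2,z}`. [folklore] -/
private theorem LA_koD_2 (h : Nat.Coprime 20 p) [NeZero (20 * p)] (hp : p.Prime) (h7 : 7 ≤ p)
    (ez : ZMod 20) (bz : ZMod p) {c c' : ZMod p} (hc : c ≠ 0) (hc' : c' ≠ 0) :
    LA h (koD (20 * p) 2 (pt h ez bz)) c c' = 0 := by
  obtain ⟨hc2, hc4, hc5, hc10, hc20⟩ := mul_ne_zero_facts hp h7 hc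
  obtain ⟨hd2, hd4, hd5, hd10, hd20⟩ := mul_ne_zero_facts hp h7 hc'
  simp only [LA, GA,
    hat_koD_dvd_twenty h (by norm_num : 2 ∣ 20) (by norm_num) _ _ hc,
    hat_koD_dvd_twenty h (by norm_num : 2 ∣ 20) (by norm_num) _ _ hc2,
    hat_koD_dvd_twenty h (by norm_num : 2 ∣ 20) (by norm_num) _ _ hc4,
    hat_koD_dvd_twenty h (by norm_num : 2 ∣ 20) (by norm_num) _ _ hc',
    hat_koD_dvd_twenty h (by norm_num : 2 ∣ 20) (by norm_num) _ _ hd2,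
    hat_koD_dvd_twenty h (by norm_num : 2 ∣ 20) (by norm_num) _ _ hd4]
  fin_cases ez <;> simp +decide

/-- `LA` kills `D_{4,z}`. [folklore] -/
private theorem LA_koD_4 (h : Nat.Coprime 20 p) [NeZero (20 * p)] (hp : p.Prime) (h7 : 7 ≤ p)
    (ez : ZMod 20) (bz : ZMod p) {c c' : ZMod p} (hc : c ≠ 0) (hc' : c' ≠ 0) :
    LA h (koD (20 * p) 4 (pt h ez bz)) c c' = 0 := by
  obtain ⟨hc2, hc4, hc5, hc10, hc20⟩ := mul_ne_zero_facts hp h7 hc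
  obtain ⟨hd2, hd4, hd5, hd10, hd20⟩ := mul_ne_zero_facts hp h7 hc'
  simp only [LA, GA,
    hat_koD_dvd_twenty h (by norm_num : 4 ∣ 20) (by norm_num) _ _ hc,
    hat_koD_dvd_twenty h (by norm_num : 4 ∣ 20) (by norm_num) _ _ hc2,
    hat_koD_dvd_twenty h (by norm_num : 4 ∣ 20) (by norm_num) _ _ hc4,
    hat_koD_dvd_twenty h (by norm_num : 4 ∣ 20) (by norm_num) _ _ hc',
    hat_koD_dvd_twenty h (by norm_num : 4 ∣ 20) (by norm_num) _ _ hd2,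
    hat_koD_dvd_twenty h (by norm_num : 4 ∣ 20) (by norm_num) _ _ hd4]
  fin_cases ez <;> simp +decide

/-- `LA` kills `D_{5,z}`. [folklore] -/
private theorem LA_koD_5 (h : Nat.Coprime 20 p) [NeZero (20 * p)] (hp : p.Prime) (h7 : 7 ≤ p)
    (ez : ZMod 20) (bz : ZMod p) {c c' : ZMod p} (hc : c ≠ 0) (hc' : c' ≠ 0) :
    LA h (koD (20 * p) 5 (pt h ez bz)) c c' = 0 := by
  obtain ⟨hc2, hc4, hc5, hc10, hc20⟩ := mul_ne_zero_facts hp h7 hc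
  obtain ⟨hd2, hd4, hd5, hd10, hd20⟩ := mul_ne_zero_facts hp h7 hc'
  simp only [LA, GA,
    hat_koD_dvd_twenty h (by norm_num : 5 ∣ 20) (by norm_num) _ _ hc,
    hat_koD_dvd_twenty h (by norm_num : 5 ∣ 20) (by norm_num) _ _ hc2,
    hat_koD_dvd_twenty h (by norm_num : 5 ∣ 20) (by norm_num) _ _ hc4,
    hat_koD_dvd_twenty h (by norm_num : 5 ∣ 20) (by norm_num) _ _ hc',
    hat_koD_dvd_twenty h (by norm_num : 5 ∣ 20) (by norm_num) _ _ hd2,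
    hat_koD_dvd_twenty h (by norm_num : 5 ∣ 20) (by norm_num) _ _ hd4]
  fin_cases ez <;> simp +decide

/-- `LA` kills `D_{10,z}`. [folklore] -/
private theorem LA_koD_10 (h : Nat.Coprime 20 p) [NeZero (20 * p)] (hp : p.Prime) (h7 : 7 ≤ p)
    (ez : ZMod 20) (bz : ZMod p) {c c' : ZMod p} (hc : c ≠ 0) (hc' : c' ≠ 0) :
    LA h (koD (20 * p) 10 (pt h ez bz)) c c' = 0 := by
  obtain ⟨hc2, hc4, hc5, hc10, hc20⟩ := mul_ne_zero_facts hp h7 hc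
  obtain ⟨hd2, hd4, hd5, hd10, hd20⟩ := mul_ne_zero_facts hp h7 hc'
  simp only [LA, GA,
    hat_koD_dvd_twenty h (by norm_num : 10 ∣ 20) (by norm_num) _ _ hc,
    hat_koD_dvd_twenty h (by norm_num : 10 ∣ 20) (by norm_num) _ _ hc2,
    hat_koD_dvd_twenty h (by norm_num : 10 ∣ 20) (by norm_num) _ _ hc4,
    hat_koD_dvd_twenty h (by norm_num : 10 ∣ 20) (by norm_num) _ _ hc',
    hat_koD_dvd_twenty h (by norm_num : 10 ∣ 20) (by norm_num) _ _ hd2,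
    hat_koD_dvd_twenty h (by norm_num : 10 ∣ 20) (by norm_num) _ _ hd4]
  fin_cases ez <;> simp +decide

/-- `LA` kills `D_{20,z}`. [folklore] -/
private theorem LA_koD_20 (h : Nat.Coprime 20 p) [NeZero (20 * p)] (hp : p.Prime) (h7 : 7 ≤ p)
    (ez : ZMod 20) (bz : ZMod p) {c c' : ZMod p} (hc : c ≠ 0) (hc' : c' ≠ 0) :
    LA h (koD (20 * p) 20 (pt h ez bz)) c c' = 0 := by
  obtain ⟨hc2, hc4, hc5, hc10, hc20⟩ := mul_ne_zero_facts hp h7 hc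
  obtain ⟨hd2, hd4, hd5, hd10, hd20⟩ := mul_ne_zero_facts hp h7 hc'
  simp only [LA, GA,
    hat_koD_dvd_twenty h (by norm_num : 20 ∣ 20) (by norm_num) _ _ hc,
    hat_koD_dvd_twenty h (by norm_num : 20 ∣ 20) (by norm_num) _ _ hc2,
    hat_koD_dvd_twenty h (by norm_num : 20 ∣ 20) (by norm_num) _ _ hc4,
    hat_koD_dvd_twenty h (by norm_num : 20 ∣ 20) (by norm_num) _ _ hc',
    hat_koD_dvd_twenty h (by norm_num : 20 ∣ 20) (by norm_num) _ _ hd2,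
    hat_koD_dvd_twenty h (by norm_num : 20 ∣ 20) (by norm_num) _ _ hd4]
  fin_cases ez <;> simp +decide

/-- `LA` kills `D_{p,z}`. [folklore] -/
private theorem LA_koD_P (h : Nat.Coprime 20 p) [NeZero (20 * p)] (hp : p.Prime) (h7 : 7 ≤ p)
    (ez : ZMod 20) (bz : ZMod p) (c c' : ZMod p) : LA h (koD (20 * p) p (pt h ez bz)) c c' = 0 := by
  simp only [LA, GA, hat_koD_P h hp]
  fin_cases ez <;> simp +decide [atoms hp h7 c bz, atoms hp h7 c' bz]

/-- `LA` kills `D_{2p,z}`. [folklore] -/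
private theorem LA_koD_2P (h : Nat.Coprime 20 p) [NeZero (20 * p)] (hp : p.Prime) (h7 : 7 ≤ p)
    (ez : ZMod 20) (bz : ZMod p) (c c' : ZMod p) : LA h (koD (20 * p) (2 * p) (pt h ez bz)) c c' = 0 := by
  simp only [LA, GA, hat_koD_mulP h hp (k := 2) (j := 10) (by norm_num), Nat.cast_ofNat]
  fin_cases ez <;> simp +decide [atoms hp h7 c bz, atoms hp h7 c' bz]

/-- `LA` kills `D_{4p,z}`. [folklore] -/
private theorem LA_koD_4P (h : Nat.Coprime 20 p) [NeZero (20 * p)] (hp : p.Prime) (h7 : 7 ≤ p)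
    (ez : ZMod 20) (bz : ZMod p) (c c' : ZMod p) : LA h (koD (20 * p) (4 * p) (pt h ez bz)) c c' = 0 := by
  simp only [LA, GA, hat_koD_mulP h hp (k := 4) (j := 5) (by norm_num), Nat.cast_ofNat]
  fin_cases ez <;> simp +decide [atoms hp h7 c bz, atoms hp h7 c' bz]

/-- `LA` kills `D_{5p,z}`. [folklore] -/
private theorem LA_koD_5P (h : Nat.Coprime 20 p) [NeZero (20 * p)] (hp : p.Prime) (h7 : 7 ≤ p)
    (ez : ZMod 20) (bz : ZMod p) (c c' : ZMod p) : LA h (koD (20 * p) (5 * p) (pt h ez bz)) c c' = 0 := by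
  simp only [LA, GA, hat_koD_mulP h hp (k := 5) (j := 4) (by norm_num), Nat.cast_ofNat]
  fin_cases ez <;> simp +decide [atoms hp h7 c bz, atoms hp h7 c' bz] <;> ring

/-- `LA` kills `D_{10p,z}`. [folklore] -/
private theorem LA_koD_10P (h : Nat.Coprime 20 p) [NeZero (20 * p)] (hp : p.Prime) (h7 : 7 ≤ p)
    (ez : ZMod 20) (bz : ZMod p) (c c' : ZMod p) : LA h (koD (20 * p) (10 * p) (pt h ez bz)) c c' = 0 := by
  simp only [LA, GA, hat_koD_mulP h hp (k := 10) (j := 2) (by norm_num), Nat.cast_ofNat]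
  fin_cases ez <;> simp +decide [atoms hp h7 c bz, atoms hp h7 c' bz] <;> ring

/-- **`LA` kills every distribution vector.** [folklore] -/
private theorem LA_koD (h : Nat.Coprime 20 p) [NeZero (20 * p)] (hp : p.Prime) (h7 : 7 ≤ p) {M : ℕ}
    (hM : M ∈ (20 * p).divisors) (z : ZMod (20 * p)) {c c' : ZMod p} (hc : c ≠ 0) (hc' : c' ≠ 0) :
    LA h (koD (20 * p) M z) c c' = 0 := by
  obtain ⟨ez, bz, rfl⟩ : ∃ ez bz, z = pt h ez bz := ⟨_, _, (pt_crt h z).symm⟩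
  rcases eq_of_dvd_twenty_mul_prime hp h7 (Nat.dvd_of_mem_divisors hM) with
    rfl | rfl | rfl | rfl | rfl | rfl | rfl | rfl | rfl | rfl | rfl | hM20
  · exact LA_koD_1 h hp h7 ez bz hc hc'
  · exact LA_koD_2 h hp h7 ez bz hc hc'
  · exact LA_koD_4 h hp h7 ez bz hc hc'
  · exact LA_koD_5 h hp h7 ez bz hc hc'
  · exact LA_koD_10 h hp h7 ez bz hc hc'
  · exact LA_koD_20 h hp h7 ez bz hc hc'
  · exact LA_koD_P h hp h7 ez bz c c'
  · exact LA_koD_2P h hp h7 ez bz c c'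
  · exact LA_koD_4P h hp h7 ez bz c c'
  · exact LA_koD_5P h hp h7 ez bz c c'
  · exact LA_koD_10P h hp h7 ez bz c c'
  · rw [hM20]
    simp [LA, GA, hat, koD_top]

/-- `LB` kills `D_{1,z}`. [folklore] -/
private theorem LB_koD_1 (h : Nat.Coprime 20 p) [NeZero (20 * p)] (hp : p.Prime) (h7 : 7 ≤ p)
    (ez : ZMod 20) (bz : ZMod p) {c c' : ZMod p} (hc : c ≠ 0) (hc' : c' ≠ 0) :
    LB h (koD (20 * p) 1 (pt h ez bz)) c c' = 0 := by
  obtain ⟨hc2, hc4, hc5, hc10, hc20⟩ := mul_ne_zero_facts hp h7 hc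
  obtain ⟨hd2, hd4, hd5, hd10, hd20⟩ := mul_ne_zero_facts hp h7 hc'
  simp only [LB, GB,
    hat_koD_dvd_twenty h (by norm_num : 1 ∣ 20) (by norm_num) _ _ hc,
    hat_koD_dvd_twenty h (by norm_num : 1 ∣ 20) (by norm_num) _ _ hc2,
    hat_koD_dvd_twenty h (by norm_num : 1 ∣ 20) (by norm_num) _ _ hc4,
    hat_koD_dvd_twenty h (by norm_num : 1 ∣ 20) (by norm_num) _ _ hc',
    hat_koD_dvd_twenty h (by norm_num : 1 ∣ 20) (by norm_num) _ _ hd2,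
    hat_koD_dvd_twenty h (by norm_num : 1 ∣ 20) (by norm_num) _ _ hd4]
  fin_cases ez <;> simp +decide

/-- `LB` kills `D_{2,z}`. [folklore] -/
private theorem LB_koD_2 (h : Nat.Coprime 20 p) [NeZero (20 * p)] (hp : p.Prime) (h7 : 7 ≤ p)
    (ez : ZMod 20) (bz : ZMod p) {c c' : ZMod p} (hc : c ≠ 0) (hc' : c' ≠ 0) :
    LB h (koD (20 * p) 2 (pt h ez bz)) c c' = 0 := by
  obtain ⟨hc2, hc4, hc5, hc10, hc20⟩ := mul_ne_zero_facts hp h7 hc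
  obtain ⟨hd2, hd4, hd5, hd10, hd20⟩ := mul_ne_zero_facts hp h7 hc'
  simp only [LB, GB,
    hat_koD_dvd_twenty h (by norm_num : 2 ∣ 20) (by norm_num) _ _ hc,
    hat_koD_dvd_twenty h (by norm_num : 2 ∣ 20) (by norm_num) _ _ hc2,
    hat_koD_dvd_twenty h (by norm_num : 2 ∣ 20) (by norm_num) _ _ hc4,
    hat_koD_dvd_twenty h (by norm_num : 2 ∣ 20) (by norm_num) _ _ hc',
    hat_koD_dvd_twenty h (by norm_num : 2 ∣ 20) (by norm_num) _ _ hd2,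
    hat_koD_dvd_twenty h (by norm_num : 2 ∣ 20) (by norm_num) _ _ hd4]
  fin_cases ez <;> simp +decide

/-- `LB` kills `D_{4,z}`. [folklore] -/
private theorem LB_koD_4 (h : Nat.Coprime 20 p) [NeZero (20 * p)] (hp : p.Prime) (h7 : 7 ≤ p)
    (ez : ZMod 20) (bz : ZMod p) {c c' : ZMod p} (hc : c ≠ 0) (hc' : c' ≠ 0) :
    LB h (koD (20 * p) 4 (pt h ez bz)) c c' = 0 := by
  obtain ⟨hc2, hc4, hc5, hc10, hc20⟩ := mul_ne_zero_facts hp h7 hc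
  obtain ⟨hd2, hd4, hd5, hd10, hd20⟩ := mul_ne_zero_facts hp h7 hc'
  simp only [LB, GB,
    hat_koD_dvd_twenty h (by norm_num : 4 ∣ 20) (by norm_num) _ _ hc,
    hat_koD_dvd_twenty h (by norm_num : 4 ∣ 20) (by norm_num) _ _ hc2,
    hat_koD_dvd_twenty h (by norm_num : 4 ∣ 20) (by norm_num) _ _ hc4,
    hat_koD_dvd_twenty h (by norm_num : 4 ∣ 20) (by norm_num) _ _ hc',
    hat_koD_dvd_twenty h (by norm_num : 4 ∣ 20) (by norm_num) _ _ hd2,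
    hat_koD_dvd_twenty h (by norm_num : 4 ∣ 20) (by norm_num) _ _ hd4]
  fin_cases ez <;> simp +decide

/-- `LB` kills `D_{5,z}`. [folklore] -/
private theorem LB_koD_5 (h : Nat.Coprime 20 p) [NeZero (20 * p)] (hp : p.Prime) (h7 : 7 ≤ p)
    (ez : ZMod 20) (bz : ZMod p) {c c' : ZMod p} (hc : c ≠ 0) (hc' : c' ≠ 0) :
    LB h (koD (20 * p) 5 (pt h ez bz)) c c' = 0 := by
  obtain ⟨hc2, hc4, hc5, hc10, hc20⟩ := mul_ne_zero_facts hp h7 hc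
  obtain ⟨hd2, hd4, hd5, hd10, hd20⟩ := mul_ne_zero_facts hp h7 hc'
  simp only [LB, GB,
    hat_koD_dvd_twenty h (by norm_num : 5 ∣ 20) (by norm_num) _ _ hc,
    hat_koD_dvd_twenty h (by norm_num : 5 ∣ 20) (by norm_num) _ _ hc2,
    hat_koD_dvd_twenty h (by norm_num : 5 ∣ 20) (by norm_num) _ _ hc4,
    hat_koD_dvd_twenty h (by norm_num : 5 ∣ 20) (by norm_num) _ _ hc',
    hat_koD_dvd_twenty h (by norm_num : 5 ∣ 20) (by norm_num) _ _ hd2,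
    hat_koD_dvd_twenty h (by norm_num : 5 ∣ 20) (by norm_num) _ _ hd4]
  fin_cases ez <;> simp +decide

/-- `LB` kills `D_{10,z}`. [folklore] -/
private theorem LB_koD_10 (h : Nat.Coprime 20 p) [NeZero (20 * p)] (hp : p.Prime) (h7 : 7 ≤ p)
    (ez : ZMod 20) (bz : ZMod p) {c c' : ZMod p} (hc : c ≠ 0) (hc' : c' ≠ 0) :
    LB h (koD (20 * p) 10 (pt h ez bz)) c c' = 0 := by
  obtain ⟨hc2, hc4, hc5, hc10, hc20⟩ := mul_ne_zero_facts hp h7 hc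
  obtain ⟨hd2, hd4, hd5, hd10, hd20⟩ := mul_ne_zero_facts hp h7 hc'
  simp only [LB, GB,
    hat_koD_dvd_twenty h (by norm_num : 10 ∣ 20) (by norm_num) _ _ hc,
    hat_koD_dvd_twenty h (by norm_num : 10 ∣ 20) (by norm_num) _ _ hc2,
    hat_koD_dvd_twenty h (by norm_num : 10 ∣ 20) (by norm_num) _ _ hc4,
    hat_koD_dvd_twenty h (by norm_num : 10 ∣ 20) (by norm_num) _ _ hc',
    hat_koD_dvd_twenty h (by norm_num : 10 ∣ 20) (by norm_num) _ _ hd2,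
    hat_koD_dvd_twenty h (by norm_num : 10 ∣ 20) (by norm_num) _ _ hd4]
  fin_cases ez <;> simp +decide

/-- `LB` kills `D_{20,z}`. [folklore] -/
private theorem LB_koD_20 (h : Nat.Coprime 20 p) [NeZero (20 * p)] (hp : p.Prime) (h7 : 7 ≤ p)
    (ez : ZMod 20) (bz : ZMod p) {c c' : ZMod p} (hc : c ≠ 0) (hc' : c' ≠ 0) :
    LB h (koD (20 * p) 20 (pt h ez bz)) c c' = 0 := by
  obtain ⟨hc2, hc4, hc5, hc10, hc20⟩ := mul_ne_zero_facts hp h7 hc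
  obtain ⟨hd2, hd4, hd5, hd10, hd20⟩ := mul_ne_zero_facts hp h7 hc'
  simp only [LB, GB,
    hat_koD_dvd_twenty h (by norm_num : 20 ∣ 20) (by norm_num) _ _ hc,
    hat_koD_dvd_twenty h (by norm_num : 20 ∣ 20) (by norm_num) _ _ hc2,
    hat_koD_dvd_twenty h (by norm_num : 20 ∣ 20) (by norm_num) _ _ hc4,
    hat_koD_dvd_twenty h (by norm_num : 20 ∣ 20) (by norm_num) _ _ hc',
    hat_koD_dvd_twenty h (by norm_num : 20 ∣ 20) (by norm_num) _ _ hd2,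
    hat_koD_dvd_twenty h (by norm_num : 20 ∣ 20) (by norm_num) _ _ hd4]
  fin_cases ez <;> simp +decide

/-- `LB` kills `D_{p,z}`. [folklore] -/
private theorem LB_koD_P (h : Nat.Coprime 20 p) [NeZero (20 * p)] (hp : p.Prime) (h7 : 7 ≤ p)
    (ez : ZMod 20) (bz : ZMod p) (c c' : ZMod p) : LB h (koD (20 * p) p (pt h ez bz)) c c' = 0 := by
  simp only [LB, GB, hat_koD_P h hp]
  fin_cases ez <;> simp +decide [atoms hp h7 c bz, atoms hp h7 c' bz]

/-- `LB` kills `D_{2p,z}`. [folklore] -/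
private theorem LB_koD_2P (h : Nat.Coprime 20 p) [NeZero (20 * p)] (hp : p.Prime) (h7 : 7 ≤ p)
    (ez : ZMod 20) (bz : ZMod p) (c c' : ZMod p) : LB h (koD (20 * p) (2 * p) (pt h ez bz)) c c' = 0 := by
  simp only [LB, GB, hat_koD_mulP h hp (k := 2) (j := 10) (by norm_num), Nat.cast_ofNat]
  fin_cases ez <;> simp +decide [atoms hp h7 c bz, atoms hp h7 c' bz]

/-- `LB` kills `D_{4p,z}`. [folklore] -/
private theorem LB_koD_4P (h : Nat.Coprime 20 p) [NeZero (20 * p)] (hp : p.Prime) (h7 : 7 ≤ p)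
    (ez : ZMod 20) (bz : ZMod p) (c c' : ZMod p) : LB h (koD (20 * p) (4 * p) (pt h ez bz)) c c' = 0 := by
  simp only [LB, GB, hat_koD_mulP h hp (k := 4) (j := 5) (by norm_num), Nat.cast_ofNat]
  fin_cases ez <;> simp +decide [atoms hp h7 c bz, atoms hp h7 c' bz]

/-- `LB` kills `D_{5p,z}`. [folklore] -/
private theorem LB_koD_5P (h : Nat.Coprime 20 p) [NeZero (20 * p)] (hp : p.Prime) (h7 : 7 ≤ p)
    (ez : ZMod 20) (bz : ZMod p) (c c' : ZMod p) : LB h (koD (20 * p) (5 * p) (pt h ez bz)) c c' = 0 := by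
  simp only [LB, GB, hat_koD_mulP h hp (k := 5) (j := 4) (by norm_num), Nat.cast_ofNat]
  fin_cases ez <;> simp +decide [atoms hp h7 c bz, atoms hp h7 c' bz] <;> ring

/-- `LB` kills `D_{10p,z}`. [folklore] -/
private theorem LB_koD_10P (h : Nat.Coprime 20 p) [NeZero (20 * p)] (hp : p.Prime) (h7 : 7 ≤ p)
    (ez : ZMod 20) (bz : ZMod p) (c c' : ZMod p) : LB h (koD (20 * p) (10 * p) (pt h ez bz)) c c' = 0 := by
  simp only [LB, GB, hat_koD_mulP h hp (k := 10) (j := 2) (by norm_num), Nat.cast_ofNat]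
  fin_cases ez <;> simp +decide [atoms hp h7 c bz, atoms hp h7 c' bz] <;> ring

/-- **`LB` kills every distribution vector.** [folklore] -/
private theorem LB_koD (h : Nat.Coprime 20 p) [NeZero (20 * p)] (hp : p.Prime) (h7 : 7 ≤ p) {M : ℕ}
    (hM : M ∈ (20 * p).divisors) (z : ZMod (20 * p)) {c c' : ZMod p} (hc : c ≠ 0) (hc' : c' ≠ 0) :
    LB h (koD (20 * p) M z) c c' = 0 := by
  obtain ⟨ez, bz, rfl⟩ : ∃ ez bz, z = pt h ez bz := ⟨_, _, (pt_crt h z).symm⟩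
  rcases eq_of_dvd_twenty_mul_prime hp h7 (Nat.dvd_of_mem_divisors hM) with
    rfl | rfl | rfl | rfl | rfl | rfl | rfl | rfl | rfl | rfl | rfl | hM20
  · exact LB_koD_1 h hp h7 ez bz hc hc'
  · exact LB_koD_2 h hp h7 ez bz hc hc'
  · exact LB_koD_4 h hp h7 ez bz hc hc'
  · exact LB_koD_5 h hp h7 ez bz hc hc'
  · exact LB_koD_10 h hp h7 ez bz hc hc'
  · exact LB_koD_20 h hp h7 ez bz hc hc'
  · exact LB_koD_P h hp h7 ez bz c c'
  · exact LB_koD_2P h hp h7 ez bz c c'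
  · exact LB_koD_4P h hp h7 ez bz c c'
  · exact LB_koD_5P h hp h7 ez bz c c'
  · exact LB_koD_10P h hp h7 ez bz c c'
  · rw [hM20]
    simp [LB, GB, hat, koD_top]

/-! ### The relations on Hodge multisets of level `20p` -/

/-- **Koblitz–Ogus, functional form:** a linear functional on `ℚ^{ℤ/20p}` that kills the negation-invariant functions and all
distribution vectors kills the multiplicity function of every Hodge multiset (the tree's PROVED
`KoblitzOgus.hodge_eq_combination`; as in `KoblitzOgusRelationsTenPrime`). [cite: Deligne1982HodgeCycles, Rem. 7.16 (a)] -/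
private theorem functional_count_eq_zero [NeZero (20 * p)] {s : Multiset (ZMod (20 * p))} (hs : IsHodgeMultiset s)
    (L : (ZMod (20 * p) → ℚ) → ℚ)
    (hadd : ∀ g g' : ZMod (20 * p) → ℚ, L (fun z ↦ g z + g' z) = L g + L g')
    (hmul : ∀ (a : ℚ) (g : ZMod (20 * p) → ℚ), L (fun z ↦ a * g z) = a * L g)
    (hsum : ∀ {ι : Type} (t : Finset ι) (g : ι → ZMod (20 * p) → ℚ), L (fun z ↦ ∑ i ∈ t, g i z) = ∑ i ∈ t, L (g i))
    (heven : ∀ g : ZMod (20 * p) → ℚ, (∀ z, g (-z) = g z) → L g = 0)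
    (hko : ∀ M ∈ (20 * p).divisors, ∀ y : ZMod (20 * p), L (koD (20 * p) M y) = 0) :
    L (fun w ↦ (count w s : ℚ)) = 0 := by
  classical
  obtain ⟨cr, cd, hrep⟩ := Literature.NumberTheory.Transcendental.KoblitzOgus.hodge_eq_combination
    (N := 20 * p) (fun x ↦ (count x s : ℚ)) (fun u hu ↦ hs.sum_count_mul_bern_eq_zero hu)
  have hf : (fun w ↦ (count w s : ℚ)) =
      fun w ↦ (∑ a : ZMod (20 * p), cr a * ((if a = w then (1 : ℚ) else 0) + (if -a = w then 1 else 0))) +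
        ∑ M ∈ (20 * p).divisors, ∑ y : ZMod (20 * p), cd M y * koD (20 * p) M y w := funext hrep
  rw [hf, hadd, hsum, hsum]
  have hA : ∀ a : ZMod (20 * p),
      L (fun w ↦ cr a * ((if a = w then (1 : ℚ) else 0) + (if -a = w then 1 else 0))) = 0 := fun a ↦ by
    rw [hmul, heven _ fun w ↦ ?_, mul_zero]
    rw [add_comm]
    congr 1
    · simp only [neg_inj]
    · simp only [eq_neg_iff_add_eq_zero, neg_eq_iff_add_eq_zero]
  have hB : ∀ M ∈ (20 * p).divisors, L (fun w ↦ ∑ y : ZMod (20 * p), cd M y * koD (20 * p) M y w) = 0 :=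
    fun M hM ↦ by
      rw [hsum]
      refine Finset.sum_eq_zero fun y _ ↦ ?_
      rw [hmul, hko M hM y, mul_zero]
  rw [Finset.sum_eq_zero fun a _ ↦ hA a, Finset.sum_eq_zero hB, add_zero]

/-- `R1` kills the multiplicity function of every Hodge multiset. [cite: Deligne1982HodgeCycles, Rem. 7.16 (a)] -/
private theorem R1_count_eq_zero (h : Nat.Coprime 20 p) [NeZero (20 * p)] (hp : p.Prime) (h7 : 7 ≤ p)
    {s : Multiset (ZMod (20 * p))} (hs : IsHodgeMultiset s) {c : ZMod p} (hc : c ≠ 0) :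
    R1 h (fun w ↦ (count w s : ℚ)) c = 0 := by
  have lin := R1_linear h c
  exact functional_count_eq_zero hs (fun g ↦ R1 h g c) lin.1 lin.2.1 (fun t g ↦ lin.2.2.1 t g) lin.2.2.2
    (fun M hM y ↦ R1_koD h hp h7 hM y hc)

/-- `Rchi` kills the multiplicity function of every Hodge multiset. [cite: Deligne1982HodgeCycles, Rem. 7.16 (a)] -/
private theorem Rchi_count_eq_zero (h : Nat.Coprime 20 p) [NeZero (20 * p)] (hp : p.Prime) (h7 : 7 ≤ p)
    {s : Multiset (ZMod (20 * p))} (hs : IsHodgeMultiset s) {c : ZMod p} (hc : c ≠ 0) :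
    Rchi h (fun w ↦ (count w s : ℚ)) c = 0 := by
  have lin := Rchi_linear h c
  exact functional_count_eq_zero hs (fun g ↦ Rchi h g c) lin.1 lin.2.1 (fun t g ↦ lin.2.2.1 t g) lin.2.2.2
    (fun M hM y ↦ Rchi_koD h hp h7 hM y hc)

/-- `Z1` kills the multiplicity function of every Hodge multiset. [cite: Deligne1982HodgeCycles, Rem. 7.16 (a)] -/
private theorem Z1_count_eq_zero (h : Nat.Coprime 20 p) [NeZero (20 * p)] (hp : p.Prime) (h7 : 7 ≤ p)
    {s : Multiset (ZMod (20 * p))} (hs : IsHodgeMultiset s) {c : ZMod p} (hc : c ≠ 0) :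
    Z1 h (fun w ↦ (count w s : ℚ)) c = 0 := by
  have lin := Z1_linear h c
  exact functional_count_eq_zero hs (fun g ↦ Z1 h g c) lin.1 lin.2.1 (fun t g ↦ lin.2.2.1 t g) lin.2.2.2
    (fun M hM y ↦ Z1_koD h hp h7 hM y hc)

/-- `Z3` kills the multiplicity function of every Hodge multiset. [cite: Deligne1982HodgeCycles, Rem. 7.16 (a)] -/
private theorem Z3_count_eq_zero (h : Nat.Coprime 20 p) [NeZero (20 * p)] (hp : p.Prime) (h7 : 7 ≤ p)
    {s : Multiset (ZMod (20 * p))} (hs : IsHodgeMultiset s) {c : ZMod p} (hc : c ≠ 0) :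
    Z3 h (fun w ↦ (count w s : ℚ)) c = 0 := by
  have lin := Z3_linear h c
  exact functional_count_eq_zero hs (fun g ↦ Z3 h g c) lin.1 lin.2.1 (fun t g ↦ lin.2.2.1 t g) lin.2.2.2
    (fun M hM y ↦ Z3_koD h hp h7 hM y hc)

/-- `L4` kills the multiplicity function of every Hodge multiset. [cite: Deligne1982HodgeCycles, Rem. 7.16 (a)] -/
private theorem L4_count_eq_zero (h : Nat.Coprime 20 p) [NeZero (20 * p)] (hp : p.Prime) (h7 : 7 ≤ p)
    {s : Multiset (ZMod (20 * p))} (hs : IsHodgeMultiset s) {c c' : ZMod p} (hc : c ≠ 0) (hc' : c' ≠ 0) :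
    L4 h (fun w ↦ (count w s : ℚ)) c c' = 0 := by
  have lin := L4_linear h c c'
  exact functional_count_eq_zero hs (fun g ↦ L4 h g c c') lin.1 lin.2.1 (fun t g ↦ lin.2.2.1 t g) lin.2.2.2
    (fun M hM y ↦ L4_koD h hp h7 hM y hc hc')

/-- `L45` kills the multiplicity function of every Hodge multiset. [cite: Deligne1982HodgeCycles, Rem. 7.16 (a)] -/
private theorem L45_count_eq_zero (h : Nat.Coprime 20 p) [NeZero (20 * p)] (hp : p.Prime) (h7 : 7 ≤ p)
    {s : Multiset (ZMod (20 * p))} (hs : IsHodgeMultiset s) {c c' : ZMod p} (hc : c ≠ 0) (hc' : c' ≠ 0) :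
    L45 h (fun w ↦ (count w s : ℚ)) c c' = 0 := by
  have lin := L45_linear h c c'
  exact functional_count_eq_zero hs (fun g ↦ L45 h g c c') lin.1 lin.2.1 (fun t g ↦ lin.2.2.1 t g) lin.2.2.2
    (fun M hM y ↦ L45_koD h hp h7 hM y hc hc')

/-- `LA` kills the multiplicity function of every Hodge multiset. [cite: Deligne1982HodgeCycles, Rem. 7.16 (a)] -/
private theorem LA_count_eq_zero (h : Nat.Coprime 20 p) [NeZero (20 * p)] (hp : p.Prime) (h7 : 7 ≤ p)
    {s : Multiset (ZMod (20 * p))} (hs : IsHodgeMultiset s) {c c' : ZMod p} (hc : c ≠ 0) (hc' : c' ≠ 0) :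
    LA h (fun w ↦ (count w s : ℚ)) c c' = 0 := by
  have lin := LA_linear h c c'
  exact functional_count_eq_zero hs (fun g ↦ LA h g c c') lin.1 lin.2.1 (fun t g ↦ lin.2.2.1 t g) lin.2.2.2
    (fun M hM y ↦ LA_koD h hp h7 hM y hc hc')

/-- `LB` kills the multiplicity function of every Hodge multiset. [cite: Deligne1982HodgeCycles, Rem. 7.16 (a)] -/
private theorem LB_count_eq_zero (h : Nat.Coprime 20 p) [NeZero (20 * p)] (hp : p.Prime) (h7 : 7 ≤ p)
    {s : Multiset (ZMod (20 * p))} (hs : IsHodgeMultiset s) {c c' : ZMod p} (hc : c ≠ 0) (hc' : c' ≠ 0) :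
    LB h (fun w ↦ (count w s : ℚ)) c c' = 0 := by
  have lin := LB_linear h c c'
  exact functional_count_eq_zero hs (fun g ↦ LB h g c c') lin.1 lin.2.1 (fun t g ↦ lin.2.2.1 t g) lin.2.2.2
    (fun M hM y ↦ LB_koD h hp h7 hM y hc hc')

/-! ### Public statements -/

/-- The residue of `ℤ/20p` with Chinese-remainder coordinates `(u, c) ∈ ℤ/20 × ℤ/p` (plumbing for the statements below). [folklore] -/
def crtPt20 (h : Nat.Coprime 20 p) (u : ZMod 20) (c : ZMod p) : ZMod (20 * p) := (ZMod.chineseRemainder h).symm (u, c)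

/-- `crtPt20` is the private `pt`. [folklore] -/
private theorem crtPt20_eq (h : Nat.Coprime 20 p) (u : ZMod 20) (c : ZMod p) : crtPt20 h u c = pt h u c := rfl

/-- `ĝ` of the multiplicity function is the tree's `oddCt`, cast to `ℚ`. [folklore] -/
private theorem hat_count_eq (s : Multiset (ZMod (20 * p))) (w : ZMod (20 * p)) :
    hat (fun w ↦ (count w s : ℚ)) w = (oddCt s w : ℚ) := by
  simp only [hat, oddCt, Int.cast_sub, Int.cast_natCast]

/-- **First Koblitz–Ogus relation at level `20p`** (the odd characters of conductor `p`): for every Hodge multiset `s` of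
level `20p`, `p ≥ 7` prime, and every `c ≢ 0 (mod p)`, with `ô(u, c) = #_{(u,c)}(s) − #_{(−u,−c)}(s)` in the coordinates
`ℤ/20p ≅ ℤ/20 × ℤ/p`: `Σ_{u∈U} (ô(u,c) − ô(u,2c) − ô(u,5c) + ô(u,10c)) + 2Σ_{e∈E₂} (ô(e,2c) − ô(e,4c) − ô(e,10c) + ô(e,20c))
+ 2Σ_{f∈E₄} (ô(f,4c) − ô(f,20c)) + 4Σ_{v∈F} (ô(v,5c) − ô(v,10c)) + 8(ô(10,10c) − ô(10,20c)) + 8ô(0,20c) = 0`.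
[cite: Deligne1982HodgeCycles, Rem. 7.16 (a)] [cite: Aoki1983, Prop. 2.2] [cite: Shioda1982PicardFermat, §3 p. 727] -/
theorem relOne_twentyPrime [NeZero (20 * p)] (hp : p.Prime) (h7 : 7 ≤ p) (h : Nat.Coprime 20 p)
    {s : Multiset (ZMod (20 * p))} (hs : IsHodgeMultiset s) {c : ZMod p} (hc : c ≠ 0) :
    oddCt s (crtPt20 h 1 c) - oddCt s (crtPt20 h 1 (2 * c)) - oddCt s (crtPt20 h 1 (5 * c)) + oddCt s (crtPt20 h 1
      (10 * c)) + oddCt s (crtPt20 h 3 c) - oddCt s (crtPt20 h 3 (2 * c)) - oddCt s (crtPt20 h 3 (5 * c)) + oddCt s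
      (crtPt20 h 3 (10 * c)) + oddCt s (crtPt20 h 7 c) - oddCt s (crtPt20 h 7 (2 * c)) - oddCt s (crtPt20 h 7 (5 *
      c)) + oddCt s (crtPt20 h 7 (10 * c)) + oddCt s (crtPt20 h 9 c) - oddCt s (crtPt20 h 9 (2 * c)) - oddCt s
      (crtPt20 h 9 (5 * c)) + oddCt s (crtPt20 h 9 (10 * c)) + oddCt s (crtPt20 h 11 c) - oddCt s (crtPt20 h 11 (2 *
      c)) - oddCt s (crtPt20 h 11 (5 * c)) + oddCt s (crtPt20 h 11 (10 * c)) + oddCt s (crtPt20 h 13 c) - oddCt s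
      (crtPt20 h 13 (2 * c)) - oddCt s (crtPt20 h 13 (5 * c)) + oddCt s (crtPt20 h 13 (10 * c)) + oddCt s (crtPt20 h
      17 c) - oddCt s (crtPt20 h 17 (2 * c)) - oddCt s (crtPt20 h 17 (5 * c)) + oddCt s (crtPt20 h 17 (10 * c)) +
      oddCt s (crtPt20 h 19 c) - oddCt s (crtPt20 h 19 (2 * c)) - oddCt s (crtPt20 h 19 (5 * c)) + oddCt s (crtPt20
      h 19 (10 * c)) + 2 * oddCt s (crtPt20 h 2 (2 * c)) - 2 * oddCt s (crtPt20 h 2 (4 * c)) - 2 * oddCt s (crtPt20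
      h 2 (10 * c)) + 2 * oddCt s (crtPt20 h 2 (20 * c)) + 2 * oddCt s (crtPt20 h 6 (2 * c)) - 2 * oddCt s (crtPt20
      h 6 (4 * c)) - 2 * oddCt s (crtPt20 h 6 (10 * c)) + 2 * oddCt s (crtPt20 h 6 (20 * c)) + 2 * oddCt s (crtPt20
      h 14 (2 * c)) - 2 * oddCt s (crtPt20 h 14 (4 * c)) - 2 * oddCt s (crtPt20 h 14 (10 * c)) + 2 * oddCt s
      (crtPt20 h 14 (20 * c)) + 2 * oddCt s (crtPt20 h 18 (2 * c)) - 2 * oddCt s (crtPt20 h 18 (4 * c)) - 2 * oddCt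
      s (crtPt20 h 18 (10 * c)) + 2 * oddCt s (crtPt20 h 18 (20 * c)) + 2 * oddCt s (crtPt20 h 4 (4 * c)) - 2 *
      oddCt s (crtPt20 h 4 (20 * c)) + 2 * oddCt s (crtPt20 h 8 (4 * c)) - 2 * oddCt s (crtPt20 h 8 (20 * c)) + 2 *
      oddCt s (crtPt20 h 12 (4 * c)) - 2 * oddCt s (crtPt20 h 12 (20 * c)) + 2 * oddCt s (crtPt20 h 16 (4 * c)) - 2
      * oddCt s (crtPt20 h 16 (20 * c)) + 4 * oddCt s (crtPt20 h 5 (5 * c)) - 4 * oddCt s (crtPt20 h 5 (10 * c)) + 4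
      * oddCt s (crtPt20 h 15 (5 * c)) - 4 * oddCt s (crtPt20 h 15 (10 * c)) + 8 * oddCt s (crtPt20 h 10 (10 * c)) -
      8 * oddCt s (crtPt20 h 10 (20 * c)) + 8 * oddCt s (crtPt20 h 0 (20 * c)) = 0 := by
  have key := R1_count_eq_zero h hp h7 hs hc
  simp only [R1, hat_count_eq, ← crtPt20_eq] at key
  have key' : ((
      oddCt s (crtPt20 h 1 c) - oddCt s (crtPt20 h 1 (2 * c)) - oddCt s (crtPt20 h 1 (5 * c)) + oddCt s (crtPt20 h 1
        (10 * c)) + oddCt s (crtPt20 h 3 c) - oddCt s (crtPt20 h 3 (2 * c)) - oddCt s (crtPt20 h 3 (5 * c)) + oddCt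
        s (crtPt20 h 3 (10 * c)) + oddCt s (crtPt20 h 7 c) - oddCt s (crtPt20 h 7 (2 * c)) - oddCt s (crtPt20 h 7 (5
        * c)) + oddCt s (crtPt20 h 7 (10 * c)) + oddCt s (crtPt20 h 9 c) - oddCt s (crtPt20 h 9 (2 * c)) - oddCt s
        (crtPt20 h 9 (5 * c)) + oddCt s (crtPt20 h 9 (10 * c)) + oddCt s (crtPt20 h 11 c) - oddCt s (crtPt20 h 11 (2
        * c)) - oddCt s (crtPt20 h 11 (5 * c)) + oddCt s (crtPt20 h 11 (10 * c)) + oddCt s (crtPt20 h 13 c) - oddCt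
        s (crtPt20 h 13 (2 * c)) - oddCt s (crtPt20 h 13 (5 * c)) + oddCt s (crtPt20 h 13 (10 * c)) + oddCt s
        (crtPt20 h 17 c) - oddCt s (crtPt20 h 17 (2 * c)) - oddCt s (crtPt20 h 17 (5 * c)) + oddCt s (crtPt20 h 17
        (10 * c)) + oddCt s (crtPt20 h 19 c) - oddCt s (crtPt20 h 19 (2 * c)) - oddCt s (crtPt20 h 19 (5 * c)) +
        oddCt s (crtPt20 h 19 (10 * c)) + 2 * oddCt s (crtPt20 h 2 (2 * c)) - 2 * oddCt s (crtPt20 h 2 (4 * c)) - 2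
        * oddCt s (crtPt20 h 2 (10 * c)) + 2 * oddCt s (crtPt20 h 2 (20 * c)) + 2 * oddCt s (crtPt20 h 6 (2 * c)) -
        2 * oddCt s (crtPt20 h 6 (4 * c)) - 2 * oddCt s (crtPt20 h 6 (10 * c)) + 2 * oddCt s (crtPt20 h 6 (20 * c))
        + 2 * oddCt s (crtPt20 h 14 (2 * c)) - 2 * oddCt s (crtPt20 h 14 (4 * c)) - 2 * oddCt s (crtPt20 h 14 (10 *
        c)) + 2 * oddCt s (crtPt20 h 14 (20 * c)) + 2 * oddCt s (crtPt20 h 18 (2 * c)) - 2 * oddCt s (crtPt20 h 18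
        (4 * c)) - 2 * oddCt s (crtPt20 h 18 (10 * c)) + 2 * oddCt s (crtPt20 h 18 (20 * c)) + 2 * oddCt s (crtPt20
        h 4 (4 * c)) - 2 * oddCt s (crtPt20 h 4 (20 * c)) + 2 * oddCt s (crtPt20 h 8 (4 * c)) - 2 * oddCt s (crtPt20
        h 8 (20 * c)) + 2 * oddCt s (crtPt20 h 12 (4 * c)) - 2 * oddCt s (crtPt20 h 12 (20 * c)) + 2 * oddCt s
        (crtPt20 h 16 (4 * c)) - 2 * oddCt s (crtPt20 h 16 (20 * c)) + 4 * oddCt s (crtPt20 h 5 (5 * c)) - 4 * oddCt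
        s (crtPt20 h 5 (10 * c)) + 4 * oddCt s (crtPt20 h 15 (5 * c)) - 4 * oddCt s (crtPt20 h 15 (10 * c)) + 8 *
        oddCt s (crtPt20 h 10 (10 * c)) - 8 * oddCt s (crtPt20 h 10 (20 * c)) + 8 * oddCt s (crtPt20 h 0 (20 * c)) :
        ℤ) : ℚ) = 0 := by
    push_cast
    linear_combination key
  exact_mod_cast key'

/-- **Second Koblitz–Ogus relation at level `20p`** (the odd characters `χ₅ψ`, `χ₅ = (·/5)`): for every Hodge multiset `s` of
level `20p`, `p ≥ 7` prime, and every `c ≢ 0 (mod p)`: `Σ_{u∈U} χ₅(u)(ô(u,c) + ô(u,2c)) + 2Σ_{e∈E₂} χ₅(e/2)(ô(e,2c) + ô(e,4c))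
+ 2Σ_{f∈E₄} χ₅(f/4) ô(f,4c) = 0`.
[cite: Deligne1982HodgeCycles, Rem. 7.16 (a)] [cite: Aoki1983, Prop. 2.2] [cite: Shioda1982PicardFermat, §3 p. 727] -/
theorem relChi5_twentyPrime [NeZero (20 * p)] (hp : p.Prime) (h7 : 7 ≤ p) (h : Nat.Coprime 20 p)
    {s : Multiset (ZMod (20 * p))} (hs : IsHodgeMultiset s) {c : ZMod p} (hc : c ≠ 0) :
    oddCt s (crtPt20 h 1 c) - oddCt s (crtPt20 h 3 c) - oddCt s (crtPt20 h 7 c) + oddCt s (crtPt20 h 9 c) + oddCt s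
      (crtPt20 h 11 c) - oddCt s (crtPt20 h 13 c) - oddCt s (crtPt20 h 17 c) + oddCt s (crtPt20 h 19 c) + oddCt s
      (crtPt20 h 1 (2 * c)) - oddCt s (crtPt20 h 3 (2 * c)) - oddCt s (crtPt20 h 7 (2 * c)) + oddCt s (crtPt20 h 9
      (2 * c)) + oddCt s (crtPt20 h 11 (2 * c)) - oddCt s (crtPt20 h 13 (2 * c)) - oddCt s (crtPt20 h 17 (2 * c)) +
      oddCt s (crtPt20 h 19 (2 * c)) + 2 * oddCt s (crtPt20 h 2 (2 * c)) - 2 * oddCt s (crtPt20 h 6 (2 * c)) - 2 *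
      oddCt s (crtPt20 h 14 (2 * c)) + 2 * oddCt s (crtPt20 h 18 (2 * c)) + 2 * oddCt s (crtPt20 h 2 (4 * c)) - 2 *
      oddCt s (crtPt20 h 6 (4 * c)) - 2 * oddCt s (crtPt20 h 14 (4 * c)) + 2 * oddCt s (crtPt20 h 18 (4 * c)) + 2 *
      oddCt s (crtPt20 h 4 (4 * c)) - 2 * oddCt s (crtPt20 h 8 (4 * c)) - 2 * oddCt s (crtPt20 h 12 (4 * c)) + 2 *
      oddCt s (crtPt20 h 16 (4 * c)) = 0 := by
  have key := Rchi_count_eq_zero h hp h7 hs hc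
  simp only [Rchi, hat_count_eq, ← crtPt20_eq] at key
  have key' : ((
      oddCt s (crtPt20 h 1 c) - oddCt s (crtPt20 h 3 c) - oddCt s (crtPt20 h 7 c) + oddCt s (crtPt20 h 9 c) + oddCt
        s (crtPt20 h 11 c) - oddCt s (crtPt20 h 13 c) - oddCt s (crtPt20 h 17 c) + oddCt s (crtPt20 h 19 c) + oddCt
        s (crtPt20 h 1 (2 * c)) - oddCt s (crtPt20 h 3 (2 * c)) - oddCt s (crtPt20 h 7 (2 * c)) + oddCt s (crtPt20 h
        9 (2 * c)) + oddCt s (crtPt20 h 11 (2 * c)) - oddCt s (crtPt20 h 13 (2 * c)) - oddCt s (crtPt20 h 17 (2 *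
        c)) + oddCt s (crtPt20 h 19 (2 * c)) + 2 * oddCt s (crtPt20 h 2 (2 * c)) - 2 * oddCt s (crtPt20 h 6 (2 * c))
        - 2 * oddCt s (crtPt20 h 14 (2 * c)) + 2 * oddCt s (crtPt20 h 18 (2 * c)) + 2 * oddCt s (crtPt20 h 2 (4 *
        c)) - 2 * oddCt s (crtPt20 h 6 (4 * c)) - 2 * oddCt s (crtPt20 h 14 (4 * c)) + 2 * oddCt s (crtPt20 h 18 (4
        * c)) + 2 * oddCt s (crtPt20 h 4 (4 * c)) - 2 * oddCt s (crtPt20 h 8 (4 * c)) - 2 * oddCt s (crtPt20 h 12 (4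
        * c)) + 2 * oddCt s (crtPt20 h 16 (4 * c)) : ℤ) : ℚ) = 0 := by
    push_cast
    linear_combination key
  exact_mod_cast key'

/-- **Third Koblitz–Ogus relation at level `20p`** (the odd characters `χ₋₄χ₄^{±1}ψ`, first real form; a single fibre): for every
Hodge multiset `s` of level `20p`, `p ≥ 7` prime, and every `c ≢ 0 (mod p)`: `ô(1,c) − ô(9,c) − ô(11,c) + ô(19,c) = 0` — the
function `c ↦ ô(1,c) − ô(9,c)` is even.
[cite: Deligne1982HodgeCycles, Rem. 7.16 (a)] [cite: Aoki1983, Prop. 2.2] [cite: Shioda1982PicardFermat, §3 p. 727] -/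
theorem relOneNine_twentyPrime [NeZero (20 * p)] (hp : p.Prime) (h7 : 7 ≤ p) (h : Nat.Coprime 20 p)
    {s : Multiset (ZMod (20 * p))} (hs : IsHodgeMultiset s) {c : ZMod p} (hc : c ≠ 0) :
    oddCt s (crtPt20 h 1 c) - oddCt s (crtPt20 h 9 c) - oddCt s (crtPt20 h 11 c) + oddCt s (crtPt20 h 19 c) = 0 :=
      by
  have key := Z1_count_eq_zero h hp h7 hs hc
  simp only [Z1, hat_count_eq, ← crtPt20_eq] at key
  have key' : ((
      oddCt s (crtPt20 h 1 c) - oddCt s (crtPt20 h 9 c) - oddCt s (crtPt20 h 11 c) + oddCt s (crtPt20 h 19 c) : ℤ) :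
        ℚ) = 0 := by
    push_cast
    linear_combination key
  exact_mod_cast key'

/-- **Fourth Koblitz–Ogus relation at level `20p`** (second real form; a single fibre): for every Hodge multiset `s` of level
`20p`, `p ≥ 7` prime, and every `c ≢ 0 (mod p)`: `ô(3,c) − ô(7,c) − ô(13,c) + ô(17,c) = 0`.
[cite: Deligne1982HodgeCycles, Rem. 7.16 (a)] [cite: Aoki1983, Prop. 2.2] [cite: Shioda1982PicardFermat, §3 p. 727] -/
theorem relThreeSeven_twentyPrime [NeZero (20 * p)] (hp : p.Prime) (h7 : 7 ≤ p) (h : Nat.Coprime 20 p)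
    {s : Multiset (ZMod (20 * p))} (hs : IsHodgeMultiset s) {c : ZMod p} (hc : c ≠ 0) :
    oddCt s (crtPt20 h 3 c) - oddCt s (crtPt20 h 7 c) - oddCt s (crtPt20 h 13 c) + oddCt s (crtPt20 h 17 c) = 0 :=
      by
  have key := Z3_count_eq_zero h hp h7 hs hc
  simp only [Z3, hat_count_eq, ← crtPt20_eq] at key
  have key' : ((
      oddCt s (crtPt20 h 3 c) - oddCt s (crtPt20 h 7 c) - oddCt s (crtPt20 h 13 c) + oddCt s (crtPt20 h 17 c) : ℤ) :
        ℚ) = 0 := by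
    push_cast
    linear_combination key
  exact_mod_cast key'

/-- `Γ₋₄(c) = Σ_{u∈U} χ₋₄(u)(ô(u,c) − ô(u,5c)) + 4(ô(5,5c) − ô(15,5c))` of a multiset `s` of level `20p` (`χ₋₄(u) = ±1` for
`u ≡ ±1 (mod 4)`), written out. [folklore] -/
def gammaM4Sum20 (h : Nat.Coprime 20 p) (s : Multiset (ZMod (20 * p))) (c : ZMod p) : ℤ :=
  oddCt s (crtPt20 h 1 c) - oddCt s (crtPt20 h 3 c) - oddCt s (crtPt20 h 7 c) + oddCt s (crtPt20 h 9 c) - oddCt s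
    (crtPt20 h 11 c) + oddCt s (crtPt20 h 13 c) + oddCt s (crtPt20 h 17 c) - oddCt s (crtPt20 h 19 c) - oddCt s
    (crtPt20 h 1 (5 * c)) + oddCt s (crtPt20 h 3 (5 * c)) + oddCt s (crtPt20 h 7 (5 * c)) - oddCt s (crtPt20 h 9 (5
    * c)) + oddCt s (crtPt20 h 11 (5 * c)) - oddCt s (crtPt20 h 13 (5 * c)) - oddCt s (crtPt20 h 17 (5 * c)) + oddCt
    s (crtPt20 h 19 (5 * c)) + 4 * oddCt s (crtPt20 h 5 (5 * c)) - 4 * oddCt s (crtPt20 h 15 (5 * c))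

/-- `G4` of the multiplicity function is `gammaM4Sum20`. [folklore] -/
private theorem G4_count_eq (h : Nat.Coprime 20 p) (s : Multiset (ZMod (20 * p))) (c : ZMod p) :
    G4 h (fun w ↦ (count w s : ℚ)) c = (gammaM4Sum20 h s c : ℚ) := by
  simp only [G4, hat_count_eq, ← crtPt20_eq, gammaM4Sum20]
  push_cast
  ring

/-- **Koblitz–Ogus relation of the character `χ₋₄` at level `20p`** (`p ≥ 7` prime): `Γ₋₄(c) = Γ₋₄(c′)` for all
`c, c′ ≢ 0 (mod p)` (`gammaM4Sum20`). [cite: Deligne1982HodgeCycles, Rem. 7.16 (a)] [cite: Aoki1983, Prop. 2.2] [cite: Shioda1982PicardFermat, §3 p. 727] -/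
theorem gammaM4_twentyPrime [NeZero (20 * p)] (hp : p.Prime) (h7 : 7 ≤ p) (h : Nat.Coprime 20 p)
    {s : Multiset (ZMod (20 * p))} (hs : IsHodgeMultiset s) {c c' : ZMod p} (hc : c ≠ 0) (hc' : c' ≠ 0) :
    gammaM4Sum20 h s c = gammaM4Sum20 h s c' := by
  have key := L4_count_eq_zero h hp h7 hs hc hc'
  rw [L4, G4_count_eq, G4_count_eq, sub_eq_zero] at key
  exact_mod_cast key

/-- `Γ₋₄χ₅(c) = Σ_{u∈{1,3,7,9}} ô(u,c) − Σ_{u∈{11,13,17,19}} ô(u,c)` of a multiset `s` of level `20p` (a single fibre), written out. [folklore] -/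
def gammaM4Chi5Sum20 (h : Nat.Coprime 20 p) (s : Multiset (ZMod (20 * p))) (c : ZMod p) : ℤ :=
  oddCt s (crtPt20 h 1 c) + oddCt s (crtPt20 h 3 c) + oddCt s (crtPt20 h 7 c) + oddCt s (crtPt20 h 9 c) - oddCt s
    (crtPt20 h 11 c) - oddCt s (crtPt20 h 13 c) - oddCt s (crtPt20 h 17 c) - oddCt s (crtPt20 h 19 c)

/-- `G45` of the multiplicity function is `gammaM4Chi5Sum20`. [folklore] -/
private theorem G45_count_eq (h : Nat.Coprime 20 p) (s : Multiset (ZMod (20 * p))) (c : ZMod p) :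
    G45 h (fun w ↦ (count w s : ℚ)) c = (gammaM4Chi5Sum20 h s c : ℚ) := by
  simp only [G45, hat_count_eq, ← crtPt20_eq, gammaM4Chi5Sum20]
  push_cast
  ring

/-- **Koblitz–Ogus relation of the character `χ₋₄χ₅` at level `20p`** (`p ≥ 7` prime): the signed number of members of residue
`1, 3, 7, 9 (mod 20)` minus that of residue `11, 13, 17, 19` over the fibres `±c` is independent of `c ≢ 0` (`gammaM4Chi5Sum20`). [cite: Deligne1982HodgeCycles, Rem. 7.16 (a)] [cite: Aoki1983, Prop. 2.2] [cite: Shioda1982PicardFermat, §3 p. 727] -/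
theorem gammaM4Chi5_twentyPrime [NeZero (20 * p)] (hp : p.Prime) (h7 : 7 ≤ p) (h : Nat.Coprime 20 p)
    {s : Multiset (ZMod (20 * p))} (hs : IsHodgeMultiset s) {c c' : ZMod p} (hc : c ≠ 0) (hc' : c' ≠ 0) :
    gammaM4Chi5Sum20 h s c = gammaM4Chi5Sum20 h s c' := by
  have key := L45_count_eq_zero h hp h7 hs hc hc'
  rw [L45, G45_count_eq, G45_count_eq, sub_eq_zero] at key
  exact_mod_cast key

/-- `Γ_A(c)` of a multiset `s` of level `20p` (the first real form of the `χ₄^{±1}`-family; fibres `c, 2c, 4c`), written out. [folklore] -/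
def gammaASum20 (h : Nat.Coprime 20 p) (s : Multiset (ZMod (20 * p))) (c : ZMod p) : ℤ :=
  -oddCt s (crtPt20 h 1 c) + oddCt s (crtPt20 h 9 c) - oddCt s (crtPt20 h 11 c) + oddCt s (crtPt20 h 19 c) - oddCt s
    (crtPt20 h 3 (2 * c)) + oddCt s (crtPt20 h 7 (2 * c)) - oddCt s (crtPt20 h 13 (2 * c)) + oddCt s (crtPt20 h 17
    (2 * c)) - 2 * oddCt s (crtPt20 h 2 (2 * c)) + 2 * oddCt s (crtPt20 h 18 (2 * c)) - 2 * oddCt s (crtPt20 h 4 (4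
    * c)) - 2 * oddCt s (crtPt20 h 6 (4 * c)) + 2 * oddCt s (crtPt20 h 14 (4 * c)) + 2 * oddCt s (crtPt20 h 16 (4 *
    c))

/-- `GA` of the multiplicity function is `gammaASum20`. [folklore] -/
private theorem GA_count_eq (h : Nat.Coprime 20 p) (s : Multiset (ZMod (20 * p))) (c : ZMod p) :
    GA h (fun w ↦ (count w s : ℚ)) c = (gammaASum20 h s c : ℚ) := by
  simp only [GA, hat_count_eq, ← crtPt20_eq, gammaASum20]
  push_cast
  ring

/-- **Koblitz–Ogus relation of the odd quartic characters mod `5` at level `20p`, first real form** (`p ≥ 7` prime):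
`Γ_A(c) = Γ_A(c′)` for all `c, c′ ≢ 0 (mod p)` (`gammaASum20`). [cite: Deligne1982HodgeCycles, Rem. 7.16 (a)] [cite: Aoki1983, Prop. 2.2] [cite: Shioda1982PicardFermat, §3 p. 727] -/
theorem gammaA_twentyPrime [NeZero (20 * p)] (hp : p.Prime) (h7 : 7 ≤ p) (h : Nat.Coprime 20 p)
    {s : Multiset (ZMod (20 * p))} (hs : IsHodgeMultiset s) {c c' : ZMod p} (hc : c ≠ 0) (hc' : c' ≠ 0) :
    gammaASum20 h s c = gammaASum20 h s c' := by
  have key := LA_count_eq_zero h hp h7 hs hc hc'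
  rw [LA, GA_count_eq, GA_count_eq, sub_eq_zero] at key
  exact_mod_cast key

/-- `Γ_B(c)` of a multiset `s` of level `20p` (the second real form of the `χ₄^{±1}`-family), written out. [folklore] -/
def gammaBSum20 (h : Nat.Coprime 20 p) (s : Multiset (ZMod (20 * p))) (c : ZMod p) : ℤ :=
  oddCt s (crtPt20 h 3 c) - oddCt s (crtPt20 h 7 c) + oddCt s (crtPt20 h 13 c) - oddCt s (crtPt20 h 17 c) - oddCt s
    (crtPt20 h 1 (2 * c)) + oddCt s (crtPt20 h 9 (2 * c)) - oddCt s (crtPt20 h 11 (2 * c)) + oddCt s (crtPt20 h 19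
    (2 * c)) + 2 * oddCt s (crtPt20 h 6 (2 * c)) - 2 * oddCt s (crtPt20 h 14 (2 * c)) - 2 * oddCt s (crtPt20 h 2 (4
    * c)) - 2 * oddCt s (crtPt20 h 8 (4 * c)) + 2 * oddCt s (crtPt20 h 12 (4 * c)) + 2 * oddCt s (crtPt20 h 18 (4 *
    c))

/-- `GB` of the multiplicity function is `gammaBSum20`. [folklore] -/
private theorem GB_count_eq (h : Nat.Coprime 20 p) (s : Multiset (ZMod (20 * p))) (c : ZMod p) :
    GB h (fun w ↦ (count w s : ℚ)) c = (gammaBSum20 h s c : ℚ) := by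
  simp only [GB, hat_count_eq, ← crtPt20_eq, gammaBSum20]
  push_cast
  ring

/-- **Koblitz–Ogus relation of the odd quartic characters mod `5` at level `20p`, second real form** (`p ≥ 7` prime):
`Γ_B(c) = Γ_B(c′)` for all `c, c′ ≢ 0 (mod p)` (`gammaBSum20`). [cite: Deligne1982HodgeCycles, Rem. 7.16 (a)] [cite: Aoki1983, Prop. 2.2] [cite: Shioda1982PicardFermat, §3 p. 727] -/
theorem gammaB_twentyPrime [NeZero (20 * p)] (hp : p.Prime) (h7 : 7 ≤ p) (h : Nat.Coprime 20 p)
    {s : Multiset (ZMod (20 * p))} (hs : IsHodgeMultiset s) {c c' : ZMod p} (hc : c ≠ 0) (hc' : c' ≠ 0) :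
    gammaBSum20 h s c = gammaBSum20 h s c' := by
  have key := LB_count_eq_zero h hp h7 hs hc hc'
  rw [LB, GB_count_eq, GB_count_eq, sub_eq_zero] at key
  exact_mod_cast key

end TwentyPrime

end Literature.AlgebraicGeometry.Shioda1982
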